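import Literature.Topology.FourManifolds.ConjugationQuotientsLocalTheory
import Mathlib.Analysis.Calculus.MeanValue
import HarnessLib
import Mathlib.Analysis.InnerProductSpace.Calculus
import Mathlib.Analysis.SpecialFunctions.Pow.Complex
import Literature.Geometry.Manifold.ChartInverseFunctionTheorem
import Literature.Topology.ProperLocalHomeomorph
import Literature.Topology.FourManifolds.ConjugationQuotients

/-!
# Uniqueness of the smooth branched double quotient `X/conj`: the proof

Topic `Topology/FourManifolds`; namespace `Literature.Topology.FourManifolds`. This file
DISCHARGES the named fact `DegtyarevKharlamov2000_conjQuotient_unique` of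
`ConjugationQuotients.lean` — Degtyarev–Kharlamov, *Topological properties of real algebraic
varieties: du côté de chez Rokhlin*, Russian Math. Surveys 55 (2000), §3.2 ¶1 (arXiv:math/0004134
p. 14, ll. 21–26): "one can easily see that, up to isotopy, there is a unique smooth structure on
`X/conj` such that the projection `X → X/conj` is a double covering branched over `ℝX`" — in the
diffeomorphism form vendored there: `theorem DegtyarevKharlamov2000_conjQuotient_unique_holds`
(last declaration of this file). Everything is proved; the file introduces NO named facts.

The print gives no proof and the classical mechanism (equivariant tubular neighbourhoods, Bredon
1972, VI.2) is absent from Mathlib, so the diffeomorphism is constructed directly by a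
**downstairs Whitney-averaging of explicit local solutions with a logarithmic radial cutoff**; the
argument was developed in fifteen parts; parts 3–6, 8, 9 form the imported file
`ConjugationQuotientsLocalTheory.lean`, parts 10–17 and the final theorem are concatenated below in
dependency order, each keeping its own header (a header saying "N-th file of the proof" means "N-th part"; parts 1, 2, 7
and the chart-level inverse function theorem are the imported tree files
`ConjugationQuotientsComparison`, `BranchedModelCalculus`, `BranchedModelAveraging`,
`Literature.Geometry.Manifold.ChartInverseFunctionTheorem`). Road map:

* parts 3–6 (`ChartPair`, `polarDeriv`, positive pairs, transitions): adapted chart pairs at the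
  fixed points; the comparison homeomorphism `h : Y₁ → Y₂` reads `Θh = sqModel ∘ θ ∘ sqModel⁻¹`
  for a smooth `flipIm`-equivariant mixed transition `θ`; `Θloc (u, w) = (γ u, polarSq (L u) w)`
  is an explicit smooth local solution; polar derivative field of `Θh`, continuous down to the
  branch locus; first-order structure of one local solution read in another pair;
* parts 8–9 (`Setup`, smooth average): finitely many positive pairs, a partition of unity, a
  Whitney embedding `Y₂ ↪ ℝᴺ` with normal retraction, the radial function `rad`, the logarithmic
  cutoff `χ = cut (log rad)`, and the averaged map `Φ = retr (∑ tᵢ • emb ∘ flocᵢ + t∞ • emb ∘ h)`;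
* parts 10–16 (local bounds, radial comparability, weight bounds, derivative, limit operator,
  sequences, main estimate): along any sequence converging to a branch point with widths
  `Λₙ → ∞`, the derivative of `Φₙ` read in an active pair converges after extraction to an
  invertible block-triangular limit operator (`2 × 2` lemma of part 2), so some point of the
  sequence is good (`Setup.BranchSeq.exists_good`);
* part 17 (global) and the final theorem: for large `n`, `Φₙ` is a local diffeomorphism
  everywhere, `Φₙ ∘ h⁻¹` is a proper local homeomorphism of `Y₂` with a singleton fibre in every
  component, hence bijective (sheet count, `Literature.Topology.ProperLocalHomeomorph`), and `Φₙ`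
  is a diffeomorphism `Y₁ → Y₂`.

## References

* [DegtyarevKharlamov2000] A. Degtyarev, V. Kharlamov, Russian Math. Surveys 55 (2000)
  (arXiv:math/0004134), §3.2 ¶1.
-/

/-!
# Local bounds near a branch point: mean value estimates for the averaged maps

Topic `Topology/FourManifolds`; namespace `Literature.Topology.FourManifolds`. Ninth file of the
proof of `Literature.Topology.FourManifolds.DegtyarevKharlamov2000_conjQuotient_unique`
(`ConjugationQuotients.lean`). Everything is proved; no named facts.

All statements are "there is a ball around the chart point `w₀ = (u₀, 0)` of a branch point on
which …" estimates, obtained from the mean value inequality on convex balls: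

* `BranchedModel.exists_ball_norm_sub_real_le` — a `C¹` map satisfies
  `‖f (u, w₂) - f (u, 0)‖ ≤ C ‖w₂‖` near a real point;
* `BranchedModel.exists_ball_norm_sqModel_sub_le` — for a smooth `flipIm`-equivariant `θ`,
  `‖sqModel (θ (u, z)) - sqModel (θ (u, 0))‖ ≤ C ‖z‖²` (the comparison map read in a pair moves
  points by `O(‖w₂‖)`, `w₂ = z²`; second order in the first component by equivariance);
* `ChartPair.contDiffAt_crossLoc` — the local solution of `i` read in `k` is smooth near the chart
  point of a branch point of `V i`; `Setup.exists_ball_lipschitz_Ech` — the embedding read in a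
  chart is Lipschitz near a good point.

## References

* A. Degtyarev, V. Kharlamov, Russian Math. Surveys 55 (2000), arXiv:math/0004134, §3.2 ¶1.
  [DegtyarevKharlamov2000]
-/

noncomputable section

open scoped Manifold ContDiff Topology
open Set Function Filter Metric
open Literature.Topology.FourManifolds.BranchedModel

namespace Literature.Topology.FourManifolds

/-- Local notation: `𝕄` is the split model space `(Fin 2 → ℝ) × ℂ`. -/
local notation "𝕄" => (Fin 2 → ℝ) × ℂ

/-- Local notation: the Euclidean space `ℝᴺ`. -/
local notation "𝔼" N:arg => EuclideanSpace ℝ (Fin N)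

/-! ### Mean value estimates in the split model -/

namespace BranchedModel

variable {F : Type*} [NormedAddCommGroup F] [NormedSpace ℝ F]

/-- The real foot `(u, 0)` of a point of a ball centred at a real point lies in the ball.
[folklore] -/
theorem real_mem_ball {u₀ : Fin 2 → ℝ} {r : ℝ} {w : 𝕄} (hw : w ∈ ball ((u₀, 0) : 𝕄) r) :
    ((w.1, 0) : 𝕄) ∈ ball ((u₀, 0) : 𝕄) r := by
  rw [mem_ball, Prod.dist_eq] at hw ⊢
  have h1 : dist w.1 u₀ < r := lt_of_le_of_lt (le_max_left _ _) hw
  have hr : 0 < r := dist_nonneg.trans_lt h1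
  simp only [dist_self]
  exact max_lt h1 hr

/-- `‖(u, w₂) - (u, 0)‖ = ‖w₂‖`. [folklore] -/
theorem norm_sub_real (w : 𝕄) : ‖w - (w.1, 0)‖ = ‖w.2‖ := by
  obtain ⟨u, w₂⟩ := w
  simp [Prod.norm_def]

/-- **A `C¹` map moves points off the real locus by `O(‖w₂‖)`**: near a real point,
`‖f (u, w₂) - f (u, 0)‖ ≤ C ‖w₂‖`. [folklore] -/
theorem exists_ball_norm_sub_real_le {f : 𝕄 → F} {u₀ : Fin 2 → ℝ}
    (hf : ContDiffAt ℝ 1 f (u₀, 0)) :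
    ∃ r : ℝ, 0 < r ∧ ∃ C : ℝ, 0 ≤ C ∧ (∀ w ∈ ball ((u₀, 0) : 𝕄) r, DifferentiableAt ℝ f w) ∧
      (∀ w ∈ ball ((u₀, 0) : 𝕄) r, ‖fderiv ℝ f w‖ ≤ C) ∧
      ∀ w ∈ ball ((u₀, 0) : 𝕄) r, ‖f w - f (w.1, 0)‖ ≤ C * ‖w.2‖ := by
  -- differentiability and a derivative bound on a ball
  have hd : ∀ᶠ w in 𝓝 ((u₀, 0) : 𝕄), DifferentiableAt ℝ f w :=
    (hf.eventually (by simp)).mono fun w hw => hw.differentiableAt one_ne_zero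
  have hc : ContinuousAt (fderiv ℝ f) ((u₀, 0) : 𝕄) := hf.continuousAt_fderiv one_ne_zero
  have hb : ∀ᶠ w in 𝓝 ((u₀, 0) : 𝕄), ‖fderiv ℝ f w‖ ≤ ‖fderiv ℝ f (u₀, 0)‖ + 1 := by
    have := (Metric.tendsto_nhds_nhds.1 hc) 1 one_pos
    obtain ⟨δ, hδ, h⟩ := this
    filter_upwards [ball_mem_nhds _ hδ] with w hw
    have h1 := h hw
    rw [dist_eq_norm] at h1
    have := norm_le_norm_add_norm_sub' (fderiv ℝ f w) (fderiv ℝ f (u₀, 0))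
    linarith
  obtain ⟨r, hr, hball⟩ := Metric.eventually_nhds_iff_ball.1 (hd.and hb)
  set C := ‖fderiv ℝ f (u₀, 0)‖ + 1 with hC
  refine ⟨r, hr, C, by positivity, fun w hw => (hball w hw).1, fun w hw => (hball w hw).2,
    fun w hw => ?_⟩
  have h := (convex_ball ((u₀, 0) : 𝕄) r).norm_image_sub_le_of_norm_fderiv_le
    (fun w hw => (hball w hw).1) (fun w hw => (hball w hw).2) (real_mem_ball hw) hw
  rwa [norm_sub_real] at h

/-- **Second-order vanishing in the normal variable**: a map `g : ℂ → F` differentiable on the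
closed disc of radius `‖z‖` with `‖Dg z'‖ ≤ C ‖z'‖` there satisfies `‖g z - g 0‖ ≤ C ‖z‖²`.
[folklore] -/
theorem norm_sub_le_sq_of_fderiv_le {g : ℂ → F} {z : ℂ} {C : ℝ}
    (hd : ∀ z' ∈ closedBall (0 : ℂ) ‖z‖, DifferentiableAt ℝ g z')
    (hb : ∀ z' ∈ closedBall (0 : ℂ) ‖z‖, ‖fderiv ℝ g z'‖ ≤ C * ‖z'‖) (hC : 0 ≤ C) :
    ‖g z - g 0‖ ≤ C * ‖z‖ ^ 2 := by
  have h := (convex_closedBall (0 : ℂ) ‖z‖).norm_image_sub_le_of_norm_fderiv_le hd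
    (C := C * ‖z‖) (fun z' hz' => (hb z' hz').trans (by
      rw [mem_closedBall, dist_zero_right] at hz'
      exact mul_le_mul_of_nonneg_left hz' hC))
    (mem_closedBall_self (norm_nonneg z)) (mem_closedBall.2 (by rw [dist_zero_right]))
  rw [sub_zero] at h
  calc ‖g z - g 0‖ ≤ C * ‖z‖ * ‖z‖ := h
    _ = C * ‖z‖ ^ 2 := by ring

/-- **The comparison map read in a pair moves points by `O(‖w₂‖)`, `w₂ = z²`.** For a smooth
`flipIm`-equivariant `θ` near the real point `(u₀, 0)`:
`‖sqModel (θ (u, z)) - sqModel (θ (u, 0))‖ ≤ C ‖z‖²` on a ball. (Second component: `θ₂ (u, 0) = 0`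
and `θ₂` is Lipschitz; first component: its normal derivative `tangNormal θ` vanishes on the real
locus and is Lipschitz.) [folklore] -/
theorem exists_ball_norm_sqModel_sub_le {θ : 𝕄 → 𝕄} {S : Set 𝕄} (hS : IsOpen S)
    (hθ : ContDiffOn ℝ ∞ θ S) (heq : ∀ x ∈ S, flipIm x ∈ S ∧ θ (flipIm x) = flipIm (θ x))
    {u₀ : Fin 2 → ℝ} (hu₀ : ((u₀, 0) : 𝕄) ∈ S) :
    ∃ r : ℝ, 0 < r ∧ ∃ C : ℝ, 0 ≤ C ∧ ∀ w ∈ ball ((u₀, 0) : 𝕄) r,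
      ‖sqModel (θ w) - sqModel (θ (w.1, 0))‖ ≤ C * ‖w.2‖ ^ 2 := by
  -- smoothness near the base point
  have hθc : ContDiffAt ℝ ∞ θ (u₀, 0) := (hθ _ hu₀).contDiffAt (hS.mem_nhds hu₀)
  have hD : ContDiffOn ℝ ∞ (fun x => fderiv ℝ θ x) S := hθ.fderiv_of_isOpen hS (by simp)
  have hT : ContDiffAt ℝ ∞ (tangNormal θ) (u₀, 0) :=
    contDiff_tangNormalMap.contDiffAt.comp _ ((hD _ hu₀).contDiffAt (hS.mem_nhds hu₀))
  -- (1) the second component `θ₂` is Lipschitz off the real locus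
  obtain ⟨r₁, hr₁, C₁, hC₁, -, -, h₁⟩ :=
    exists_ball_norm_sub_real_le (f := fun x => (θ x).2) (hθc.snd.of_le (by exact_mod_cast le_top))
  -- (2) the normal derivative of `θ₁` is Lipschitz off the real locus
  obtain ⟨r₂, hr₂, C₂, hC₂, -, -, h₂⟩ :=
    exists_ball_norm_sub_real_le (f := tangNormal θ) (hT.of_le (by exact_mod_cast le_top))
  -- (3) a ball inside `S` on which `θ` is differentiable
  obtain ⟨r₃, hr₃, h₃⟩ : ∃ r₃ > 0, ball ((u₀, 0) : 𝕄) r₃ ⊆ S := Metric.isOpen_iff.1 hS _ hu₀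
  set r := min (min r₁ r₂) r₃ with hr
  have hr0 : 0 < r := by positivity
  refine ⟨r, hr0, max C₂ (C₁ ^ 2), by positivity, fun w hw => ?_⟩
  obtain ⟨u, z⟩ := w
  have hw₁ : ((u, z) : 𝕄) ∈ ball ((u₀, 0) : 𝕄) r₁ :=
    ball_subset_ball (by rw [hr]; exact (min_le_left _ _).trans (min_le_left _ _)) hw
  have hw₂ : ((u, z) : 𝕄) ∈ ball ((u₀, 0) : 𝕄) r₂ :=
    ball_subset_ball (by rw [hr]; exact (min_le_left _ _).trans (min_le_right _ _)) hw
  have hw₃ : ((u, z) : 𝕄) ∈ ball ((u₀, 0) : 𝕄) r₃ := ball_subset_ball (by rw [hr]; exact min_le_right _ _) hw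
  -- real points of the ball lie in `S`, where `θ₂` and `tangNormal` vanish
  have hreal : ∀ u' : Fin 2 → ℝ, ((u', (0 : ℂ)) : 𝕄) ∈ ball ((u₀, 0) : 𝕄) r₃ →
      (θ (u', 0)).2 = 0 ∧ tangNormal θ (u', 0) = 0 := by
    intro u' hu'
    have hu'S : ((u', (0 : ℂ)) : 𝕄) ∈ S := h₃ hu'
    have hev : ∀ᶠ x in 𝓝 ((u', 0) : 𝕄), θ (flipIm x) = flipIm (θ x) := by
      filter_upwards [hS.mem_nhds hu'S] with x hx
      exact (heq x hx).2
    refine ⟨snd_apply_eq_zero_of_equivariant hev, ContinuousLinearMap.ext fun b => ?_⟩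
    rw [tangNormal_apply, zero_apply]
    exact fst_fderiv_inr_eq_zero_of_equivariant
      ((((hθ _ hu'S).contDiffAt (hS.mem_nhds hu'S)).differentiableAt (by simp)).hasFDerivAt) hev b
  obtain ⟨h0₂, h0T⟩ := hreal u (real_mem_ball hw₃)
  -- second component
  have hz₂ : ‖(θ (u, z)).2‖ ≤ C₁ * ‖z‖ := by
    have := h₁ (u, z) hw₁
    simpa [h0₂] using this
  -- first component: mean value along `z' ↦ θ₁ (u, z')` on the disc of radius `‖z‖`
  have hseg : ∀ z' ∈ closedBall (0 : ℂ) ‖z‖, ((u, z') : 𝕄) ∈ ball ((u₀, 0) : 𝕄) r := by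
    intro z' hz'
    rw [mem_closedBall, dist_zero_right] at hz'
    rw [mem_ball, Prod.dist_eq] at hw ⊢
    refine max_lt (by simpa using (le_max_left _ _).trans_lt hw) ?_
    calc dist z' 0 = ‖z'‖ := dist_zero_right z'
      _ ≤ ‖z‖ := hz'
      _ = dist z 0 := (dist_zero_right z).symm
      _ < r := (le_max_right _ _).trans_lt hw
  have hg : ∀ z' ∈ closedBall (0 : ℂ) ‖z‖,
      HasFDerivAt (fun z' : ℂ => (θ (u, z')).1) (tangNormal θ (u, z')) z' := by
    intro z' hz'
    have hmem : ((u, z') : 𝕄) ∈ S := h₃ (ball_subset_ball (by rw [hr]; exact min_le_right _ _) (hseg z' hz'))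
    have hθd : HasFDerivAt θ (fderiv ℝ θ (u, z')) (u, z') :=
      (((hθ _ hmem).contDiffAt (hS.mem_nhds hmem)).differentiableAt (by simp)).hasFDerivAt
    have hi : HasFDerivAt (fun z' : ℂ => ((u, z') : 𝕄)) (ContinuousLinearMap.inr ℝ (Fin 2 → ℝ) ℂ) z' :=
      ((ContinuousLinearMap.inr ℝ (Fin 2 → ℝ) ℂ).hasFDerivAt.const_add ((u, 0) : 𝕄)).congr_of_eventuallyEq
        (Eventually.of_forall fun z'' => by simp)
    have := hasFDerivAt_fst.comp z' (hθd.comp z' hi)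
    exact this
  have hfd : ∀ z' ∈ closedBall (0 : ℂ) ‖z‖, DifferentiableAt ℝ (fun z' : ℂ => (θ (u, z')).1) z' :=
    fun z' hz' => (hg z' hz').differentiableAt
  have hfb : ∀ z' ∈ closedBall (0 : ℂ) ‖z‖, ‖fderiv ℝ (fun z' : ℂ => (θ (u, z')).1) z'‖ ≤ C₂ * ‖z'‖ := by
    intro z' hz'
    rw [(hg z' hz').fderiv]
    have hw' : ((u, z') : 𝕄) ∈ ball ((u₀, 0) : 𝕄) r₂ :=
      ball_subset_ball (by rw [hr]; exact (min_le_left _ _).trans (min_le_right _ _)) (hseg z' hz')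
    have := h₂ (u, z') hw'
    simpa [h0T] using this
  have hz₁ : ‖(θ (u, z)).1 - (θ (u, 0)).1‖ ≤ C₂ * ‖z‖ ^ 2 := norm_sub_le_sq_of_fderiv_le hfd hfb hC₂
  -- assemble in the max norm of the product
  rw [Prod.norm_def]
  simp only [sqModel, Prod.fst_sub, Prod.snd_sub, h0₂]
  refine max_le (hz₁.trans ?_) ?_
  · exact mul_le_mul_of_nonneg_right (le_max_left _ _) (by positivity)
  · rw [zero_pow two_ne_zero, sub_zero, norm_pow]
    calc ‖(θ (u, z)).2‖ ^ 2 ≤ (C₁ * ‖z‖) ^ 2 := by gcongr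
      _ = C₁ ^ 2 * ‖z‖ ^ 2 := by ring
      _ ≤ max C₂ (C₁ ^ 2) * ‖z‖ ^ 2 := mul_le_mul_of_nonneg_right (le_max_right _ _) (by positivity)

/-- **A `C¹` map is Lipschitz on a ball around any point.** [folklore] -/
theorem exists_ball_lipschitz {E' : Type*} [NormedAddCommGroup E'] [NormedSpace ℝ E']
    {f : E' → F} {x₀ : E'} (hf : ContDiffAt ℝ 1 f x₀) :
    ∃ r : ℝ, 0 < r ∧ ∃ L : ℝ, 0 ≤ L ∧ ∀ x ∈ ball x₀ r, ∀ y ∈ ball x₀ r, ‖f x - f y‖ ≤ L * ‖x - y‖ := by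
  have hd : ∀ᶠ x in 𝓝 x₀, DifferentiableAt ℝ f x :=
    (hf.eventually (by simp)).mono fun x hx => hx.differentiableAt one_ne_zero
  have hc : ContinuousAt (fderiv ℝ f) x₀ := hf.continuousAt_fderiv one_ne_zero
  have hb : ∀ᶠ x in 𝓝 x₀, ‖fderiv ℝ f x‖ ≤ ‖fderiv ℝ f x₀‖ + 1 := by
    obtain ⟨δ, hδ, h⟩ := (Metric.tendsto_nhds_nhds.1 hc) 1 one_pos
    filter_upwards [ball_mem_nhds _ hδ] with x hx
    have h1 := h hx
    rw [dist_eq_norm] at h1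
    have := norm_le_norm_add_norm_sub' (fderiv ℝ f x) (fderiv ℝ f x₀)
    linarith
  obtain ⟨r, hr, hball⟩ := Metric.eventually_nhds_iff_ball.1 (hd.and hb)
  refine ⟨r, hr, ‖fderiv ℝ f x₀‖ + 1, by positivity, fun x hx y hy => ?_⟩
  exact (convex_ball x₀ r).norm_image_sub_le_of_norm_fderiv_le (fun z hz => (hball z hz).1)
    (fun z hz => (hball z hz).2) hy hx

end BranchedModel

/-! ### Smoothness of the local solution of one pair read in another -/

namespace ChartPair

variable {X : Type*} [TopologicalSpace X] [ChartedSpace (Fin 2 → ℂ) X]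
  {Y₁ : Type*} [TopologicalSpace Y₁] [ChartedSpace (EuclideanSpace ℝ (Fin 4)) Y₁]
  {Y₂ : Type*} [TopologicalSpace Y₂] [ChartedSpace (EuclideanSpace ℝ (Fin 4)) Y₂]
  {σ : X → X} {q₁ : X → Y₁} {q₂ : X → Y₂}

/-- **The local solution of `b` read in `k` is `C^∞` at the chart point of any point of the
good set of `b` read in the charts of `k`.** [folklore] -/
theorem contDiffAt_crossLoc [IsManifold (𝓡 4) ∞ Y₁] [IsManifold (𝓡 4) ∞ Y₂] (b k : ChartPair σ q₁ q₂)
    (hb : b.IsPos) {y : Y₁} (hyb : y ∈ b.flocSource) (hyk : y ∈ k.ψ₁.source)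
    (hfy : b.floc y ∈ k.ψ₂.source) : ContDiffAt ℝ ∞ (b.crossLoc k) (splitW (k.ψ₁ y)) := by
  have hsm : ContMDiffAt (𝓡 4) (𝓡 4) ∞ b.floc y :=
    (b.contMDiffOn_floc hb).contMDiffAt ((b.isOpen_flocSource hb).mem_nhds hyb)
  rw [contMDiffAt_iff_of_mem_maximalAtlas k.ψ₁_mem k.ψ₂_mem hyk hfy] at hsm
  have h2 := hsm.2
  simp only [OpenPartialHomeomorph.extend_coe, OpenPartialHomeomorph.extend_coe_symm,
    modelWithCornersSelf_coe, modelWithCornersSelf_coe_symm, CompTriple.comp_eq, range_id] at h2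
  have h3 : ContDiffAt ℝ ∞ (k.ψ₂ ∘ b.floc ∘ k.ψ₁.symm) (k.ψ₁ y) := h2.contDiffAt univ_mem
  have h4 : ContDiffAt ℝ ∞ (k.ψ₂ ∘ b.floc ∘ k.ψ₁.symm) (splitW.symm (splitW (k.ψ₁ y))) := by
    rwa [ContinuousLinearEquiv.symm_apply_apply]
  exact splitW.contDiff.contDiffAt.comp _ (h4.comp _ splitW.symm.contDiff.contDiffAt)

end ChartPair

/-! ### The embedding read in a chart is Lipschitz near a good point -/

namespace Setup

variable {X : Type*} [TopologicalSpace X] [ChartedSpace (Fin 2 → ℂ) X]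
  {Y₁ : Type*} [TopologicalSpace Y₁] [ChartedSpace (EuclideanSpace ℝ (Fin 4)) Y₁]
  {Y₂ : Type*} [TopologicalSpace Y₂] [ChartedSpace (EuclideanSpace ℝ (Fin 4)) Y₂]
  {ι : Type*} [Fintype ι] {σ : X → X} {q₁ : X → Y₁} {q₂ : X → Y₂} {N : ℕ}

/-- **`Ech` is Lipschitz on a ball around every good chart point.** [folklore] -/
theorem exists_ball_lipschitz_Ech (S : Setup ι σ q₁ q₂ N) (k : ι) {z₀ : 𝕄}
    (hz₀ : splitW.symm z₀ ∈ (S.c k).ψ₂.target) :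
    ∃ r : ℝ, 0 < r ∧ ∃ L : ℝ, 0 ≤ L ∧ ∀ z ∈ ball z₀ r, ∀ z' ∈ ball z₀ r,
      ‖S.Ech k z - S.Ech k z'‖ ≤ L * ‖z - z'‖ :=
  exists_ball_lipschitz ((S.contDiffAt_Ech k hz₀).of_le (by exact_mod_cast le_top))

end Setup

end Literature.Topology.FourManifolds

end


/-!
# Radial comparability: the radial function is `≍ ‖w₂‖²` with gradient `O(‖w₂‖)` in every pair

Topic `Topology/FourManifolds`; namespace `Literature.Topology.FourManifolds`. Tenth file of the
proof of `Literature.Topology.FourManifolds.DegtyarevKharlamov2000_conjQuotient_unique`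
(`ConjugationQuotients.lean`). Everything is proved; no named facts.

Read in the source chart of a pair `k` near the chart point `w₀ = (u₀, 0)` of a branch point
`y₀ = q₁ x₀`, the radial function of the set-up (`Setup.rad = ∑ⱼ ηⱼ ‖wⱼ‖² + η∞`) is
`radch = ∑ⱼ ηchⱼ · ‖(T_{kj} w).2‖² + ηinfch` where `T_{kj}` is the downstairs `q₁`-transition
from the coordinates of `k` to those of `j` (`Setup.radch_apply`). Each `T_{kj}` is smooth,
preserves the real locus and is inverted by `T_{jk}`, so `‖(T_{kj} w).2‖ ≍ ‖w.2‖` near `w₀`;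
consequently (`Setup.radial_comparability`) on a ball around `w₀`:

  `c ‖w.2‖² ≤ radch w`  and  `‖D radch w‖ ≤ C ‖w.2‖`.

This is what makes the logarithmic cutoff `χ = cut (log rad)` have gradient `O(1/(Λ ‖w.2‖))`.

## References

* A. Degtyarev, V. Kharlamov, Russian Math. Surveys 55 (2000), arXiv:math/0004134, §3.2 ¶1.
  [DegtyarevKharlamov2000]
-/

noncomputable section

open scoped Manifold ContDiff Topology
open Set Function Filter Metric
open Literature.Topology.FourManifolds.BranchedModel

namespace Literature.Topology.FourManifolds

/-- Local notation: `𝕄` is the split model space `(Fin 2 → ℝ) × ℂ`. -/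
local notation "𝕄" => (Fin 2 → ℝ) × ℂ

/-- Local notation: the Euclidean space `ℝᴺ`. -/
local notation "𝔼" N:arg => EuclideanSpace ℝ (Fin N)

namespace Setup

variable {X : Type*} [TopologicalSpace X] [ChartedSpace (Fin 2 → ℂ) X]
  {Y₁ : Type*} [TopologicalSpace Y₁] [ChartedSpace (EuclideanSpace ℝ (Fin 4)) Y₁]
  {Y₂ : Type*} [TopologicalSpace Y₂] [ChartedSpace (EuclideanSpace ℝ (Fin 4)) Y₂]
  {ι : Type*} [Fintype ι] {σ : X → X} {q₁ : X → Y₁} {q₂ : X → Y₂} {N : ℕ}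

/-! ### Functions on `Y₁` read in the source chart of a pair -/

/-- The chart domain of pair `k` read in the model: `Ωₖ = splitW '' ψ₁.target`. [folklore] -/
def Ω (S : Setup ι σ q₁ q₂ N) (k : ι) : Set 𝕄 :=
  {w | splitW.symm w ∈ (S.c k).ψ₁.target}

/-- `Ωₖ` is open. [folklore] -/
theorem isOpen_Ω (S : Setup ι σ q₁ q₂ N) (k : ι) : IsOpen (S.Ω k) :=
  (S.c k).ψ₁.open_target.preimage splitW.symm.continuous

/-- The chart point of a branch point lies in `Ωₖ`. [folklore] -/
theorem base_mem_Ω (S : Setup ι σ q₁ q₂ N) {k : ι} {x₀ : X} (hx₀ : x₀ ∈ (S.c k).dom)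
    (hfix : σ x₀ = x₀) : (((split ((S.c k).φ₁ x₀)).1, 0) : 𝕄) ∈ S.Ω k :=
  S.base_mem_target hx₀ hfix

/-- **A smooth function on `Y₁` read in the source chart of pair `k` is smooth on `Ωₖ`.**
[folklore] -/
theorem contDiffOn_comp_ych [IsManifold (𝓡 4) ∞ Y₁] (S : Setup ι σ q₁ q₂ N) (k : ι)
    {F' : Type*} [NormedAddCommGroup F'] [NormedSpace ℝ F'] {g : Y₁ → F'}
    (hg : ContMDiff (𝓡 4) 𝓘(ℝ, F') ∞ g) : ContDiffOn ℝ ∞ (g ∘ S.ych k) (S.Ω k) := by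
  have h1 : ContMDiffOn (𝓡 4) 𝓘(ℝ, F') ∞ g (S.c k).ψ₁.source := hg.contMDiffOn
  rw [contMDiffOn_iff_of_mem_maximalAtlas' (e' := OpenPartialHomeomorph.refl F') (S.c k).ψ₁_mem
    (StructureGroupoid.chart_mem_maximalAtlas _ (0 : F')) Subset.rfl (fun _ _ => mem_univ _)] at h1
  simp only [OpenPartialHomeomorph.extend_coe, OpenPartialHomeomorph.extend_coe_symm,
    modelWithCornersSelf_coe, modelWithCornersSelf_coe_symm, CompTriple.comp_eq,
    OpenPartialHomeomorph.refl_apply, (S.c k).ψ₁.image_source_eq_target] at h1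
  have h2 : ContDiffOn ℝ ∞ ((g ∘ (S.c k).ψ₁.symm) ∘ splitW.symm) (S.Ω k) :=
    h1.comp splitW.symm.contDiff.contDiffOn fun w hw => hw
  exact h2

/-- Pointwise version at points of `Ωₖ`. [folklore] -/
theorem contDiffAt_comp_ych [IsManifold (𝓡 4) ∞ Y₁] (S : Setup ι σ q₁ q₂ N) (k : ι)
    {F' : Type*} [NormedAddCommGroup F'] [NormedSpace ℝ F'] {g : Y₁ → F'}
    (hg : ContMDiff (𝓡 4) 𝓘(ℝ, F') ∞ g) {w : 𝕄} (hw : w ∈ S.Ω k) :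
    ContDiffAt ℝ ∞ (g ∘ S.ych k) w :=
  (S.contDiffOn_comp_ych k hg w hw).contDiffAt ((S.isOpen_Ω k).mem_nhds hw)

/-- The weight of pair `j` read in the source chart of pair `k`. [folklore] -/
def ηch (S : Setup ι σ q₁ q₂ N) (k j : ι) (w : 𝕄) : ℝ :=
  S.η j (S.ych k w)

/-- The weight of the complement read in the source chart of pair `k`. [folklore] -/
def ηinfch (S : Setup ι σ q₁ q₂ N) (k : ι) (w : 𝕄) : ℝ :=
  S.ηinf (S.ych k w)

/-- The radial function read in the source chart of pair `k`. [folklore] -/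
def radch (S : Setup ι σ q₁ q₂ N) (k : ι) (w : 𝕄) : ℝ :=
  S.rad (S.ych k w)

/-- **The downstairs `q₁`-transition from the coordinates of `k` to those of `j`.** [folklore] -/
def Tch (S : Setup ι σ q₁ q₂ N) (k j : ι) (w : 𝕄) : 𝕄 :=
  ((S.c k).pairWith₁ (S.c j)).Θh S.h₁ S.h₁ w

/-- `Tch k j w = splitW (ψ₁ⱼ (ych k w))`. [folklore] -/
theorem Tch_apply (S : Setup ι σ q₁ q₂ N) (k j : ι) (w : 𝕄) :
    S.Tch k j w = splitW ((S.c j).ψ₁ (S.ych k w)) := by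
  rw [Tch, ChartPair.Θh_self_apply]; rfl

/-- **The radial function read in pair `k`**: `radch = ∑ⱼ ηchⱼ · ‖(T_{kj} w).2‖² + ηinfch`.
[folklore] -/
theorem radch_apply (S : Setup ι σ q₁ q₂ N) (k : ι) (w : 𝕄) :
    S.radch k w = ∑ j, S.ηch k j w * ‖(S.Tch k j w).2‖ ^ 2 + S.ηinfch k w := by
  simp only [radch, rad, ηch, ηinfch, nsq, Tch_apply]

/-! ### Per-pair facts near the chart point of a branch point -/

section PerPair

/-- The fibre of a branch point is a single fixed point. [folklore] -/
theorem eq_of_q₁_eq (S : Setup ι σ q₁ q₂ N) {x x₀ : X} (hfix : σ x₀ = x₀) (h : q₁ x = q₁ x₀) :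
    x = x₀ := by
  rcases (S.h₁.apply_eq_iff x x₀).1 h with h' | h'
  · exact h'.symm
  · calc x = σ (σ x) := (S.h₁.involutive x).symm
      _ = σ x₀ := by rw [← h']
      _ = x₀ := hfix

/-- For an active pair `j` at the branch point `q₁ x₀`, the fixed point lies in its common domain.
[folklore] -/
theorem mem_dom_of_mem_tsupport (S : Setup ι σ q₁ q₂ N) {j : ι} {x₀ : X} (hfix : σ x₀ = x₀)
    (hj : q₁ x₀ ∈ tsupport (S.η j)) : x₀ ∈ (S.c j).dom := by
  obtain ⟨x', hx', hfix', hq⟩ := S.exists_of_mem_V (S.tsupport_η_subset j hj) ⟨x₀, hfix, rfl⟩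
  rwa [S.eq_of_q₁_eq hfix hq] at hx'

/-- **The transition `T_{kj}` is smooth at the chart point of a common branch point.** [folklore] -/
theorem contDiffAt_Tch (S : Setup ι σ q₁ q₂ N) {k j : ι} {x₀ : X} (hk : x₀ ∈ (S.c k).dom)
    (hj : x₀ ∈ (S.c j).dom) (hfix : σ x₀ = x₀) :
    ContDiffAt ℝ ∞ (S.Tch k j) ((split ((S.c k).φ₁ x₀)).1, 0) := by
  have h := ((S.c k).pairWith₁ (S.c j)).contDiffAt_Θh_self S.h₁ (y := q₁ x₀)
    ((S.c k).adapted₁ x₀ hk.1).2.2.1 ((S.c j).adapted₁ x₀ hj.1).2.2.1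
  have hw₀ := (S.base_facts hk hfix).1
  simp only [ChartPair.pairWith₁] at h
  rw [hw₀] at h
  exact h

/-- The transition maps the chart point of `x₀` in `k` to its chart point in `j`. [folklore] -/
theorem Tch_base (S : Setup ι σ q₁ q₂ N) {k j : ι} {x₀ : X} (hk : x₀ ∈ (S.c k).dom)
    (hj : x₀ ∈ (S.c j).dom) (hfix : σ x₀ = x₀) :
    S.Tch k j ((split ((S.c k).φ₁ x₀)).1, 0) = ((split ((S.c j).φ₁ x₀)).1, 0) := by
  rw [Tch_apply, (S.base_facts hk hfix).2.1, (S.base_facts hj hfix).1]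

/-- **The transition preserves the real locus near the base point**: `(T_{kj} (u, 0)).2 = 0`.
[folklore] -/
theorem eventually_Tch_real (S : Setup ι σ q₁ q₂ N) {k j : ι} {x₀ : X} (hk : x₀ ∈ (S.c k).dom)
    (hj : x₀ ∈ (S.c j).dom) (hfix : σ x₀ = x₀) :
    ∀ᶠ w in 𝓝 (((split ((S.c k).φ₁ x₀)).1, 0) : 𝕄), (S.Tch k j (w.1, 0)).2 = 0 := by
  set P := (S.c k).pairWith₁ (S.c j) with hP
  have hu₀ : (split ((S.c k).φ₁ x₀)).1 ∈ P.realSource :=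
    (S.c k).fst_split_φ₁_mem_realSource_pairWith₁ (S.c j) hk hj hfix
  have hev : ∀ᶠ w in 𝓝 (((split ((S.c k).φ₁ x₀)).1, 0) : 𝕄), w.1 ∈ P.realSource :=
    continuous_fst.continuousAt.preimage_mem_nhds (P.isOpen_realSource.mem_nhds hu₀)
  filter_upwards [hev] with w hw
  rw [Tch, P.Θh_self_real S.h₁ hw]

/-- **`T_{jk} ∘ T_{kj} = id` near the base point.** [folklore] -/
theorem eventually_Tch_Tch (S : Setup ι σ q₁ q₂ N) {k j : ι} {x₀ : X} (hk : x₀ ∈ (S.c k).dom)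
    (hj : x₀ ∈ (S.c j).dom) (hfix : σ x₀ = x₀) :
    ∀ᶠ w in 𝓝 (((split ((S.c k).φ₁ x₀)).1, 0) : 𝕄), S.Tch j k (S.Tch k j w) = w := by
  have hΩ : ∀ᶠ w in 𝓝 (((split ((S.c k).φ₁ x₀)).1, 0) : 𝕄), w ∈ S.Ω k :=
    (S.isOpen_Ω k).mem_nhds (S.base_mem_Ω hk hfix)
  have hcont : ContinuousAt (S.ych k) (((split ((S.c k).φ₁ x₀)).1, 0) : 𝕄) :=
    S.continuousAt_ych k (S.base_mem_target hk hfix)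
  have hy₀ := (S.base_facts hk hfix).2.1
  have hsrc : ∀ᶠ w in 𝓝 (((split ((S.c k).φ₁ x₀)).1, 0) : 𝕄), S.ych k w ∈ (S.c j).ψ₁.source := by
    refine hcont.preimage_mem_nhds ((S.c j).ψ₁.open_source.mem_nhds ?_)
    rw [hy₀]; exact ((S.c j).adapted₁ x₀ hj.1).2.2.1
  filter_upwards [hΩ, hsrc] with w hΩw hw
  rw [Tch_apply, Tch_apply, ych, ContinuousLinearEquiv.symm_apply_apply, (S.c j).ψ₁.left_inv hw]
  show splitW ((S.c k).ψ₁ ((S.c k).ψ₁.symm (splitW.symm w))) = w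
  rw [(S.c k).ψ₁.right_inv hΩw, ContinuousLinearEquiv.apply_symm_apply]

/-- **Two-sided comparability of the normal coordinates of two pairs**: near the base point,
`‖(T_{kj} w).2‖ ≤ C ‖w.2‖` and `‖w.2‖ ≤ C ‖(T_{kj} w).2‖`. [folklore] -/
theorem eventually_Tch_snd_comparable (S : Setup ι σ q₁ q₂ N) {k j : ι} {x₀ : X}
    (hk : x₀ ∈ (S.c k).dom) (hj : x₀ ∈ (S.c j).dom) (hfix : σ x₀ = x₀) :
    ∃ C : ℝ, 1 ≤ C ∧ ∀ᶠ w in 𝓝 (((split ((S.c k).φ₁ x₀)).1, 0) : 𝕄),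
      ‖(S.Tch k j w).2‖ ≤ C * ‖w.2‖ ∧ ‖w.2‖ ≤ C * ‖(S.Tch k j w).2‖ := by
  -- upper bound for `T_{kj}`
  have h1 : ContDiffAt ℝ 1 (fun w => (S.Tch k j w).2) ((split ((S.c k).φ₁ x₀)).1, 0) :=
    (S.contDiffAt_Tch hk hj hfix).snd.of_le (by exact_mod_cast le_top)
  obtain ⟨r₁, hr₁, C₁, hC₁, -, -, hb₁⟩ := exists_ball_norm_sub_real_le h1
  -- upper bound for `T_{jk}` at the chart point of `x₀` in `j`
  have h2 : ContDiffAt ℝ 1 (fun w => (S.Tch j k w).2) ((split ((S.c j).φ₁ x₀)).1, 0) :=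
    (S.contDiffAt_Tch hj hk hfix).snd.of_le (by exact_mod_cast le_top)
  obtain ⟨r₂, hr₂, C₂, hC₂, -, -, hb₂⟩ := exists_ball_norm_sub_real_le h2
  refine ⟨max (max C₁ C₂) 1, le_max_right _ _, ?_⟩
  -- `T_{kj} w` stays in the second ball
  have hcont : ContinuousAt (S.Tch k j) ((split ((S.c k).φ₁ x₀)).1, 0) :=
    (S.contDiffAt_Tch hk hj hfix).continuousAt
  have hin : ∀ᶠ w in 𝓝 (((split ((S.c k).φ₁ x₀)).1, 0) : 𝕄),
      S.Tch k j w ∈ ball (((split ((S.c j).φ₁ x₀)).1, 0) : 𝕄) r₂ := by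
    refine hcont.preimage_mem_nhds ?_
    rw [S.Tch_base hk hj hfix]
    exact ball_mem_nhds _ hr₂
  -- real-locus vanishing for both transitions
  have hreal₂ : ∀ᶠ w in 𝓝 (((split ((S.c k).φ₁ x₀)).1, 0) : 𝕄),
      (S.Tch j k ((S.Tch k j w).1, 0)).2 = 0 := by
    have h := S.eventually_Tch_real hj hk hfix
    have h' := hcont.eventually (by rw [S.Tch_base hk hj hfix]; exact h)
    exact h'
  filter_upwards [ball_mem_nhds _ hr₁, S.eventually_Tch_real hk hj hfix, hin, hreal₂,
    S.eventually_Tch_Tch hk hj hfix] with w hw hreal hw₂ hreal' hTT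
  constructor
  · have := hb₁ w hw
    rw [hreal, sub_zero] at this
    exact this.trans (mul_le_mul_of_nonneg_right ((le_max_left _ _).trans (le_max_left _ _))
      (norm_nonneg _))
  · have := hb₂ (S.Tch k j w) hw₂
    rw [hreal', sub_zero, hTT] at this
    exact this.trans (mul_le_mul_of_nonneg_right ((le_max_right _ _).trans (le_max_left _ _))
      (norm_nonneg _))

/-- The weight of `j` read in `k` is smooth on `Ωₖ`. [folklore] -/
theorem contDiffAt_ηch [IsManifold (𝓡 4) ∞ Y₁] (S : Setup ι σ q₁ q₂ N) (k j : ι) {w : 𝕄} (hw : w ∈ S.Ω k) :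
    ContDiffAt ℝ ∞ (S.ηch k j) w :=
  S.contDiffAt_comp_ych k (S.contMDiff_η j) hw

/-- The radial function read in `k` is smooth on `Ωₖ`. [folklore] -/
theorem contDiffAt_radch [IsManifold (𝓡 4) ∞ Y₁] (S : Setup ι σ q₁ q₂ N) (k : ι) {w : 𝕄} (hw : w ∈ S.Ω k) :
    ContDiffAt ℝ ∞ (S.radch k) w :=
  S.contDiffAt_comp_ych k S.contMDiff_rad hw

/-- `ηinfch` vanishes near the chart point of a branch point. [folklore] -/
theorem ηinfch_eventuallyEq_zero (S : Setup ι σ q₁ q₂ N) {k : ι} {x₀ : X} (hk : x₀ ∈ (S.c k).dom)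
    (hfix : σ x₀ = x₀) :
    S.ηinfch k =ᶠ[𝓝 (((split ((S.c k).φ₁ x₀)).1, 0) : 𝕄)] 0 := by
  have hcont : ContinuousAt (S.ych k) (((split ((S.c k).φ₁ x₀)).1, 0) : 𝕄) :=
    S.continuousAt_ych k (S.base_mem_target hk hfix)
  have hy₀ := (S.base_facts hk hfix).2.1
  have h := S.ηinf_eventuallyEq_zero (y := q₁ x₀) ⟨x₀, hfix, rfl⟩
  rw [← hy₀] at h
  exact hcont.tendsto.eventually h |>.mono fun w hw => by simpa [ηinfch] using hw

/-- An inactive weight vanishes near the chart point of the branch point. [folklore] -/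
theorem ηch_eventuallyEq_zero (S : Setup ι σ q₁ q₂ N) {k j : ι} {x₀ : X} (hk : x₀ ∈ (S.c k).dom)
    (hfix : σ x₀ = x₀) (hj : q₁ x₀ ∉ tsupport (S.η j)) :
    S.ηch k j =ᶠ[𝓝 (((split ((S.c k).φ₁ x₀)).1, 0) : 𝕄)] 0 := by
  have hcont : ContinuousAt (S.ych k) (((split ((S.c k).φ₁ x₀)).1, 0) : 𝕄) :=
    S.continuousAt_ych k (S.base_mem_target hk hfix)
  have hy₀ := (S.base_facts hk hfix).2.1
  have h : S.η j =ᶠ[𝓝 (q₁ x₀)] 0 := notMem_tsupport_iff_eventuallyEq.1 hj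
  rw [← hy₀] at h
  exact hcont.tendsto.eventually h |>.mono fun w hw => by simpa [ηch] using hw

/-- **Per-pair radial facts.** For every pair `j` there is a constant `C ≥ 1` such that near the
chart point of the branch point: `ηchⱼ w ‖w.2‖² ≤ C² (ηchⱼ w ‖(T_{kj} w).2‖²)`, and the term
`w ↦ ηchⱼ w ‖(T_{kj} w).2‖²` has a derivative of norm `≤ C ‖w.2‖` (for an inactive pair both are
trivial). [folklore] -/
theorem radial_term_facts [IsManifold (𝓡 4) ∞ Y₁] (S : Setup ι σ q₁ q₂ N) {k : ι} (j : ι) {x₀ : X} (hk : x₀ ∈ (S.c k).dom)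
    (hfix : σ x₀ = x₀) :
    ∃ C : ℝ, 1 ≤ C ∧ ∀ᶠ w in 𝓝 (((split ((S.c k).φ₁ x₀)).1, 0) : 𝕄),
      S.ηch k j w * ‖w.2‖ ^ 2 ≤ C ^ 2 * (S.ηch k j w * ‖(S.Tch k j w).2‖ ^ 2) ∧
      ∃ D : 𝕄 →L[ℝ] ℝ, HasFDerivAt (fun w => S.ηch k j w * ‖(S.Tch k j w).2‖ ^ 2) D w ∧
        ‖D‖ ≤ C * ‖w.2‖ := by
  by_cases hj : q₁ x₀ ∈ tsupport (S.η j)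
  · -- active pair
    have hjd : x₀ ∈ (S.c j).dom := S.mem_dom_of_mem_tsupport hfix hj
    obtain ⟨C₀, hC₀, hcomp⟩ := S.eventually_Tch_snd_comparable hk hjd hfix
    -- derivative bounds for `ηch` and `T` near the base point
    have hη : ContDiffAt ℝ 1 (S.ηch k j) ((split ((S.c k).φ₁ x₀)).1, 0) :=
      (S.contDiffAt_ηch k j (S.base_mem_Ω hk hfix)).of_le (by exact_mod_cast le_top)
    obtain ⟨r₁, hr₁, C₁, hC₁, hd₁, hb₁, -⟩ := exists_ball_norm_sub_real_le hη
    have hT : ContDiffAt ℝ 1 (fun w => (S.Tch k j w).2) ((split ((S.c k).φ₁ x₀)).1, 0) :=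
      (S.contDiffAt_Tch hk hjd hfix).snd.of_le (by exact_mod_cast le_top)
    obtain ⟨r₂, hr₂, C₂, hC₂, hd₂, hb₂, -⟩ := exists_ball_norm_sub_real_le hT
    set C := max (max C₀ (C₁ * C₀ ^ 2 + 2 * C₀ * C₂)) 1 with hC
    refine ⟨C, le_max_right _ _, ?_⟩
    have hsmall : ∀ᶠ w in 𝓝 (((split ((S.c k).φ₁ x₀)).1, (0 : ℂ)) : 𝕄), ‖w.2‖ ≤ 1 := by
      have : ContinuousAt (fun w : 𝕄 => ‖w.2‖) (((split ((S.c k).φ₁ x₀)).1, 0) : 𝕄) :=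
        continuous_snd.norm.continuousAt
      have h0 : ‖(((split ((S.c k).φ₁ x₀)).1, (0 : ℂ)) : 𝕄).2‖ < 1 := by simp
      exact (this.eventually (gt_mem_nhds h0)).mono fun w hw => hw.le
    filter_upwards [hcomp, ball_mem_nhds _ hr₁, ball_mem_nhds _ hr₂, hsmall] with w hcw hw₁ hw₂ hw1
    have hηnn : 0 ≤ S.ηch k j w := S.η_nonneg j _
    have hηle : S.ηch k j w ≤ 1 := S.η_le_one j _
    refine ⟨?_, ?_⟩
    · -- lower comparability
      have h := hcw.2
      have h2 : ‖w.2‖ ^ 2 ≤ C ^ 2 * ‖(S.Tch k j w).2‖ ^ 2 := by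
        have hC0 : C₀ ≤ C := (le_max_left _ _).trans (le_max_left _ _)
        calc ‖w.2‖ ^ 2 ≤ (C₀ * ‖(S.Tch k j w).2‖) ^ 2 := by gcongr
          _ = C₀ ^ 2 * ‖(S.Tch k j w).2‖ ^ 2 := by ring
          _ ≤ C ^ 2 * ‖(S.Tch k j w).2‖ ^ 2 := by gcongr
      nlinarith
    · -- the derivative of the term
      have hηd : HasFDerivAt (S.ηch k j) (fderiv ℝ (S.ηch k j) w) w := (hd₁ w hw₁).hasFDerivAt
      have hTd : HasFDerivAt (fun w => (S.Tch k j w).2) (fderiv ℝ (fun w => (S.Tch k j w).2) w) w :=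
        (hd₂ w hw₂).hasFDerivAt
      have hN := hTd.norm_sq
      have hprod := hηd.mul hN
      refine ⟨_, hprod, ?_⟩
      -- bound the two summands
      have hT0 : ‖(S.Tch k j w).2‖ ≤ C₀ * ‖w.2‖ := hcw.1
      set B := (innerSL ℝ (S.Tch k j w).2).comp (fderiv ℝ (fun w => (S.Tch k j w).2) w) with hBdef
      have hB : ‖B‖ ≤ C₀ * ‖w.2‖ * C₂ := by
        refine (ContinuousLinearMap.opNorm_comp_le _ _).trans ?_
        rw [innerSL_apply_norm]
        exact mul_le_mul hT0 (hb₂ w hw₂) (norm_nonneg _) (by positivity)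
      have e1 : ‖S.ηch k j w • ((2 : ℕ) • B)‖ ≤ 2 * C₀ * C₂ * ‖w.2‖ := by
        rw [norm_smul, Real.norm_eq_abs, abs_of_nonneg hηnn]
        calc S.ηch k j w * ‖(2 : ℕ) • B‖ ≤ 1 * ((2 : ℕ) * ‖B‖) := by
              gcongr
              exact norm_nsmul_le
          _ ≤ 1 * ((2 : ℕ) * (C₀ * ‖w.2‖ * C₂)) := by gcongr
          _ = 2 * C₀ * C₂ * ‖w.2‖ := by push_cast; ring
      have e2 : ‖(‖(S.Tch k j w).2‖ ^ 2) • fderiv ℝ (S.ηch k j) w‖ ≤ C₁ * C₀ ^ 2 * ‖w.2‖ := by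
        rw [norm_smul, Real.norm_eq_abs, abs_of_nonneg (by positivity)]
        calc ‖(S.Tch k j w).2‖ ^ 2 * ‖fderiv ℝ (S.ηch k j) w‖ ≤ (C₀ * ‖w.2‖) ^ 2 * C₁ := by
              gcongr; exact hb₁ w hw₁
          _ = C₁ * C₀ ^ 2 * ‖w.2‖ * ‖w.2‖ := by ring
          _ ≤ C₁ * C₀ ^ 2 * ‖w.2‖ * 1 := by gcongr
          _ = C₁ * C₀ ^ 2 * ‖w.2‖ := by ring
      calc ‖S.ηch k j w • ((2 : ℕ) • B) + (‖(S.Tch k j w).2‖ ^ 2) • fderiv ℝ (S.ηch k j) w‖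
          ≤ ‖S.ηch k j w • ((2 : ℕ) • B)‖ + ‖(‖(S.Tch k j w).2‖ ^ 2) • fderiv ℝ (S.ηch k j) w‖ :=
            norm_add_le _ _
        _ ≤ 2 * C₀ * C₂ * ‖w.2‖ + C₁ * C₀ ^ 2 * ‖w.2‖ := add_le_add e1 e2
        _ = (C₁ * C₀ ^ 2 + 2 * C₀ * C₂) * ‖w.2‖ := by ring
        _ ≤ C * ‖w.2‖ := by
            gcongr
            exact (le_max_right _ _).trans (le_max_left _ _)
  · -- inactive pair: the weight vanishes identically near the base point
    refine ⟨1, le_rfl, ?_⟩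
    have h0 := S.ηch_eventuallyEq_zero hk hfix hj
    have hev : ∀ᶠ w in 𝓝 (((split ((S.c k).φ₁ x₀)).1, (0 : ℂ)) : 𝕄), S.ηch k j =ᶠ[𝓝 w] 0 :=
      h0.eventually_nhds
    filter_upwards [h0, hev] with w hw hw'
    simp only [Pi.zero_apply] at hw
    refine ⟨by rw [hw]; simp, 0, ?_, by simp⟩
    have : (fun w => S.ηch k j w * ‖(S.Tch k j w).2‖ ^ 2) =ᶠ[𝓝 w] fun _ => 0 := by
      filter_upwards [hw'] with w'' hw''
      simp [hw'']
    exact (hasFDerivAt_const (0 : ℝ) w).congr_of_eventuallyEq this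

end PerPair

/-! ### Radial comparability -/

/-- **Radial comparability.** Near the chart point `w₀` of a branch point read in the pair `k`:
`c ‖w.2‖² ≤ radch w` with `c > 0`, and `radch` is differentiable with `‖D radch w‖ ≤ C ‖w.2‖`.
[folklore] -/
theorem radial_comparability [IsManifold (𝓡 4) ∞ Y₁] (S : Setup ι σ q₁ q₂ N) {k : ι} {x₀ : X}
    (hk : x₀ ∈ (S.c k).dom) (hfix : σ x₀ = x₀) :
    ∃ c : ℝ, 0 < c ∧ ∃ C : ℝ, 0 ≤ C ∧ ∀ᶠ w in 𝓝 (((split ((S.c k).φ₁ x₀)).1, 0) : 𝕄),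
      c * ‖w.2‖ ^ 2 ≤ S.radch k w ∧ DifferentiableAt ℝ (S.radch k) w ∧
        ‖fderiv ℝ (S.radch k) w‖ ≤ C * ‖w.2‖ := by
  classical
  haveI : Nonempty ι := ⟨k⟩
  choose Cj hCj hev using fun j => S.radial_term_facts j hk hfix
  set Cmax : ℝ := ∑ j, Cj j with hCmax
  have hCjle : ∀ j, Cj j ≤ Cmax := fun j =>
    Finset.single_le_sum (fun i _ => zero_le_one.trans (hCj i)) (Finset.mem_univ j)
  have hCmax1 : 1 ≤ Cmax := by
    obtain ⟨j, -⟩ := Finset.univ_nonempty (α := ι)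
    exact (hCj j).trans (hCjle j)
  refine ⟨1 / Cmax ^ 2, by positivity, Cmax, by positivity, ?_⟩
  have hall := eventually_all.2 hev
  have hinf := S.ηinfch_eventuallyEq_zero hk hfix
  have hinf' : ∀ᶠ w in 𝓝 (((split ((S.c k).φ₁ x₀)).1, (0 : ℂ)) : 𝕄), S.ηinfch k =ᶠ[𝓝 w] 0 :=
    hinf.eventually_nhds
  filter_upwards [hall, hinf, hinf'] with w hw hinfw hinfw'
  simp only [Pi.zero_apply] at hinfw
  -- the sum of the weights is one here
  have hsum : ∑ j, S.ηch k j w = 1 := by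
    have := S.sum_η_eq (S.ych k w)
    simp only [ηch]
    rw [this]
    show 1 - S.ηinfch k w = 1
    rw [hinfw, sub_zero]
  -- the derivative of the chart radial function at `w`
  choose D hD hDb using fun j => (hw j).2
  have hfun : S.radch k = fun w => ∑ j, S.ηch k j w * ‖(S.Tch k j w).2‖ ^ 2 + S.ηinfch k w :=
    funext fun w => S.radch_apply k w
  have hinfd : HasFDerivAt (S.ηinfch k) (0 : 𝕄 →L[ℝ] ℝ) w := by
    have : S.ηinfch k =ᶠ[𝓝 w] fun _ => 0 := hinfw'
    exact (hasFDerivAt_const (0 : ℝ) w).congr_of_eventuallyEq this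
  have hrad : HasFDerivAt (S.radch k) (∑ j, D j + 0) w := by
    rw [hfun]
    exact (HasFDerivAt.fun_sum fun j _ => hD j).add hinfd
  refine ⟨?_, hrad.differentiableAt, ?_⟩
  · -- lower bound
    rw [S.radch_apply, hinfw, add_zero]
    calc 1 / Cmax ^ 2 * ‖w.2‖ ^ 2 = ∑ j, S.ηch k j w * ‖w.2‖ ^ 2 / Cmax ^ 2 := by
          rw [← Finset.sum_div, ← Finset.sum_mul, hsum, one_mul]
          ring
      _ ≤ ∑ j, S.ηch k j w * ‖(S.Tch k j w).2‖ ^ 2 := by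
          refine Finset.sum_le_sum fun j _ => ?_
          have h1 := (hw j).1
          have h2 : (Cj j) ^ 2 ≤ Cmax ^ 2 := by
            have := hCjle j; have := hCj j; gcongr
          have hpos : 0 < Cmax ^ 2 := by positivity
          rw [div_le_iff₀ hpos]
          have hnn : 0 ≤ S.ηch k j w * ‖(S.Tch k j w).2‖ ^ 2 :=
            mul_nonneg (S.η_nonneg j _) (by positivity)
          nlinarith
  · -- derivative bound
    rw [hrad.fderiv, add_zero]
    calc ‖∑ j, D j‖ ≤ ∑ j, ‖D j‖ := norm_sum_le _ _
      _ ≤ ∑ j, Cj j * ‖w.2‖ := Finset.sum_le_sum fun j _ => hDb j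
      _ = Cmax * ‖w.2‖ := by rw [hCmax, Finset.sum_mul]

end Setup

end Literature.Topology.FourManifolds

end


/-!
# Weight bounds: the logarithmic cutoff has gradient `O(1/(Λ ‖w₂‖))`

Topic `Topology/FourManifolds`; namespace `Literature.Topology.FourManifolds`. Eleventh file of the
proof of `Literature.Topology.FourManifolds.DegtyarevKharlamov2000_conjQuotient_unique`
(`ConjugationQuotients.lean`). Everything is proved; no named facts.

Read in the source chart of a pair `k` near the chart point `w₀` of a branch point, the weights
`tchᵢ = χch · ηchᵢ`, `tinfch = 1 - ∑ tchᵢ` of the average are smooth, their derivatives sum to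
zero, and — the point of the logarithmic cutoff together with radial comparability
(`Setup.radial_comparability`) — **`‖D χch w‖ · ‖w.2‖ ≤ K/Λ`** (`Setup.norm_fderiv_χch_mul_le`).
Consequently, along any sequence `wₙ → w₀` and parameters `Λₙ → ∞`,
`‖D tch_o⁽ⁿ⁾ (wₙ)‖ · ‖(wₙ).2‖ → 0` for every weight (`Setup.tendsto_fderiv_tch_mul`,
`Setup.tendsto_fderiv_tinfch_mul`).

## References

* A. Degtyarev, V. Kharlamov, Russian Math. Surveys 55 (2000), arXiv:math/0004134, §3.2 ¶1.
  [DegtyarevKharlamov2000]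
-/

noncomputable section

open scoped Manifold ContDiff Topology
open Set Function Filter Metric
open Literature.Topology.FourManifolds.BranchedModel

namespace Literature.Topology.FourManifolds

/-- Local notation: `𝕄` is the split model space `(Fin 2 → ℝ) × ℂ`. -/
local notation "𝕄" => (Fin 2 → ℝ) × ℂ

namespace Setup

variable {X : Type*} [TopologicalSpace X] [ChartedSpace (Fin 2 → ℂ) X]
  {Y₁ : Type*} [TopologicalSpace Y₁] [ChartedSpace (EuclideanSpace ℝ (Fin 4)) Y₁]
  {Y₂ : Type*} [TopologicalSpace Y₂] [ChartedSpace (EuclideanSpace ℝ (Fin 4)) Y₂]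
  {ι : Type*} [Fintype ι] {σ : X → X} {q₁ : X → Y₁} {q₂ : X → Y₂} {N : ℕ}

/-! ### The cutoff read in a chart -/

/-- The cutoff read in the source chart of pair `k`. [folklore] -/
def χch (S : Setup ι σ q₁ q₂ N) (k : ι) (a Λ : ℝ) (w : 𝕄) : ℝ :=
  S.χ a Λ (S.ych k w)

/-- `tchᵢ = χch · ηchᵢ`. [folklore] -/
theorem tch_eq (S : Setup ι σ q₁ q₂ N) (k : ι) (a Λ : ℝ) (i : ι) :
    S.tch k a Λ i = fun w => S.χch k a Λ w * S.ηch k i w :=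
  rfl

/-- `tinfch = 1 - ∑ᵢ tchᵢ`. [folklore] -/
theorem tinfch_eq (S : Setup ι σ q₁ q₂ N) (k : ι) (a Λ : ℝ) :
    S.tinfch k a Λ = fun w => 1 - ∑ i, S.tch k a Λ i w :=
  rfl

/-- `0 ≤ χch ≤ 1`. [folklore] -/
theorem χch_nonneg (S : Setup ι σ q₁ q₂ N) (k : ι) (a Λ : ℝ) (w : 𝕄) : 0 ≤ S.χch k a Λ w :=
  S.χ_nonneg a Λ _

/-- `0 ≤ χch ≤ 1`. [folklore] -/
theorem χch_le_one (S : Setup ι σ q₁ q₂ N) (k : ι) (a Λ : ℝ) (w : 𝕄) : S.χch k a Λ w ≤ 1 :=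
  S.χ_le_one a Λ _

section Smooth

variable [IsManifold (𝓡 4) ∞ Y₁]

/-- The cutoff read in `k` is smooth on `Ωₖ` (`Λ > 0`). [folklore] -/
theorem contDiffAt_χch (S : Setup ι σ q₁ q₂ N) (k : ι) (a : ℝ) {Λ : ℝ} (hΛ : 0 < Λ) {w : 𝕄}
    (hw : w ∈ S.Ω k) : ContDiffAt ℝ ∞ (S.χch k a Λ) w :=
  S.contDiffAt_comp_ych k (S.contMDiff_χ a hΛ) hw

/-- The weights read in `k` are smooth on `Ωₖ`. [folklore] -/
theorem contDiffAt_tch (S : Setup ι σ q₁ q₂ N) (k : ι) (a : ℝ) {Λ : ℝ} (hΛ : 0 < Λ) (i : ι)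
    {w : 𝕄} (hw : w ∈ S.Ω k) : ContDiffAt ℝ ∞ (S.tch k a Λ i) w :=
  S.contDiffAt_comp_ych k (S.contMDiff_t a hΛ i) hw

/-- The weight of the comparison map read in `k` is smooth on `Ωₖ`. [folklore] -/
theorem contDiffAt_tinfch (S : Setup ι σ q₁ q₂ N) (k : ι) (a : ℝ) {Λ : ℝ} (hΛ : 0 < Λ)
    {w : 𝕄} (hw : w ∈ S.Ω k) : ContDiffAt ℝ ∞ (S.tinfch k a Λ) w :=
  S.contDiffAt_comp_ych k (S.contMDiff_tinf a hΛ) hw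

/-- **The derivatives of the weights sum to zero.** [folklore] -/
theorem sum_fderiv_tch (S : Setup ι σ q₁ q₂ N) (k : ι) (a : ℝ) {Λ : ℝ} (hΛ : 0 < Λ) {w : 𝕄}
    (hw : w ∈ S.Ω k) :
    ∑ i, fderiv ℝ (S.tch k a Λ i) w + fderiv ℝ (S.tinfch k a Λ) w = 0 := by
  have h1 : HasFDerivAt (fun w => ∑ i, S.tch k a Λ i w + S.tinfch k a Λ w)
      (∑ i, fderiv ℝ (S.tch k a Λ i) w + fderiv ℝ (S.tinfch k a Λ) w) w :=
    (HasFDerivAt.fun_sum fun i _ => ((S.contDiffAt_tch k a hΛ i hw).differentiableAt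
      (by simp)).hasFDerivAt).add
      ((S.contDiffAt_tinfch k a hΛ hw).differentiableAt (by simp)).hasFDerivAt
  have h2 : HasFDerivAt (fun w => ∑ i, S.tch k a Λ i w + S.tinfch k a Λ w) (0 : 𝕄 →L[ℝ] ℝ) w := by
    have : (fun w => ∑ i, S.tch k a Λ i w + S.tinfch k a Λ w) = fun _ => (1 : ℝ) :=
      funext fun w => S.sum_tch k a Λ w
    rw [this]
    exact hasFDerivAt_const 1 w
  exact h1.unique h2

end Smooth

/-! ### The gradient of the logarithmic cutoff -/

/-- **The logarithmic cutoff has gradient `O(1/(Λ ‖w₂‖))`.** At a point `w ∈ Ωₖ` where radial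
comparability holds (`c ‖w.2‖² ≤ radch w`, `‖D radch w‖ ≤ C ‖w.2‖`), for `Λ > 0`:
`‖D χch w‖ · ‖w.2‖ ≤ (C₀ C / c)/Λ`, `C₀` a bound for the derivative of the smooth transition.
[folklore] -/
theorem norm_fderiv_χch_mul_le (S : Setup ι σ q₁ q₂ N) (k : ι) (a : ℝ)
    {Λ : ℝ} (hΛ : 0 < Λ) {C₀ : ℝ} (hC₀ : ∀ x, ‖deriv Real.smoothTransition x‖ ≤ C₀)
    {c C : ℝ} (hc : 0 < c) (hC : 0 ≤ C) {w : 𝕄}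
    (hlow : c * ‖w.2‖ ^ 2 ≤ S.radch k w) (hdiff : DifferentiableAt ℝ (S.radch k) w)
    (hder : ‖fderiv ℝ (S.radch k) w‖ ≤ C * ‖w.2‖) :
    ‖fderiv ℝ (S.χch k a Λ) w‖ * ‖w.2‖ ≤ C₀ * C / c / Λ := by
  have hC₀nn : 0 ≤ C₀ := (norm_nonneg _).trans (hC₀ 0)
  have hK : 0 ≤ C₀ * C / c / Λ := by positivity
  by_cases hw2 : w.2 = 0
  · rw [hw2, norm_zero, mul_zero]; exact hK
  · -- `radch > 0` at `w`, hence near `w`, where `χch = cut ∘ log ∘ radch`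
    have hn : 0 < ‖w.2‖ := norm_pos_iff.2 hw2
    have hpos : 0 < S.radch k w := lt_of_lt_of_le (by positivity) hlow
    have hcont : ContinuousAt (S.radch k) w := hdiff.continuousAt
    have hev : S.χch k a Λ =ᶠ[𝓝 w] fun w => cut a Λ (Real.log (S.radch k w)) := by
      filter_upwards [hcont.eventually (lt_mem_nhds hpos)] with w' hw'
      exact S.χ_of_pos hΛ hw'
    -- chain rule
    have hlog : HasDerivAt Real.log (S.radch k w)⁻¹ (S.radch k w) := Real.hasDerivAt_log hpos.ne'
    have hcut : HasDerivAt (cut a Λ) (deriv (cut a Λ) (Real.log (S.radch k w)))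
        (Real.log (S.radch k w)) :=
      ((contDiff_cut a Λ).differentiable (by simp) _).hasDerivAt
    have hcomp : HasDerivAt (cut a Λ ∘ Real.log)
        (deriv (cut a Λ) (Real.log (S.radch k w)) * (S.radch k w)⁻¹) (S.radch k w) :=
      hcut.comp _ hlog
    have hF : HasFDerivAt (fun w => cut a Λ (Real.log (S.radch k w)))
        ((deriv (cut a Λ) (Real.log (S.radch k w)) * (S.radch k w)⁻¹) • fderiv ℝ (S.radch k) w) w := by
      have h := hcomp.hasFDerivAt.comp w hdiff.hasFDerivAt
      refine h.congr_fderiv (ContinuousLinearMap.ext fun v => ?_)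
      simp [ContinuousLinearMap.toSpanSingleton_apply, mul_comm]
    have hF' : HasFDerivAt (S.χch k a Λ)
        ((deriv (cut a Λ) (Real.log (S.radch k w)) * (S.radch k w)⁻¹) • fderiv ℝ (S.radch k) w) w :=
      hF.congr_of_eventuallyEq hev
    rw [hF'.fderiv, norm_smul, norm_mul, norm_inv, Real.norm_of_nonneg hpos.le]
    have hd : ‖deriv (cut a Λ) (Real.log (S.radch k w))‖ ≤ C₀ / Λ := norm_deriv_cut_le hC₀ a hΛ _
    have hinv : (S.radch k w)⁻¹ ≤ (c * ‖w.2‖ ^ 2)⁻¹ := inv_anti₀ (by positivity) hlow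
    calc ‖deriv (cut a Λ) (Real.log (S.radch k w))‖ * (S.radch k w)⁻¹ * ‖fderiv ℝ (S.radch k) w‖ * ‖w.2‖
        ≤ C₀ / Λ * (c * ‖w.2‖ ^ 2)⁻¹ * (C * ‖w.2‖) * ‖w.2‖ := by gcongr
      _ = C₀ * C / c / Λ := by field_simp

/-- **The gradient of a weight, times `‖w₂‖`, is small**: with the notation above,
`‖D tchᵢ w‖ · ‖w.2‖ ≤ ‖D ηchᵢ w‖ · ‖w.2‖ + (C₀ C / c)/Λ`. [folklore] -/
theorem norm_fderiv_tch_mul_le [IsManifold (𝓡 4) ∞ Y₁] (S : Setup ι σ q₁ q₂ N) (k : ι) (a : ℝ)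
    {Λ : ℝ} (hΛ : 0 < Λ) {C₀ : ℝ} (hC₀ : ∀ x, ‖deriv Real.smoothTransition x‖ ≤ C₀)
    {c C : ℝ} (hc : 0 < c) (hC : 0 ≤ C) {w : 𝕄} (hw : w ∈ S.Ω k)
    (hlow : c * ‖w.2‖ ^ 2 ≤ S.radch k w) (hdiff : DifferentiableAt ℝ (S.radch k) w)
    (hder : ‖fderiv ℝ (S.radch k) w‖ ≤ C * ‖w.2‖) (i : ι) :
    ‖fderiv ℝ (S.tch k a Λ i) w‖ * ‖w.2‖ ≤
      ‖fderiv ℝ (S.ηch k i) w‖ * ‖w.2‖ + C₀ * C / c / Λ := by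
  have hχ : HasFDerivAt (S.χch k a Λ) (fderiv ℝ (S.χch k a Λ) w) w :=
    ((S.contDiffAt_χch k a hΛ hw).differentiableAt (by simp)).hasFDerivAt
  have hη : HasFDerivAt (S.ηch k i) (fderiv ℝ (S.ηch k i) w) w :=
    ((S.contDiffAt_ηch k i hw).differentiableAt (by simp)).hasFDerivAt
  have hprod : HasFDerivAt (fun w => S.χch k a Λ w * S.ηch k i w)
      (S.χch k a Λ w • fderiv ℝ (S.ηch k i) w + S.ηch k i w • fderiv ℝ (S.χch k a Λ) w) w :=
    hχ.mul hη
  rw [S.tch_eq k a Λ i, hprod.fderiv]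
  have h1 : ‖S.χch k a Λ w • fderiv ℝ (S.ηch k i) w‖ ≤ ‖fderiv ℝ (S.ηch k i) w‖ := by
    rw [norm_smul, Real.norm_eq_abs, abs_of_nonneg (S.χch_nonneg k a Λ w)]
    exact mul_le_of_le_one_left (norm_nonneg _) (S.χch_le_one k a Λ w)
  have h2 : ‖S.ηch k i w • fderiv ℝ (S.χch k a Λ) w‖ ≤ ‖fderiv ℝ (S.χch k a Λ) w‖ := by
    rw [norm_smul, Real.norm_eq_abs, abs_of_nonneg (show 0 ≤ S.ηch k i w from S.η_nonneg i _)]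
    exact mul_le_of_le_one_left (norm_nonneg _) (show S.ηch k i w ≤ 1 from S.η_le_one i _)
  have h3 := S.norm_fderiv_χch_mul_le k a hΛ hC₀ hc hC hlow hdiff hder
  calc ‖S.χch k a Λ w • fderiv ℝ (S.ηch k i) w + S.ηch k i w • fderiv ℝ (S.χch k a Λ) w‖ * ‖w.2‖
      ≤ (‖fderiv ℝ (S.ηch k i) w‖ + ‖fderiv ℝ (S.χch k a Λ) w‖) * ‖w.2‖ := by
        gcongr
        exact (norm_add_le _ _).trans (add_le_add h1 h2)
    _ = ‖fderiv ℝ (S.ηch k i) w‖ * ‖w.2‖ + ‖fderiv ℝ (S.χch k a Λ) w‖ * ‖w.2‖ := by ring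
    _ ≤ ‖fderiv ℝ (S.ηch k i) w‖ * ‖w.2‖ + C₀ * C / c / Λ := by gcongr

/-! ### Limits along sequences -/

/-- **Along `wₙ → w₀` and `Λₙ → ∞`, `‖D tchᵢ⁽ⁿ⁾ (wₙ)‖ · ‖(wₙ).2‖ → 0`.** [folklore] -/
theorem tendsto_fderiv_tch_mul [IsManifold (𝓡 4) ∞ Y₁] (S : Setup ι σ q₁ q₂ N) {k : ι} {x₀ : X}
    (hk : x₀ ∈ (S.c k).dom) (hfix : σ x₀ = x₀) (a Λ : ℕ → ℝ) (hΛ : ∀ n, 0 < Λ n)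
    (hΛ' : Tendsto Λ atTop atTop) {w : ℕ → 𝕄}
    (hw : Tendsto w atTop (𝓝 (((split ((S.c k).φ₁ x₀)).1, 0) : 𝕄))) (i : ι) :
    Tendsto (fun n => ‖fderiv ℝ (S.tch k (a n) (Λ n) i) (w n)‖ * ‖(w n).2‖) atTop (𝓝 0) := by
  obtain ⟨C₀, hC₀pos, hC₀⟩ := exists_bound_deriv_smoothTransition
  obtain ⟨c, hc, C, hC, hev⟩ := S.radial_comparability hk hfix
  set w₀ : 𝕄 := ((split ((S.c k).φ₁ x₀)).1, 0) with hw₀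
  -- eventually along the sequence: comparability, membership in `Ω`, and a bound for `D ηchᵢ`
  have hΩ : ∀ᶠ w' in 𝓝 w₀, w' ∈ S.Ω k := (S.isOpen_Ω k).mem_nhds (S.base_mem_Ω hk hfix)
  have hηc : ContDiffAt ℝ 1 (S.ηch k i) w₀ :=
    (S.contDiffAt_ηch k i (S.base_mem_Ω hk hfix)).of_le (by exact_mod_cast le_top)
  obtain ⟨r, hr, Cη, hCη, -, hbη, -⟩ := exists_ball_norm_sub_real_le hηc
  have hb : ∀ᶠ w' in 𝓝 w₀, ‖fderiv ℝ (S.ηch k i) w'‖ ≤ Cη :=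
    Filter.eventually_of_mem (ball_mem_nhds w₀ hr) hbη
  have hall : ∀ᶠ n in atTop, w n ∈ S.Ω k ∧ (c * ‖(w n).2‖ ^ 2 ≤ S.radch k (w n) ∧
      DifferentiableAt ℝ (S.radch k) (w n) ∧ ‖fderiv ℝ (S.radch k) (w n)‖ ≤ C * ‖(w n).2‖) ∧
      ‖fderiv ℝ (S.ηch k i) (w n)‖ ≤ Cη :=
    hw.eventually (hΩ.and (hev.and hb))
  -- the two majorants tend to zero
  have h2 : Tendsto (fun n => ‖(w n).2‖) atTop (𝓝 0) := by
    have : Tendsto (fun n => (w n).2) atTop (𝓝 0) := by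
      have h := (continuous_snd.tendsto w₀).comp hw
      simpa [hw₀, Function.comp_def] using h
    simpa using this.norm
  have hmaj : Tendsto (fun n => Cη * ‖(w n).2‖ + C₀ * C / c / Λ n) atTop (𝓝 0) := by
    have h3 : Tendsto (fun n => C₀ * C / c / Λ n) atTop (𝓝 0) := by
      have := hΛ'.inv_tendsto_atTop
      simpa [div_eq_mul_inv] using this.const_mul (C₀ * C / c)
    simpa using (h2.const_mul Cη).add h3
  refine squeeze_zero' (Eventually.of_forall fun n => by positivity) ?_ hmaj
  filter_upwards [hall] with n hn
  obtain ⟨hΩn, ⟨hlow, hdiff, hder⟩, hηb⟩ := hn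
  calc ‖fderiv ℝ (S.tch k (a n) (Λ n) i) (w n)‖ * ‖(w n).2‖
      ≤ ‖fderiv ℝ (S.ηch k i) (w n)‖ * ‖(w n).2‖ + C₀ * C / c / Λ n :=
        S.norm_fderiv_tch_mul_le k (a n) (hΛ n) hC₀ hc hC hΩn hlow hdiff hder i
    _ ≤ Cη * ‖(w n).2‖ + C₀ * C / c / Λ n := by gcongr

/-- **Along `wₙ → w₀` and `Λₙ → ∞`, `‖D tinfch⁽ⁿ⁾ (wₙ)‖ · ‖(wₙ).2‖ → 0`.** [folklore] -/
theorem tendsto_fderiv_tinfch_mul [IsManifold (𝓡 4) ∞ Y₁] (S : Setup ι σ q₁ q₂ N) {k : ι} {x₀ : X}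
    (hk : x₀ ∈ (S.c k).dom) (hfix : σ x₀ = x₀) (a Λ : ℕ → ℝ) (hΛ : ∀ n, 0 < Λ n)
    (hΛ' : Tendsto Λ atTop atTop) {w : ℕ → 𝕄}
    (hw : Tendsto w atTop (𝓝 (((split ((S.c k).φ₁ x₀)).1, 0) : 𝕄))) :
    Tendsto (fun n => ‖fderiv ℝ (S.tinfch k (a n) (Λ n)) (w n)‖ * ‖(w n).2‖) atTop (𝓝 0) := by
  have hΩ : ∀ᶠ n in atTop, w n ∈ S.Ω k :=
    hw.eventually ((S.isOpen_Ω k).mem_nhds (S.base_mem_Ω hk hfix))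
  have hsum : Tendsto (fun n => ∑ i, ‖fderiv ℝ (S.tch k (a n) (Λ n) i) (w n)‖ * ‖(w n).2‖)
      atTop (𝓝 0) := by
    have := tendsto_finsetSum (Finset.univ : Finset ι)
      fun i _ => S.tendsto_fderiv_tch_mul hk hfix a Λ hΛ hΛ' hw i
    simpa using this
  refine squeeze_zero' (Eventually.of_forall fun n => by positivity) ?_ hsum
  filter_upwards [hΩ] with n hn
  have h0 := S.sum_fderiv_tch k (a n) (hΛ n) hn
  have : fderiv ℝ (S.tinfch k (a n) (Λ n)) (w n) = -∑ i, fderiv ℝ (S.tch k (a n) (Λ n) i) (w n) :=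
    eq_neg_of_add_eq_zero_right h0
  rw [this, norm_neg, ← Finset.sum_mul]
  gcongr
  exact norm_sum_le _ _

end Setup

end Literature.Topology.FourManifolds

end


/-!
# The derivative of the averaged map read in a chart pair

Topic `Topology/FourManifolds`; namespace `Literature.Topology.FourManifolds`. Twelfth file of the
proof of `Literature.Topology.FourManifolds.DegtyarevKharlamov2000_conjQuotient_unique`
(`ConjugationQuotients.lean`). Everything is proved; no named facts.

Near the chart point `w₀` of a branch point read in the pair `k`, the averaged map is
`Φch = Rch ∘ avgch` with `avgch = ∑ᵢ tchᵢ • Ech ∘ Gᵢ + tinfch • Ech ∘ Gh`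
(`Setup.avgch_eventuallyEq`, `Gᵢ = crossLocᵢ`, `Gh = Θh`). This file computes its derivative
(`Setup.hasFDerivAt_avgch`, `Setup.hasFDerivAt_Φch`):

  `D Φch = D Rch ∘ (Alin + Blin)`,
  `Alin = ∑ᵢ tchᵢ • (D Ech ∘ D Gᵢ) + tinfch • (D Ech ∘ polarDeriv θₖ p)`,
  `Blin = ∑ᵢ (D tchᵢ) ⊗ Ech (Gᵢ w) + (D tinfch) ⊗ Ech (Gh w)`,

valid at a point `w = sqModel (u, s • e)` with polar data `p = (u, s, e)`; inactive terms (weights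
vanishing identically near `w`, the comparison term at branch points) contribute consistently with
the same formula. It also provides the facts discharging the hypotheses near `w₀`
(`Setup.eventually_derivative_hyps`, `Setup.exists_polar`).

## References

* A. Degtyarev, V. Kharlamov, Russian Math. Surveys 55 (2000), arXiv:math/0004134, §3.2 ¶1.
  [DegtyarevKharlamov2000]
-/

noncomputable section

open scoped Manifold ContDiff Topology
open Set Function Filter Metric
open Literature.Topology.FourManifolds.BranchedModel

namespace Literature.Topology.FourManifolds

/-- Local notation: `𝕄` is the split model space `(Fin 2 → ℝ) × ℂ`. -/
local notation "𝕄" => (Fin 2 → ℝ) × ℂ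

/-- Local notation: the Euclidean space `ℝᴺ`. -/
local notation "𝔼" N:arg => EuclideanSpace ℝ (Fin N)

/-- Local notation: the polar parameter space `(u, s, e)`. -/
local notation "ℙ" => (Fin 2 → ℝ) × ℝ × ℂ

namespace Setup

variable {X : Type*} [TopologicalSpace X] [ChartedSpace (Fin 2 → ℂ) X]
  {Y₁ : Type*} [TopologicalSpace Y₁] [ChartedSpace (EuclideanSpace ℝ (Fin 4)) Y₁]
  {Y₂ : Type*} [TopologicalSpace Y₂] [ChartedSpace (EuclideanSpace ℝ (Fin 4)) Y₂]
  {ι : Type*} [Fintype ι] {σ : X → X} {q₁ : X → Y₁} {q₂ : X → Y₂} {N : ℕ}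

/-! ### The linear data -/

/-- The local solution of `i` read in `k`. [folklore] -/
def Gx (S : Setup ι σ q₁ q₂ N) (k i : ι) : 𝕄 → 𝕄 :=
  (S.c i).crossLoc (S.c k)

/-- The comparison map read in `k`. [folklore] -/
def Gh (S : Setup ι σ q₁ q₂ N) (k : ι) : 𝕄 → 𝕄 :=
  (S.c k).Θh S.h₁ S.h₂

/-- `D(Ech ∘ Gᵢ)` at `w`. [folklore] -/
def Qx (S : Setup ι σ q₁ q₂ N) (k i : ι) (w : 𝕄) : 𝕄 →L[ℝ] 𝔼 N :=
  (fderiv ℝ (S.Ech k) (S.Gx k i w)).comp (fderiv ℝ (S.Gx k i) w)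

/-- `D Ech ∘ polarDeriv θₖ p` at `w`. [folklore] -/
def Qh (S : Setup ι σ q₁ q₂ N) (k : ι) (w : 𝕄) (p : ℙ) : 𝕄 →L[ℝ] 𝔼 N :=
  (fderiv ℝ (S.Ech k) (S.Gh k w)).comp (polarDeriv (S.c k).θ p)

/-- The main part `Alin = ∑ᵢ tchᵢ • Qxᵢ + tinfch • Qh` of the derivative of the average. [folklore] -/
def Alin (S : Setup ι σ q₁ q₂ N) (k : ι) (a Λ : ℝ) (w : 𝕄) (p : ℙ) : 𝕄 →L[ℝ] 𝔼 N :=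
  ∑ i, S.tch k a Λ i w • S.Qx k i w + S.tinfch k a Λ w • S.Qh k w p

/-- The weight-derivative part `Blin = ∑ᵢ D tchᵢ ⊗ Ech (Gᵢ w) + D tinfch ⊗ Ech (Gh w)`. [folklore] -/
def Blin (S : Setup ι σ q₁ q₂ N) (k : ι) (a Λ : ℝ) (w : 𝕄) : 𝕄 →L[ℝ] 𝔼 N :=
  ∑ i, (fderiv ℝ (S.tch k a Λ i) w).smulRight (S.Ech k (S.Gx k i w)) +
    (fderiv ℝ (S.tinfch k a Λ) w).smulRight (S.Ech k (S.Gh k w))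

/-! ### One term -/

/-- **Derivative of an active term** `t • F`: `t w • F' + Dt ⊗ F w`. [folklore] -/
theorem hasFDerivAt_term_active {t : 𝕄 → ℝ} {F : 𝕄 → 𝔼 N} {F' : 𝕄 →L[ℝ] 𝔼 N} {w : 𝕄}
    (ht : DifferentiableAt ℝ t w) (hF : HasFDerivAt F F' w) :
    HasFDerivAt (fun w => t w • F w) (t w • F' + (fderiv ℝ t w).smulRight (F w)) w :=
  ht.hasFDerivAt.smul hF

/-- **Derivative of an inactive term**: if the weight vanishes identically near `w`, the same
formula holds (both summands vanish) whatever `F'`. [folklore] -/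
theorem hasFDerivAt_term_inactive {t : 𝕄 → ℝ} {F : 𝕄 → 𝔼 N} (F' : 𝕄 →L[ℝ] 𝔼 N) {w : 𝕄}
    (ht : t =ᶠ[𝓝 w] 0) :
    HasFDerivAt (fun w => t w • F w) (t w • F' + (fderiv ℝ t w).smulRight (F w)) w := by
  have h0 : t w = 0 := by simpa using ht.self_of_nhds
  have h1 : fderiv ℝ t w = 0 := by rw [ht.fderiv_eq]; exact fderiv_const_apply 0
  have h2 : t w • F' + (fderiv ℝ t w).smulRight (F w) = 0 := by
    rw [h0, h1]
    refine ContinuousLinearMap.ext fun v => ?_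
    rw [add_apply, smul_apply, ContinuousLinearMap.smulRight_apply, zero_apply, zero_apply,
      zero_smul, zero_smul, add_zero]
  rw [h2]
  refine (hasFDerivAt_const (0 : 𝔼 N) w).congr_of_eventuallyEq ?_
  filter_upwards [ht] with w' hw'
  simp [hw']

/-! ### The derivative of the average and of `Φch` -/

/-- **The derivative of the average read in pair `k`.** At a point `w` near `w₀` where the
representation holds, with polar data `p` for the comparison term: active pairs `i` (those with
`y₀ ∈ tsupport ηᵢ`) need `Gᵢ` and `Ech` differentiable, inactive ones have identically vanishing
weight; the comparison term is either differentiable with derivative `polarDeriv θₖ p` or has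
identically vanishing weight. [folklore] -/
theorem hasFDerivAt_avgch (S : Setup ι σ q₁ q₂ N) {k : ι} {a Λ : ℝ} {w : 𝕄} {p : ℙ}
    (J : ι → Prop)
    (hrep : S.avgch k a Λ =ᶠ[𝓝 w] fun w =>
      ∑ i, S.tch k a Λ i w • S.Ech k ((S.c i).crossLoc (S.c k) w) +
        S.tinfch k a Λ w • S.Ech k ((S.c k).Θh S.h₁ S.h₂ w))
    (htd : ∀ i, J i → DifferentiableAt ℝ (S.tch k a Λ i) w)
    (hG : ∀ i, J i → DifferentiableAt ℝ (S.Gx k i) w ∧ DifferentiableAt ℝ (S.Ech k) (S.Gx k i w))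
    (hti : ∀ i, ¬J i → S.tch k a Λ i =ᶠ[𝓝 w] 0)
    (hh : (DifferentiableAt ℝ (S.tinfch k a Λ) w ∧ HasFDerivAt (S.Gh k) (polarDeriv (S.c k).θ p) w ∧
        DifferentiableAt ℝ (S.Ech k) (S.Gh k w)) ∨ S.tinfch k a Λ =ᶠ[𝓝 w] 0) :
    HasFDerivAt (S.avgch k a Λ) (S.Alin k a Λ w p + S.Blin k a Λ w) w := by
  classical
  -- the terms of the pairs
  have hterm : ∀ i, HasFDerivAt (fun w => S.tch k a Λ i w • S.Ech k (S.Gx k i w))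
      (S.tch k a Λ i w • S.Qx k i w +
        (fderiv ℝ (S.tch k a Λ i) w).smulRight (S.Ech k (S.Gx k i w))) w := by
    intro i
    by_cases hJ : J i
    · obtain ⟨hGd, hEd⟩ := hG i hJ
      exact hasFDerivAt_term_active (htd i hJ) (hEd.hasFDerivAt.comp w hGd.hasFDerivAt)
    · exact hasFDerivAt_term_inactive _ (hti i hJ)
  -- the comparison term
  have hterm' : HasFDerivAt (fun w => S.tinfch k a Λ w • S.Ech k (S.Gh k w))
      (S.tinfch k a Λ w • S.Qh k w p +
        (fderiv ℝ (S.tinfch k a Λ) w).smulRight (S.Ech k (S.Gh k w))) w := by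
    rcases hh with ⟨htd', hGh, hEd⟩ | h0
    · exact hasFDerivAt_term_active htd' (hEd.hasFDerivAt.comp w hGh)
    · exact hasFDerivAt_term_inactive _ h0
  have hsum := (HasFDerivAt.fun_sum fun i (_ : i ∈ Finset.univ) => hterm i).add hterm'
  have hsum' : HasFDerivAt (S.avgch k a Λ)
      (∑ i, (S.tch k a Λ i w • S.Qx k i w +
        (fderiv ℝ (S.tch k a Λ i) w).smulRight (S.Ech k (S.Gx k i w))) +
        (S.tinfch k a Λ w • S.Qh k w p +
          (fderiv ℝ (S.tinfch k a Λ) w).smulRight (S.Ech k (S.Gh k w)))) w :=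
    hsum.congr_of_eventuallyEq hrep
  refine hsum'.congr_fderiv ?_
  simp only [Alin, Blin, Finset.sum_add_distrib]
  abel

/-- **The derivative of `Φch = Rch ∘ avgch`.** [folklore] -/
theorem hasFDerivAt_Φch (S : Setup ι σ q₁ q₂ N) {k : ι} {a Λ : ℝ} {w : 𝕄}
    {D : 𝕄 →L[ℝ] 𝔼 N} (havg : HasFDerivAt (S.avgch k a Λ) D w)
    (hR : DifferentiableAt ℝ (S.Rch k) (S.avgch k a Λ w)) :
    HasFDerivAt (S.Φch k a Λ) ((fderiv ℝ (S.Rch k) (S.avgch k a Λ w)).comp D) w :=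
  hR.hasFDerivAt.comp w havg

/-! ### Discharging the hypotheses near the base point -/

section Hyps

/-- The local solution of an active pair read in `k` is smooth at `w₀`. [folklore] -/
theorem contDiffAt_Gx [IsManifold (𝓡 4) ∞ Y₁] [IsManifold (𝓡 4) ∞ Y₂] (S : Setup ι σ q₁ q₂ N) {k i : ι} {x₀ : X} (hk : x₀ ∈ (S.c k).dom)
    (hfix : σ x₀ = x₀) (hi : q₁ x₀ ∈ tsupport (S.η i)) :
    ContDiffAt ℝ ∞ (S.Gx k i) ((split ((S.c k).φ₁ x₀)).1, 0) := by
  have hyV := S.tsupport_η_subset i hi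
  have hid : x₀ ∈ (S.c i).dom := S.mem_dom_of_mem_tsupport hfix hi
  have hfl : (S.c i).floc (q₁ x₀) = q₂ x₀ := (S.c i).floc_apply_of_mem_fixedPoints hid hfix
  have h := (S.c i).contDiffAt_crossLoc (S.c k) (S.pos i) hyV.1 ((S.c k).adapted₁ x₀ hk.1).2.2.1
    (by rw [hfl]; exact ((S.c k).adapted₂ x₀ hk.2).2.2.1)
  rwa [(S.base_facts hk hfix).1] at h

/-- **Near `w₀`, the active local solutions are `C¹`.** [folklore] -/
theorem eventually_contDiffAt_Gx [IsManifold (𝓡 4) ∞ Y₁] [IsManifold (𝓡 4) ∞ Y₂]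
    (S : Setup ι σ q₁ q₂ N) {k i : ι} {x₀ : X} (hk : x₀ ∈ (S.c k).dom)
    (hfix : σ x₀ = x₀) (hi : q₁ x₀ ∈ tsupport (S.η i)) :
    ∀ᶠ w in 𝓝 (((split ((S.c k).φ₁ x₀)).1, 0) : 𝕄), ContDiffAt ℝ 1 (S.Gx k i) w :=
  ((S.contDiffAt_Gx hk hfix hi).of_le (by exact_mod_cast le_top)).eventually (by simp)

/-- The set of good target chart points is an open neighbourhood of `z₀ = θ w₀`, and `Ech` is
`C¹` on it. [folklore] -/
theorem eventually_contDiffAt_Ech (S : Setup ι σ q₁ q₂ N) {k : ι} {x₀ : X} (hk : x₀ ∈ (S.c k).dom)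
    (hfix : σ x₀ = x₀) :
    ∀ᶠ z in 𝓝 ((S.c k).θ ((split ((S.c k).φ₁ x₀)).1, 0)), ContDiffAt ℝ 1 (S.Ech k) z := by
  have hz₀ : splitW.symm ((S.c k).θ ((split ((S.c k).φ₁ x₀)).1, 0)) ∈ (S.c k).ψ₂.target := by
    rw [← (S.base_facts hk hfix).2.2.1, ContinuousLinearEquiv.symm_apply_apply]
    exact (S.c k).ψ₂.map_source (S.base_facts hk hfix).2.2.2
  filter_upwards [(S.isOpen_Ech_good k).mem_nhds hz₀] with z hz
  exact (S.contDiffAt_Ech k hz).of_le (by exact_mod_cast le_top)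

/-- **Inactive weights vanish identically near every point near `w₀`, for all parameters.**
[folklore] -/
theorem eventually_tch_eventuallyEq_zero (S : Setup ι σ q₁ q₂ N) {k i : ι} {x₀ : X}
    (hk : x₀ ∈ (S.c k).dom) (hfix : σ x₀ = x₀) (hi : q₁ x₀ ∉ tsupport (S.η i)) :
    ∀ᶠ w in 𝓝 (((split ((S.c k).φ₁ x₀)).1, 0) : 𝕄), ∀ a Λ : ℝ, S.tch k a Λ i =ᶠ[𝓝 w] 0 := by
  filter_upwards [(S.ηch_eventuallyEq_zero hk hfix hi).eventually_nhds] with w hw a Λ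
  filter_upwards [hw] with w' hw'
  simp only [Pi.zero_apply] at hw' ⊢
  rw [S.tch_eq]
  simp [hw']

/-- At a chart point over the branch locus the weight of the comparison map vanishes identically
nearby. [folklore] -/
theorem tinfch_eventuallyEq_zero (S : Setup ι σ q₁ q₂ N) {k : ι} (a Λ : ℝ) {w : 𝕄}
    (hw : w ∈ S.Ω k) (hB : S.ych k w ∈ q₁ '' fixedPoints σ) :
    S.tinfch k a Λ =ᶠ[𝓝 w] 0 := by
  have h := S.tinf_eventuallyEq_zero a Λ hB
  exact ((S.continuousAt_ych k hw).tendsto.eventually h).mono fun w' hw' => by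
    simpa [tinfch] using hw'

/-- **Polar data off the branch locus**: a chart point `w` with `w.2 ≠ 0` is `sqModel (w.1, s • e)`
with `s > 0`, `‖e‖ = 1`, `s ^ 2 = ‖w.2‖`. [folklore] -/
theorem exists_polar (w : 𝕄) (hw : w.2 ≠ 0) :
    ∃ s : ℝ, 0 < s ∧ ∃ e : ℂ, ‖e‖ = 1 ∧ w = sqModel (w.1, s • e) ∧ s ^ 2 = ‖w.2‖ := by
  obtain ⟨z, hz⟩ : ∃ z : ℂ, z ^ 2 = w.2 := ⟨w.2 ^ ((2 : ℕ)⁻¹ : ℂ), Complex.cpow_nat_inv_pow _ two_ne_zero⟩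
  have hz0 : z ≠ 0 := by rintro rfl; exact hw (by rw [← hz]; simp)
  have hn : 0 < ‖z‖ := norm_pos_iff.2 hz0
  refine ⟨‖z‖, hn, (‖z‖⁻¹ : ℝ) • z, ?_, ?_, ?_⟩
  · rw [norm_smul, norm_inv, norm_norm, inv_mul_cancel₀ hn.ne']
  · rw [smul_inv_smul₀ hn.ne']
    obtain ⟨u, w₂⟩ := w
    simp only [sqModel_apply, Prod.mk.injEq, true_and]
    exact hz.symm
  · rw [← hz, norm_pow]

/-- The comparison map read in `k` is differentiable at `sqModel (u, s • e)` with derivative the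
polar derivative field, when `(u, s • e) ∈ θ.source`, `s ≠ 0`, `e ≠ 0`. [folklore] -/
theorem hasFDerivAt_Gh (S : Setup ι σ q₁ q₂ N) (k : ι) {u : Fin 2 → ℝ} {s : ℝ} {e : ℂ}
    (hx : ((u, s • e) : 𝕄) ∈ (S.c k).θ.source) (hs : s ≠ 0) (he : e ≠ 0) :
    HasFDerivAt (S.Gh k) (polarDeriv (S.c k).θ (u, s, e)) (sqModel (u, s • e)) :=
  (S.c k).hasFDerivAt_Θh_polar S.h₁ S.h₂ hx hs he

/-- `Rch` is `C¹` on the open set of tube points retracting into the chart domain, an open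
neighbourhood of `emb (q₂ x₀)`. [folklore] -/
theorem eventually_contDiffAt_Rch (S : Setup ι σ q₁ q₂ N) {k : ι} {x₀ : X} (hk : x₀ ∈ (S.c k).dom) :
    ∀ᶠ p in 𝓝 (S.emb (q₂ x₀)), ContDiffAt ℝ 1 (S.Rch k) p := by
  have hopen : IsOpen (S.tube ∩ S.retr ⁻¹' (S.c k).ψ₂.source) :=
    S.retr_smooth.continuousOn.isOpen_inter_preimage S.tube_open (S.c k).ψ₂.open_source
  have hmem : S.emb (q₂ x₀) ∈ S.tube ∩ S.retr ⁻¹' (S.c k).ψ₂.source :=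
    ⟨S.emb_mem _, by rw [mem_preimage, S.retr_emb]; exact ((S.c k).adapted₂ x₀ hk.2).2.2.1⟩
  filter_upwards [hopen.mem_nhds hmem] with p hp
  exact (S.contDiffAt_Rch k hp.1 hp.2).of_le (by exact_mod_cast le_top)

end Hyps

end Setup

end Literature.Topology.FourManifolds

end


/-!
# The limit operator at a branch point and its invertibility

Topic `Topology/FourManifolds`; namespace `Literature.Topology.FourManifolds`. Thirteenth file of
the proof of `Literature.Topology.FourManifolds.DegtyarevKharlamov2000_conjQuotient_unique`
(`ConjugationQuotients.lean`). Everything is proved; no named facts.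

Along a sequence of chart points `wₙ → w₀` converging to the chart point of a branch point, the
derivative of the averaged map converges (after extraction) to the **limit operator**

  `Mstar = ∑ᵢ T*ᵢ • D Gᵢ (w₀) + T*_h • polarDeriv θₖ (u₀, 0, e*)`

(`Setup.Mstar`), a convex combination (`∑ T*ᵢ + T*_h = 1`, weights of inactive pairs zero) of the
derivatives of the local solutions and of the polar derivative field of the comparison map in the
limit direction `e*`. By `crossLoc_firstOrder` and `polarDeriv_zero_apply_*` all these operators
are block lower-triangular for the splitting (real, normal) with the SAME real block `D γₖ (u₀)`
(injective) and normal blocks `λᵢ • polarSq Lₖ` (`λᵢ > 0`) resp. `dirNormal Lₖ e*`; the `2 × 2`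
lemma `injective_smul_polarSq_add_smul_dirNormal` and the positivity of the pair `k` then give
**`Mstar` is injective** (`Setup.injective_Mstar`), hence a unit of the operator algebra
(`isUnit_of_injective`). Also: `D Rch ∘ D Ech = id` at the base point
(`Setup.fderiv_Rch_comp_fderiv_Ech`).

## References

* A. Degtyarev, V. Kharlamov, Russian Math. Surveys 55 (2000), arXiv:math/0004134, §3.2 ¶1.
  [DegtyarevKharlamov2000]
-/

noncomputable section

open scoped Manifold ContDiff Topology
open Set Function Filter Metric
open Literature.Topology.FourManifolds.BranchedModel

namespace Literature.Topology.FourManifolds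

/-- Local notation: `𝕄` is the split model space `(Fin 2 → ℝ) × ℂ`. -/
local notation "𝕄" => (Fin 2 → ℝ) × ℂ

/-- Local notation: the Euclidean space `ℝᴺ`. -/
local notation "𝔼" N:arg => EuclideanSpace ℝ (Fin N)

/-- **An injective endomorphism of a finite-dimensional normed space is a unit** of the algebra
of bounded operators. [folklore] -/
theorem isUnit_of_injective {V : Type*} [NormedAddCommGroup V] [NormedSpace ℝ V]
    [FiniteDimensional ℝ V] {A : V →L[ℝ] V} (hA : Injective A) : IsUnit A := by
  have hb : Bijective A := ⟨hA, LinearMap.surjective_of_injective (f := A.toLinearMap) hA⟩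
  set e : V ≃L[ℝ] V := (LinearEquiv.ofBijective A.toLinearMap hb).toContinuousLinearEquiv with he
  have hcoe : (e : V →L[ℝ] V) = A := by
    ext v; rfl
  rw [← hcoe]
  exact ⟨(ContinuousLinearEquiv.unitsEquiv ℝ V).symm e, rfl⟩

namespace Setup

variable {X : Type*} [TopologicalSpace X] [ChartedSpace (Fin 2 → ℂ) X]
  {Y₁ : Type*} [TopologicalSpace Y₁] [ChartedSpace (EuclideanSpace ℝ (Fin 4)) Y₁]
  {Y₂ : Type*} [TopologicalSpace Y₂] [ChartedSpace (EuclideanSpace ℝ (Fin 4)) Y₂]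
  {ι : Type*} [Fintype ι] {σ : X → X} {q₁ : X → Y₁} {q₂ : X → Y₂} {N : ℕ}

/-- **The limit operator** at the branch point `q₁ x₀` read in pair `k`, for limit weights
`T, Th` and limit direction `e`. [folklore] -/
def Mstar (S : Setup ι σ q₁ q₂ N) (k : ι) (x₀ : X) (T : ι → ℝ) (Th : ℝ) (e : ℂ) : 𝕄 →L[ℝ] 𝕄 :=
  ∑ i, T i • fderiv ℝ (S.Gx k i) ((split ((S.c k).φ₁ x₀)).1, 0) +
    Th • polarDeriv (S.c k).θ ((split ((S.c k).φ₁ x₀)).1, 0, e)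

/-- **The limit operator is injective.** [folklore] -/
theorem injective_Mstar (S : Setup ι σ q₁ q₂ N) {k : ι} {x₀ : X} (hk : x₀ ∈ (S.c k).dom)
    (hfix : σ x₀ = x₀) {T : ι → ℝ} {Th : ℝ} {e : ℂ} (hT : ∀ i, 0 ≤ T i) (hTh : 0 ≤ Th)
    (hsum : ∑ i, T i + Th = 1) (hT0 : ∀ i, q₁ x₀ ∉ tsupport (S.η i) → T i = 0) (he : ‖e‖ = 1) :
    Injective (S.Mstar k x₀ T Th e) := by
  classical
  set u₀ := (split ((S.c k).φ₁ x₀)).1 with hu₀def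
  have hu₀ : u₀ ∈ (S.c k).realSource := (S.c k).fst_split_φ₁_mem_realSource hk hfix
  have hu₀' : ((u₀, 0) : 𝕄) ∈ (S.c k).θ.source := hu₀
  set L := (S.c k).L u₀ with hLdef
  have hLpos : ‖anticonformalPart L‖ < ‖conformalPart L‖ := S.pos k u₀ hu₀'
  -- structural data for every pair (for inactive pairs borrow those of an active one, if any)
  have key : ∀ i, ∃ D : 𝕄 →L[ℝ] 𝕄, ∃ lam : ℝ, 0 ≤ lam ∧ (T i ≠ 0 → 0 < lam) ∧
      T i • fderiv ℝ (S.Gx k i) (u₀, 0) = T i • D ∧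
      (∀ a : Fin 2 → ℝ, D (a, 0) = (fderiv ℝ (S.c k).γ u₀ a, 0)) ∧
      normalPart D = lam • polarSq L := by
    intro i
    by_cases hi : q₁ x₀ ∈ tsupport (S.η i)
    · have hid : x₀ ∈ (S.c i).dom := S.mem_dom_of_mem_tsupport hfix hi
      obtain ⟨D, hD, hreal, lam, hlam, hN⟩ :=
        (S.c i).crossLoc_firstOrder (S.c k) S.h₁ S.h₂ (S.pos i) (S.pos k) hk hid hfix
      refine ⟨D, lam, hlam.le, fun _ => hlam, ?_, hreal, hN⟩
      have : fderiv ℝ (S.Gx k i) (u₀, 0) = D := hD.fderiv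
      rw [this]
    · -- inactive: `T i = 0`; use the reference operator `(a, b) ↦ (Dγ a, polarSq L b)`
      refine ⟨(ContinuousLinearMap.inl ℝ (Fin 2 → ℝ) ℂ).comp ((fderiv ℝ (S.c k).γ u₀).comp
        (ContinuousLinearMap.fst ℝ (Fin 2 → ℝ) ℂ)) + (ContinuousLinearMap.inr ℝ (Fin 2 → ℝ) ℂ).comp
        ((polarSq L).comp (ContinuousLinearMap.snd ℝ (Fin 2 → ℝ) ℂ)), 1, zero_le_one,
        fun h => absurd (hT0 i hi) h, ?_, fun a => ?_, ?_⟩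
      · rw [hT0 i hi]
        exact ContinuousLinearMap.ext fun v => by simp only [smul_apply, zero_smul]
      · simp
      · refine ContinuousLinearMap.ext fun b => ?_
        rw [normalPart_apply]
        simp
  choose D lam hlam0 hlampos hTD hDreal hDN using key
  -- rewrite the operator through the structural data
  have hM : ∀ v : 𝕄, S.Mstar k x₀ T Th e v = ∑ i, T i • D i v + Th • polarDeriv (S.c k).θ (u₀, 0, e) v := by
    intro v
    simp only [Mstar, add_apply, sum_apply, smul_apply]
    congr 1
    refine Finset.sum_congr rfl fun i _ => ?_
    have := congrArg (fun A : 𝕄 →L[ℝ] 𝕄 => A v) (hTD i)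
    simpa only [smul_apply] using this
  -- facts about `θ` at the base point
  have hθd : DifferentiableAt ℝ (S.c k).θ (u₀, 0) := ((S.c k).contDiffAt_θ hu₀').differentiableAt (by simp)
  have hθ0 : ((S.c k).θ (u₀, 0)).2 = 0 := (S.c k).θ_snd_eq_zero hu₀'
  -- injectivity
  rw [injective_iff_map_eq_zero]
  rintro ⟨a, b⟩ hv
  -- the normal component: `(α • polarSq L + Th • dirNormal L e) b = 0`
  set α : ℝ := ∑ i, T i * lam i with hα
  have hsnd : (α • polarSq L + Th • dirNormal L e) b = 0 := by
    have h := hM (a, b)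
    rw [hv] at h
    have h2 := congrArg Prod.snd h
    simp only [Prod.snd_zero, Prod.snd_add, Prod.snd_sum] at h2
    have hterm : ∀ i, (T i • D i (a, b)).2 = (T i * lam i) • polarSq L b := by
      intro i
      have hsplit : ((a, b) : 𝕄) = (a, 0) + (0, b) := by simp
      have h1 : (D i (a, b)).2 = lam i • polarSq L b := by
        rw [hsplit, map_add, Prod.snd_add, hDreal i a, ← normalPart_apply, hDN i, smul_apply]
        simp
      rw [Prod.smul_snd, h1, smul_smul]
    have hP : (Th • polarDeriv (S.c k).θ (u₀, 0, e) (a, b)).2 = Th • dirNormal L e b := by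
      rw [Prod.smul_snd, polarDeriv_zero_apply_snd _ hθd hθ0]
      rfl
    simp only [hterm, hP] at h2
    rw [← Finset.sum_smul] at h2
    rw [add_apply, smul_apply, smul_apply]
    exact h2.symm
  have hαnn : 0 ≤ α := Finset.sum_nonneg fun i _ => mul_nonneg (hT i) (hlam0 i)
  have hαt : 0 < α + Th := by
    rcases hTh.lt_or_eq with hpos | h0
    · exact add_pos_of_nonneg_of_pos hαnn hpos
    · rw [← h0, add_zero] at hsum
      obtain ⟨i, -, hi⟩ : ∃ i ∈ Finset.univ, T i ≠ 0 := by
        by_contra hall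
        push Not at hall
        rw [Finset.sum_eq_zero hall] at hsum
        exact zero_ne_one hsum
      have hTi : 0 < T i := (hT i).lt_of_ne' hi
      have hli : 0 < lam i := hlampos i hi
      rw [← h0, add_zero]
      exact lt_of_lt_of_le (mul_pos hTi hli)
        (Finset.single_le_sum (fun j _ => mul_nonneg (hT j) (hlam0 j)) (Finset.mem_univ i))
  have hb : b = 0 :=
    (injective_iff_map_eq_zero _).1
      (injective_smul_polarSq_add_smul_dirNormal L hLpos.ne' he hαnn hTh hαt) b hsnd
  subst hb
  -- the real component: `Dγ a = 0`
  have hfst : fderiv ℝ (S.c k).γ u₀ a = 0 := by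
    have h := hM (a, 0)
    rw [hv] at h
    have h2 := congrArg Prod.fst h
    simp only [Prod.fst_zero, Prod.fst_add, Prod.fst_sum, Prod.smul_fst] at h2
    have hP : (polarDeriv (S.c k).θ (u₀, 0, e) (a, 0)).1 = fderiv ℝ (S.c k).γ u₀ a := by
      rw [polarDeriv_zero_apply_inl _ hθ0, ← (S.c k).fderiv_γ_apply hu₀]
    have hterm : ∀ i, (D i (a, 0)).1 = fderiv ℝ (S.c k).γ u₀ a := fun i => by rw [hDreal i a]
    simp only [hterm, hP] at h2
    rw [← Finset.sum_smul, ← add_smul, hsum, one_smul] at h2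
    exact h2.symm
  have hθa : fderiv ℝ (S.c k).θ (u₀, 0) (a, 0) = 0 := by
    rw [(S.c k).fderiv_θ_real_apply hu₀, hfst, map_zero, Prod.mk_zero_zero]
  have := (S.c k).injective_fderiv_θ hu₀' (hθa.trans (map_zero _).symm)
  simpa using this

/-- **`D Rch ∘ D Ech = id` at the base target point.** [folklore] -/
theorem fderiv_Rch_comp_fderiv_Ech (S : Setup ι σ q₁ q₂ N) (k : ι) {z : 𝕄}
    (hz : splitW.symm z ∈ (S.c k).ψ₂.target) (hR : DifferentiableAt ℝ (S.Rch k) (S.Ech k z)) :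
    (fderiv ℝ (S.Rch k) (S.Ech k z)).comp (fderiv ℝ (S.Ech k) z) = ContinuousLinearMap.id ℝ 𝕄 := by
  have hE : DifferentiableAt ℝ (S.Ech k) z := (S.contDiffAt_Ech k hz).differentiableAt (by simp)
  have hcomp : HasFDerivAt (S.Rch k ∘ S.Ech k)
      ((fderiv ℝ (S.Rch k) (S.Ech k z)).comp (fderiv ℝ (S.Ech k) z)) z :=
    hR.hasFDerivAt.comp z hE.hasFDerivAt
  have hid : HasFDerivAt (S.Rch k ∘ S.Ech k) (ContinuousLinearMap.id ℝ 𝕄) z :=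
    (hasFDerivAt_id z).congr_of_eventuallyEq (S.Rch_Ech_eventuallyEq k hz)
  exact hcomp.unique hid

end Setup

end Literature.Topology.FourManifolds

end


/-!
# Sequences of chart points converging to a branch point

Topic `Topology/FourManifolds`; namespace `Literature.Topology.FourManifolds`. Fourteenth file of
the proof of `Literature.Topology.FourManifolds.DegtyarevKharlamov2000_conjQuotient_unique`
(`ConjugationQuotients.lean`). Everything is proved; no named facts.

A `Setup.BranchSeq S k x₀` packages a sequence of parameters `(aₙ, Λₙ)` with `Λₙ → ∞` and a
sequence of points `yₙ → q₁ x₀` of `Y₁` inside `q₁ '' (c k).dom`, for a branch point `q₁ x₀` read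
in the pair `k`. This file collects the elementary limits along such a sequence: the chart points
`wₙ → w₀`, the local solutions and the comparison map at `wₙ` tend to `z₀ = θ w₀`, the average
`avgchₙ (wₙ) → Ech z₀ = emb (q₂ x₀)` (`tendsto_avgch`), and the derivative formula of
`ConjugationQuotientsDerivative` holds at `wₙ` for all large `n` (`eventually_hasFDerivAt_avgch`).

## References

* A. Degtyarev, V. Kharlamov, Russian Math. Surveys 55 (2000), arXiv:math/0004134, §3.2 ¶1.
  [DegtyarevKharlamov2000]
-/

noncomputable section

open scoped Manifold ContDiff Topology
open Set Function Filter Metric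
open Literature.Topology.FourManifolds.BranchedModel

namespace Literature.Topology.FourManifolds

/-- Local notation: `𝕄` is the split model space `(Fin 2 → ℝ) × ℂ`. -/
local notation "𝕄" => (Fin 2 → ℝ) × ℂ

/-- Local notation: the Euclidean space `ℝᴺ`. -/
local notation "𝔼" N:arg => EuclideanSpace ℝ (Fin N)

/-- Local notation: the polar parameter space `(u, s, e)`. -/
local notation "ℙ" => (Fin 2 → ℝ) × ℝ × ℂ

namespace Setup

variable {X : Type*} [TopologicalSpace X] [ChartedSpace (Fin 2 → ℂ) X]
  {Y₁ : Type*} [TopologicalSpace Y₁] [ChartedSpace (EuclideanSpace ℝ (Fin 4)) Y₁]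
  {Y₂ : Type*} [TopologicalSpace Y₂] [ChartedSpace (EuclideanSpace ℝ (Fin 4)) Y₂]
  {ι : Type*} [Fintype ι] {σ : X → X} {q₁ : X → Y₁} {q₂ : X → Y₂} {N : ℕ}

/-! ### Base point facts -/

section Base

variable (S : Setup ι σ q₁ q₂ N) {k : ι} {x₀ : X}

/-- `z₀ = θ w₀` is a good target chart point. [folklore] -/
theorem base_target_mem (hk : x₀ ∈ (S.c k).dom) (hfix : σ x₀ = x₀) :
    splitW.symm ((S.c k).θ ((split ((S.c k).φ₁ x₀)).1, 0)) ∈ (S.c k).ψ₂.target := by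
  rw [← (S.base_facts hk hfix).2.2.1, ContinuousLinearEquiv.symm_apply_apply]
  exact (S.c k).ψ₂.map_source (S.base_facts hk hfix).2.2.2

/-- `Ech` is continuous at `z₀`. [folklore] -/
theorem continuousAt_Ech_base (hk : x₀ ∈ (S.c k).dom) (hfix : σ x₀ = x₀) :
    ContinuousAt (S.Ech k) ((S.c k).θ ((split ((S.c k).φ₁ x₀)).1, 0)) :=
  (S.contDiffAt_Ech k (S.base_target_mem hk hfix)).continuousAt

/-- `Ech z₀ = emb (q₂ x₀)`. [folklore] -/
theorem Ech_base (hk : x₀ ∈ (S.c k).dom) (hfix : σ x₀ = x₀) :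
    S.Ech k ((S.c k).θ ((split ((S.c k).φ₁ x₀)).1, 0)) = S.emb (q₂ x₀) := by
  rw [Ech, ← (S.base_facts hk hfix).2.2.1, ContinuousLinearEquiv.symm_apply_apply,
    (S.c k).ψ₂.left_inv (S.base_facts hk hfix).2.2.2]

/-- `z₀ = (γₖ u₀, 0)`. [folklore] -/
theorem θ_base (hk : x₀ ∈ (S.c k).dom) (hfix : σ x₀ = x₀) :
    (S.c k).θ ((split ((S.c k).φ₁ x₀)).1, 0) = ((S.c k).γ (split ((S.c k).φ₁ x₀)).1, 0) :=
  (S.c k).θ_real ((S.c k).fst_split_φ₁_mem_realSource hk hfix)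

/-- An active local solution read in `k` maps `w₀` to `z₀`. [folklore] -/
theorem Gx_base (hk : x₀ ∈ (S.c k).dom) (hfix : σ x₀ = x₀) {i : ι} (hi : q₁ x₀ ∈ tsupport (S.η i)) :
    S.Gx k i ((split ((S.c k).φ₁ x₀)).1, 0) = (S.c k).θ ((split ((S.c k).φ₁ x₀)).1, 0) := by
  rw [S.θ_base hk hfix]
  exact ((S.c i).crossLoc_real (S.c k) hk (S.mem_dom_of_mem_tsupport hfix hi) hfix).self_of_nhds

/-- The comparison map read in `k` maps `w₀` to `z₀`. [folklore] -/
theorem Gh_base (hk : x₀ ∈ (S.c k).dom) (hfix : σ x₀ = x₀) :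
    S.Gh k ((split ((S.c k).φ₁ x₀)).1, 0) = (S.c k).θ ((split ((S.c k).φ₁ x₀)).1, 0) := by
  have hu : (((split ((S.c k).φ₁ x₀)).1, (0 : ℂ)) : 𝕄) ∈ (S.c k).θ.source :=
    (S.c k).fst_split_φ₁_mem_realSource hk hfix
  have h := (S.c k).Θh_sqModel S.h₁ S.h₂ hu
  have h0 : sqModel (((split ((S.c k).φ₁ x₀)).1, (0 : ℂ)) : 𝕄) = ((split ((S.c k).φ₁ x₀)).1, 0) := by
    simp [sqModel_apply]
  rw [h0] at h
  rw [Gh, h, S.θ_base hk hfix]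
  simp [sqModel_apply]

/-- The comparison map read in `k` is continuous at `w₀`. [folklore] -/
theorem continuousAt_Gh (hk : x₀ ∈ (S.c k).dom) (hfix : σ x₀ = x₀) :
    ContinuousAt (S.Gh k) ((split ((S.c k).φ₁ x₀)).1, 0) := by
  have hy₀ := (S.base_facts hk hfix).2.1
  have h1 : ContinuousAt (S.ych k) (((split ((S.c k).φ₁ x₀)).1, 0) : 𝕄) :=
    S.continuousAt_ych k (S.base_mem_target hk hfix)
  have h2 : ContinuousAt (fun w => S.hcmp (S.ych k w)) (((split ((S.c k).φ₁ x₀)).1, 0) : 𝕄) := by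
    refine ContinuousAt.comp (g := S.hcmp) ?_ h1
    exact (IsBranchedDoubleQuotient.continuous_comparison S.h₁ S.h₂).continuousAt
  have h3 : ContinuousAt (fun w => (S.c k).ψ₂ (S.hcmp (S.ych k w)))
      (((split ((S.c k).φ₁ x₀)).1, 0) : 𝕄) := by
    refine ContinuousAt.comp (g := (S.c k).ψ₂) ?_ h2
    rw [hy₀, show S.hcmp (q₁ x₀) = q₂ x₀ from IsBranchedDoubleQuotient.comparison_apply S.h₁ S.h₂ x₀]
    exact (S.c k).ψ₂.continuousAt (S.base_facts hk hfix).2.2.2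
  exact splitW.continuous.continuousAt.comp h3

end Base

/-! ### Branch sequences -/

/-- **A branch sequence**: parameters `(aₙ, Λₙ)` with `Λₙ > 0`, `Λₙ → ∞`, and points
`yₙ → q₁ x₀` of `Y₁` lying in `q₁ '' (c k).dom`, for a branch point `q₁ x₀` of the pair `k`.
[folklore] -/
structure BranchSeq (S : Setup ι σ q₁ q₂ N) (k : ι) (x₀ : X) where
  /-- the inner parameters -/
  a : ℕ → ℝ
  /-- the logarithmic widths -/
  Λ : ℕ → ℝ
  /-- the points -/
  y : ℕ → Y₁
  hΛ : ∀ n, 0 < Λ n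
  hΛ' : Tendsto Λ atTop atTop
  hy : Tendsto y atTop (𝓝 (q₁ x₀))
  hyd : ∀ n, y n ∈ q₁ '' (S.c k).dom
  hk : x₀ ∈ (S.c k).dom
  hfix : σ x₀ = x₀

namespace BranchSeq

variable {S : Setup ι σ q₁ q₂ N} {k : ι} {x₀ : X} (B : BranchSeq S k x₀)

/-- The chart points `wₙ = splitW (ψ₁ yₙ)`. [folklore] -/
def w (n : ℕ) : 𝕄 :=
  splitW ((S.c k).ψ₁ (B.y n))

/-- Composition with a strictly monotone reindexing. [folklore] -/
def comp (φ : ℕ → ℕ) (hφ : StrictMono φ) : BranchSeq S k x₀ where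
  a := B.a ∘ φ
  Λ := B.Λ ∘ φ
  y := B.y ∘ φ
  hΛ n := B.hΛ (φ n)
  hΛ' := B.hΛ'.comp hφ.tendsto_atTop
  hy := B.hy.comp hφ.tendsto_atTop
  hyd n := B.hyd (φ n)
  hk := B.hk
  hfix := B.hfix

/-- `comp_a` (auxiliary). [folklore] -/
@[simp] theorem comp_a (φ : ℕ → ℕ) (hφ : StrictMono φ) (n : ℕ) : (B.comp φ hφ).a n = B.a (φ n) := rfl
/-- `comp_Λ` (auxiliary). [folklore] -/
@[simp] theorem comp_Λ (φ : ℕ → ℕ) (hφ : StrictMono φ) (n : ℕ) : (B.comp φ hφ).Λ n = B.Λ (φ n) := rfl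
/-- `comp_y` (auxiliary). [folklore] -/
@[simp] theorem comp_y (φ : ℕ → ℕ) (hφ : StrictMono φ) (n : ℕ) : (B.comp φ hφ).y n = B.y (φ n) := rfl
/-- `comp_w` (auxiliary). [folklore] -/
@[simp] theorem comp_w (φ : ℕ → ℕ) (hφ : StrictMono φ) (n : ℕ) : (B.comp φ hφ).w n = B.w (φ n) := rfl

/-- The points lie in the source chart domain. [folklore] -/
theorem y_mem_source (n : ℕ) : B.y n ∈ (S.c k).ψ₁.source := by
  obtain ⟨x, hx, hxy⟩ := B.hyd n
  rw [← hxy]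
  exact ((S.c k).adapted₁ x hx.1).2.2.1

/-- `ych wₙ = yₙ`. [folklore] -/
theorem ych_w (n : ℕ) : S.ych k (B.w n) = B.y n := by
  rw [ych, w, ContinuousLinearEquiv.symm_apply_apply, (S.c k).ψ₁.left_inv (B.y_mem_source n)]

/-- `wₙ ∈ Ωₖ`. [folklore] -/
theorem w_mem_Ω (n : ℕ) : B.w n ∈ S.Ω k := by
  show splitW.symm (B.w n) ∈ (S.c k).ψ₁.target
  rw [w, ContinuousLinearEquiv.symm_apply_apply]
  exact (S.c k).ψ₁.map_source (B.y_mem_source n)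

/-- `wₙ = sqModel (split (φ₁ xₙ))` for the point `xₙ ∈ dom` over `yₙ`. [folklore] -/
theorem exists_w_eq (n : ℕ) : ∃ x ∈ (S.c k).dom, q₁ x = B.y n ∧ B.w n = sqModel (split ((S.c k).φ₁ x)) := by
  obtain ⟨x, hx, hxy⟩ := B.hyd n
  exact ⟨x, hx, hxy, by rw [w, ← hxy, (S.c k).sqModel_split_φ₁ hx.1]⟩

/-- **`(wₙ).2 = 0` iff `yₙ` is a branch point.** [folklore] -/
theorem snd_w_eq_zero_iff (n : ℕ) : (B.w n).2 = 0 ↔ B.y n ∈ q₁ '' fixedPoints σ := by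
  obtain ⟨x, hx, hxy, hw⟩ := B.exists_w_eq n
  rw [hw, ← hxy, S.h₁.apply_mem_image_fixedPoints_iff, sqModel_apply]
  simp only [pow_eq_zero_iff two_ne_zero]
  have h := (S.c k).snd_eq_zero_iff ((S.c k).split_mem_θ_source hx)
  rwa [ContinuousLinearEquiv.symm_apply_apply, (S.c k).φ₁.left_inv hx.1] at h

/-- The averaged quantities at `yₙ` are the chart ones at `wₙ`. [folklore] -/
theorem avg_eq (n : ℕ) : S.avg (B.a n) (B.Λ n) (B.y n) = S.avgch k (B.a n) (B.Λ n) (B.w n) := by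
  rw [avgch, B.ych_w]

/-- The averaged map at `yₙ` is `retr` of the chart average at `wₙ`. [folklore] -/
theorem Φ_eq (n : ℕ) : S.Φ (B.a n) (B.Λ n) (B.y n) = S.retr (S.avgch k (B.a n) (B.Λ n) (B.w n)) := by
  rw [← B.avg_eq]; rfl

/-- **`wₙ → w₀`.** [folklore] -/
theorem tendsto_w : Tendsto B.w atTop (𝓝 ((split ((S.c k).φ₁ x₀)).1, 0)) := by
  have h1 : ContinuousAt (fun y => splitW ((S.c k).ψ₁ y)) (q₁ x₀) :=
    splitW.continuous.continuousAt.comp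
      ((S.c k).ψ₁.continuousAt ((S.c k).adapted₁ x₀ B.hk.1).2.2.1)
  have h2 := h1.tendsto.comp B.hy
  rw [(S.base_facts B.hk B.hfix).1] at h2
  exact h2

/-- `(wₙ).2 → 0`. [folklore] -/
theorem tendsto_snd_w : Tendsto (fun n => (B.w n).2) atTop (𝓝 0) := by
  have h := (continuous_snd.tendsto _).comp B.tendsto_w
  simpa [Function.comp_def] using h

/-- `‖(wₙ).2‖ → 0`. [folklore] -/
theorem tendsto_norm_snd_w : Tendsto (fun n => ‖(B.w n).2‖) atTop (𝓝 0) := by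
  simpa using B.tendsto_snd_w.norm

/-- `(wₙ).1 → u₀`. [folklore] -/
theorem tendsto_fst_w : Tendsto (fun n => (B.w n).1) atTop (𝓝 (split ((S.c k).φ₁ x₀)).1) := by
  have h := (continuous_fst.tendsto _).comp B.tendsto_w
  simpa [Function.comp_def] using h

/-- Eventual properties at `w₀` hold at `wₙ` for large `n`. [folklore] -/
theorem eventually_of_nhds {p : 𝕄 → Prop}
    (h : ∀ᶠ w in 𝓝 (((split ((S.c k).φ₁ x₀)).1, 0) : 𝕄), p w) : ∀ᶠ n in atTop, p (B.w n) :=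
  B.tendsto_w.eventually h

section Limits

variable [IsManifold (𝓡 4) ∞ Y₁] [IsManifold (𝓡 4) ∞ Y₂]

/-- **Active local solutions along the sequence tend to `z₀`.** [folklore] -/
theorem tendsto_Gx {i : ι} (hi : q₁ x₀ ∈ tsupport (S.η i)) :
    Tendsto (fun n => S.Gx k i (B.w n)) atTop (𝓝 ((S.c k).θ ((split ((S.c k).φ₁ x₀)).1, 0))) := by
  rw [← S.Gx_base B.hk B.hfix hi]
  exact ((S.contDiffAt_Gx B.hk B.hfix hi).continuousAt.tendsto).comp B.tendsto_w

omit [IsManifold (𝓡 4) ∞ Y₁] [IsManifold (𝓡 4) ∞ Y₂] in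
/-- **The comparison map along the sequence tends to `z₀`.** [folklore] -/
theorem tendsto_Gh :
    Tendsto (fun n => S.Gh k (B.w n)) atTop (𝓝 ((S.c k).θ ((split ((S.c k).φ₁ x₀)).1, 0))) := by
  rw [← S.Gh_base B.hk B.hfix]
  exact (S.continuousAt_Gh B.hk B.hfix).tendsto.comp B.tendsto_w

/-- **The average along the sequence tends to `emb (q₂ x₀)`.** Each term
`tₒ • (Ech (Gₒ wₙ) - Ech z₀)` tends to zero: the weights are in `[0, 1]`, active maps tend to
`z₀`, inactive weights vanish eventually. [folklore] -/
theorem tendsto_avgch :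
    Tendsto (fun n => S.avgch k (B.a n) (B.Λ n) (B.w n)) atTop (𝓝 (S.emb (q₂ x₀))) := by
  set z₀ := (S.c k).θ ((split ((S.c k).φ₁ x₀)).1, 0) with hz₀
  have hE : Tendsto (fun z => S.Ech k z) (𝓝 z₀) (𝓝 (S.Ech k z₀)) :=
    (S.continuousAt_Ech_base B.hk B.hfix).tendsto
  rw [← S.Ech_base B.hk B.hfix]
  -- the representation at `wₙ`
  have hrep : ∀ᶠ n in atTop, S.avgch k (B.a n) (B.Λ n) (B.w n) =
      ∑ i, S.tch k (B.a n) (B.Λ n) i (B.w n) • S.Ech k (S.Gx k i (B.w n)) +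
        S.tinfch k (B.a n) (B.Λ n) (B.w n) • S.Ech k (S.Gh k (B.w n)) := by
    filter_upwards [B.eventually_of_nhds (S.avgch_eventuallyEq B.hk B.hfix)] with n hn
    exact hn (B.a n) (B.Λ n)
  -- recentred form: `avgch - Ech z₀ = ∑ tᵢ • (Eᵢ - E₀) + t∞ • (E_h - E₀)`
  have hrep' : ∀ᶠ n in atTop, S.avgch k (B.a n) (B.Λ n) (B.w n) - S.Ech k z₀ =
      ∑ i, S.tch k (B.a n) (B.Λ n) i (B.w n) • (S.Ech k (S.Gx k i (B.w n)) - S.Ech k z₀) +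
        S.tinfch k (B.a n) (B.Λ n) (B.w n) • (S.Ech k (S.Gh k (B.w n)) - S.Ech k z₀) := by
    filter_upwards [hrep] with n hn
    have hs := S.sum_tch k (B.a n) (B.Λ n) (B.w n)
    rw [hn]
    have key : ∀ (t : ι → ℝ) (ti : ℝ) (E : ι → 𝔼 N) (Eh E₀ : 𝔼 N), ∑ i, t i + ti = 1 →
        ∑ i, t i • E i + ti • Eh - E₀ = ∑ i, t i • (E i - E₀) + ti • (Eh - E₀) := by
      intro t ti E Eh E₀ h
      have hE₀ : E₀ = (∑ i, t i + ti) • E₀ := by rw [h, one_smul]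
      conv_lhs => rw [hE₀]
      simp only [smul_sub, Finset.sum_sub_distrib, Finset.sum_smul, add_smul]
      abel
    exact key _ _ (fun i => S.Ech k (S.Gx k i (B.w n))) _ _ hs
  -- each term tends to zero
  have hterm : ∀ i, Tendsto (fun n => S.tch k (B.a n) (B.Λ n) i (B.w n) •
      (S.Ech k (S.Gx k i (B.w n)) - S.Ech k z₀)) atTop (𝓝 0) := by
    intro i
    by_cases hi : q₁ x₀ ∈ tsupport (S.η i)
    · have hv : Tendsto (fun n => S.Ech k (S.Gx k i (B.w n)) - S.Ech k z₀) atTop (𝓝 0) := by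
        have := (hE.comp (B.tendsto_Gx hi)).sub_const (S.Ech k z₀)
        simpa using this
      refine squeeze_zero_norm (fun n => ?_) (tendsto_zero_iff_norm_tendsto_zero.1 hv)
      rw [norm_smul, Real.norm_eq_abs,
        abs_of_nonneg (show 0 ≤ S.tch k (B.a n) (B.Λ n) i (B.w n) from S.t_nonneg _ _ _ _)]
      refine mul_le_of_le_one_left (norm_nonneg _) ?_
      exact (mul_le_one₀ (S.χ_le_one _ _ _) (S.η_nonneg _ _) (S.η_le_one _ _))
    · refine tendsto_const_nhds.congr' ?_
      filter_upwards [B.eventually_of_nhds (S.eventually_tch_eventuallyEq_zero B.hk B.hfix hi)] with n hn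
      have h0 : S.tch k (B.a n) (B.Λ n) i (B.w n) = 0 := by
        simpa using (hn (B.a n) (B.Λ n)).self_of_nhds
      rw [h0, zero_smul]
  have hterm' : Tendsto (fun n => S.tinfch k (B.a n) (B.Λ n) (B.w n) •
      (S.Ech k (S.Gh k (B.w n)) - S.Ech k z₀)) atTop (𝓝 0) := by
    have hv : Tendsto (fun n => S.Ech k (S.Gh k (B.w n)) - S.Ech k z₀) atTop (𝓝 0) := by
      have := (hE.comp B.tendsto_Gh).sub_const (S.Ech k z₀)
      simpa using this
    refine squeeze_zero_norm (fun n => ?_) (tendsto_zero_iff_norm_tendsto_zero.1 hv)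
    rw [norm_smul, Real.norm_eq_abs,
      abs_of_nonneg (show 0 ≤ S.tinfch k (B.a n) (B.Λ n) (B.w n) from S.tinf_nonneg _ _ _)]
    refine mul_le_of_le_one_left (norm_nonneg _) ?_
    have hs := S.sum_tch k (B.a n) (B.Λ n) (B.w n)
    have hnn : 0 ≤ ∑ i, S.tch k (B.a n) (B.Λ n) i (B.w n) :=
      Finset.sum_nonneg fun i _ => S.t_nonneg _ _ _ _
    show S.tinfch k (B.a n) (B.Λ n) (B.w n) ≤ 1
    linarith
  have hsum : Tendsto (fun n => ∑ i, S.tch k (B.a n) (B.Λ n) i (B.w n) •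
      (S.Ech k (S.Gx k i (B.w n)) - S.Ech k z₀) +
        S.tinfch k (B.a n) (B.Λ n) (B.w n) • (S.Ech k (S.Gh k (B.w n)) - S.Ech k z₀)) atTop (𝓝 0) := by
    have := (tendsto_finsetSum (Finset.univ : Finset ι) fun i _ => hterm i).add hterm'
    simpa using this
  have hdiff : Tendsto (fun n => S.avgch k (B.a n) (B.Λ n) (B.w n) - S.Ech k z₀) atTop (𝓝 0) :=
    hsum.congr' (hrep'.mono fun n hn => hn.symm)
  have h := hdiff.add_const (S.Ech k z₀)
  simp only [sub_add_cancel, zero_add] at h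
  exact h

/-- **`Φ (yₙ) → q₂ x₀`** and the average enters the good region: eventually
`avg ∈ tube`, `retr avg ∈ ψ₂.source`, and `Rch` is `C¹` at the average. [folklore] -/
theorem eventually_avg_good :
    ∀ᶠ n in atTop, S.avg (B.a n) (B.Λ n) (B.y n) ∈ S.tube ∧
      S.Φ (B.a n) (B.Λ n) (B.y n) ∈ (S.c k).ψ₂.source ∧
      ContDiffAt ℝ 1 (S.Rch k) (S.avgch k (B.a n) (B.Λ n) (B.w n)) := by
  have hopen : IsOpen (S.tube ∩ S.retr ⁻¹' (S.c k).ψ₂.source) :=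
    S.retr_smooth.continuousOn.isOpen_inter_preimage S.tube_open (S.c k).ψ₂.open_source
  have hmem : S.emb (q₂ x₀) ∈ S.tube ∩ S.retr ⁻¹' (S.c k).ψ₂.source :=
    ⟨S.emb_mem _, by rw [mem_preimage, S.retr_emb]; exact ((S.c k).adapted₂ x₀ B.hk.2).2.2.1⟩
  filter_upwards [B.tendsto_avgch.eventually (hopen.mem_nhds hmem),
    B.tendsto_avgch.eventually (S.eventually_contDiffAt_Rch B.hk)] with n hn hR
  rw [B.avg_eq, B.Φ_eq]
  exact ⟨hn.1, hn.2, hR⟩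

/-- **The derivative formula holds at `wₙ` for large `n`**, given polar data for the comparison
term off the branch locus. The polar parameter sequence `p` must satisfy, for every `n` with `yₙ`
off the branch locus, `wₙ = sqModel ((p n).1, (p n).2.1 • (p n).2.2)` with `(p n).2.1 ≠ 0`,
`(p n).2.2 ≠ 0` and `((p n).1, (p n).2.1 • (p n).2.2) ∈ θ.source`. [folklore] -/
theorem eventually_hasFDerivAt_avgch (p : ℕ → ℙ)
    (hp : ∀ᶠ n in atTop, B.y n ∉ q₁ '' fixedPoints σ →
      B.w n = sqModel ((p n).1, (p n).2.1 • (p n).2.2) ∧ (p n).2.1 ≠ 0 ∧ (p n).2.2 ≠ 0 ∧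
        (((p n).1, (p n).2.1 • (p n).2.2) : 𝕄) ∈ (S.c k).θ.source) :
    ∀ᶠ n in atTop, HasFDerivAt (S.avgch k (B.a n) (B.Λ n))
      (S.Alin k (B.a n) (B.Λ n) (B.w n) (p n) + S.Blin k (B.a n) (B.Λ n) (B.w n)) (B.w n) := by
  classical
  set z₀ := (S.c k).θ ((split ((S.c k).φ₁ x₀)).1, 0) with hz₀
  -- eventual facts along the sequence
  have hgoodE : ∀ᶠ z in 𝓝 z₀, ContDiffAt ℝ 1 (S.Ech k) z := S.eventually_contDiffAt_Ech B.hk B.hfix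
  have hJ : ∀ i, q₁ x₀ ∈ tsupport (S.η i) → ∀ᶠ n in atTop,
      ContDiffAt ℝ 1 (S.Gx k i) (B.w n) ∧ ContDiffAt ℝ 1 (S.Ech k) (S.Gx k i (B.w n)) := fun i hi =>
    (B.eventually_of_nhds (S.eventually_contDiffAt_Gx B.hk B.hfix hi)).and
      ((B.tendsto_Gx hi).eventually hgoodE)
  have hJ' : ∀ i, q₁ x₀ ∉ tsupport (S.η i) → ∀ᶠ n in atTop,
      ∀ a Λ : ℝ, S.tch k a Λ i =ᶠ[𝓝 (B.w n)] 0 := fun i hi =>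
    B.eventually_of_nhds (S.eventually_tch_eventuallyEq_zero B.hk B.hfix hi)
  have hall : ∀ᶠ n in atTop, ∀ i,
      (q₁ x₀ ∈ tsupport (S.η i) →
        ContDiffAt ℝ 1 (S.Gx k i) (B.w n) ∧ ContDiffAt ℝ 1 (S.Ech k) (S.Gx k i (B.w n))) ∧
      (q₁ x₀ ∉ tsupport (S.η i) → ∀ a Λ : ℝ, S.tch k a Λ i =ᶠ[𝓝 (B.w n)] 0) := by
    refine eventually_all.2 fun i => ?_
    by_cases hi : q₁ x₀ ∈ tsupport (S.η i)
    · exact (hJ i hi).mono fun n hn => ⟨fun _ => hn, fun h => absurd hi h⟩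
    · exact (hJ' i hi).mono fun n hn => ⟨fun h => absurd h hi, fun _ => hn⟩
  have hEh : ∀ᶠ n in atTop, ContDiffAt ℝ 1 (S.Ech k) (S.Gh k (B.w n)) := B.tendsto_Gh.eventually hgoodE
  filter_upwards [B.eventually_of_nhds (S.avgch_eventuallyEq_nhds B.hk B.hfix), hall, hEh, hp]
    with n hrep hn hEhn hpn
  refine S.hasFDerivAt_avgch (fun i => q₁ x₀ ∈ tsupport (S.η i)) (hrep (B.a n) (B.Λ n))
    (fun i _ => (S.contDiffAt_tch k (B.a n) (B.hΛ n) i (B.w_mem_Ω n)).differentiableAt (by simp))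
    (fun i hi => ⟨((hn i).1 hi).1.differentiableAt one_ne_zero,
      ((hn i).1 hi).2.differentiableAt one_ne_zero⟩)
    (fun i hi => (hn i).2 hi (B.a n) (B.Λ n)) ?_
  by_cases hB : B.y n ∈ q₁ '' fixedPoints σ
  · right
    exact S.tinfch_eventuallyEq_zero (B.a n) (B.Λ n) (B.w_mem_Ω n) (by rw [B.ych_w]; exact hB)
  · left
    obtain ⟨hw, hs, he, hsrc⟩ := hpn hB
    refine ⟨(S.contDiffAt_tinfch k (B.a n) (B.hΛ n) (B.w_mem_Ω n)).differentiableAt (by simp),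
      ?_, hEhn.differentiableAt one_ne_zero⟩
    rw [hw]
    exact S.hasFDerivAt_Gh k hsrc hs he

end Limits

end BranchSeq

end Setup

end Literature.Topology.FourManifolds

end


/-!
# The main estimate: the averaged map is a local diffeomorphism near the branch locus

Topic `Topology/FourManifolds`; namespace `Literature.Topology.FourManifolds`. Fifteenth file of
the proof of `Literature.Topology.FourManifolds.DegtyarevKharlamov2000_conjQuotient_unique`
(`ConjugationQuotients.lean`). Everything is proved; no named facts.

Along a branch sequence (`Setup.BranchSeq`) read in an ACTIVE pair `k` (`q₁ x₀ ∈ tsupport ηₖ`),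
after extraction of subsequences making the weights and the normal direction converge, the
derivative `Dₙ = D Rch ∘ (Alinₙ + Blinₙ)` of the averaged map at `wₙ` converges to the limit
operator `Mstar` of `ConjugationQuotientsLimitOperator`:

* `Alinₙ → Â` (`tendsto_Alin`: continuity of `D Ech`, of `D Gᵢ`, and of the polar derivative
  field down to `s = 0`, `continuousAt_polarDeriv`);
* `Blinₙ → 0` (`tendsto_Blin`): after recentring with `∑ D tₒ = 0`, every term is bounded by
  `‖D tₒ (wₙ)‖ · K ‖(wₙ).2‖ → 0` — the local solutions and the comparison map differ by
  `O(‖w₂‖)` (`ConjugationQuotientsLocalBounds`) while the logarithmic cutoff has gradient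
  `O(1/(Λ ‖w₂‖))` (`ConjugationQuotientsWeightBounds`);
* `D Rch ∘ Â = Mstar` (`D Rch ∘ D Ech = id`), which is invertible (`injective_Mstar`).

Since the units are open, `Dₙ` is invertible for large `n` (`eventually_good`); an extraction
argument (`exists_good`) removes the convergence assumptions: **along every branch sequence some
(in fact almost every) point is good** — the average lies in the tube and the averaged map read in
the charts has an invertible derivative.

## References

* A. Degtyarev, V. Kharlamov, Russian Math. Surveys 55 (2000), arXiv:math/0004134, §3.2 ¶1.
  [DegtyarevKharlamov2000]
-/

noncomputable section

open scoped Manifold ContDiff Topology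
open Set Function Filter Metric
open Literature.Topology.FourManifolds.BranchedModel

namespace Literature.Topology.FourManifolds

/-- Local notation: `𝕄` is the split model space `(Fin 2 → ℝ) × ℂ`. -/
local notation "𝕄" => (Fin 2 → ℝ) × ℂ

/-- Local notation: the Euclidean space `ℝᴺ`. -/
local notation "𝔼" N:arg => EuclideanSpace ℝ (Fin N)

/-- Local notation: the polar parameter space `(u, s, e)`. -/
local notation "ℙ" => (Fin 2 → ℝ) × ℝ × ℂ

/-- **Recentring a sum of rank-one operators whose functionals sum to zero.** [folklore] -/
theorem BranchedModel.sum_smulRight_add_recenter {ι E F : Type*} [Fintype ι]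
    [NormedAddCommGroup E] [NormedSpace ℝ E] [NormedAddCommGroup F] [NormedSpace ℝ F]
    (τ' : ι → E →L[ℝ] ℝ) (τh : E →L[ℝ] ℝ) (v : ι → F) (vh z : F)
    (h0 : ∑ i, τ' i + τh = 0) :
    ∑ i, (τ' i).smulRight (v i) + τh.smulRight vh =
      ∑ i, (τ' i).smulRight (v i - z) + τh.smulRight (vh - z) := by
  refine ContinuousLinearMap.ext fun x => ?_
  have hx : ∑ i, τ' i x + τh x = 0 := by
    have := congrArg (fun A : E →L[ℝ] ℝ => A x) h0
    simpa only [add_apply, sum_apply, zero_apply] using this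
  simp only [add_apply, sum_apply, ContinuousLinearMap.smulRight_apply, smul_sub,
    Finset.sum_sub_distrib, ← Finset.sum_smul]
  rw [show (∑ i, τ' i x) • z = -(τh x • z) by
    rw [← neg_smul, show -τh x = ∑ i, τ' i x by linarith]]
  abel

/-- **Composition of operators is jointly continuous** (sequential form). [folklore] -/
theorem BranchedModel.tendsto_clm_comp {α E F G : Type*} {l : Filter α}
    [NormedAddCommGroup E] [NormedSpace ℝ E] [NormedAddCommGroup F] [NormedSpace ℝ F]
    [NormedAddCommGroup G] [NormedSpace ℝ G] {g : α → F →L[ℝ] G} {f : α → E →L[ℝ] F}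
    {g₀ : F →L[ℝ] G} {f₀ : E →L[ℝ] F} (hg : Tendsto g l (𝓝 g₀)) (hf : Tendsto f l (𝓝 f₀)) :
    Tendsto (fun x => (g x).comp (f x)) l (𝓝 (g₀.comp f₀)) :=
  ((isBoundedBilinearMap_comp (𝕜 := ℝ) (E := E) (F := F) (G := G)).continuous.tendsto (g₀, f₀)).comp
    (hg.prodMk_nhds hf)

namespace Setup

variable {X : Type*} [TopologicalSpace X] [ChartedSpace (Fin 2 → ℂ) X]
  {Y₁ : Type*} [TopologicalSpace Y₁] [ChartedSpace (EuclideanSpace ℝ (Fin 4)) Y₁]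
  {Y₂ : Type*} [TopologicalSpace Y₂] [ChartedSpace (EuclideanSpace ℝ (Fin 4)) Y₂]
  {ι : Type*} [Fintype ι] {σ : X → X} {q₁ : X → Y₁} {q₂ : X → Y₂} {N : ℕ}

/-! ### Bounds near the base point -/

section Bounds

variable [IsManifold (𝓡 4) ∞ Y₁] [IsManifold (𝓡 4) ∞ Y₂] (S : Setup ι σ q₁ q₂ N) {k : ι} {x₀ : X}

/-- **Two active local solutions read in `k` differ by `O(‖w₂‖)` near `w₀`** (both are `C¹` and
agree with `(γₖ u, 0)` on the real locus). [folklore] -/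
theorem exists_bound_Gx_sub (hk : x₀ ∈ (S.c k).dom) (hfix : σ x₀ = x₀) {i : ι}
    (hi : q₁ x₀ ∈ tsupport (S.η i)) (hkJ : q₁ x₀ ∈ tsupport (S.η k)) :
    ∃ C : ℝ, ∀ᶠ w in 𝓝 (((split ((S.c k).φ₁ x₀)).1, 0) : 𝕄),
      ‖S.Gx k i w - S.Gx k k w‖ ≤ C * ‖w.2‖ := by
  have hci := (S.contDiffAt_Gx hk hfix hi).of_le (show (1 : WithTop ℕ∞) ≤ ∞ by exact_mod_cast le_top)
  have hck := (S.contDiffAt_Gx hk hfix hkJ).of_le (show (1 : WithTop ℕ∞) ≤ ∞ by exact_mod_cast le_top)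
  obtain ⟨r₁, hr₁, C₁, -, -, -, h₁⟩ := exists_ball_norm_sub_real_le hci
  obtain ⟨r₂, hr₂, C₂, -, -, -, h₂⟩ := exists_ball_norm_sub_real_le hck
  have hreal_i := (S.c i).crossLoc_real (S.c k) hk (S.mem_dom_of_mem_tsupport hfix hi) hfix
  have hreal_k := (S.c k).crossLoc_real (S.c k) hk (S.mem_dom_of_mem_tsupport hfix hkJ) hfix
  have hfst : Tendsto (fun w : 𝕄 => w.1) (𝓝 (((split ((S.c k).φ₁ x₀)).1, 0) : 𝕄))
      (𝓝 (split ((S.c k).φ₁ x₀)).1) :=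
    continuous_fst.tendsto (((split ((S.c k).φ₁ x₀)).1, (0 : ℂ)) : 𝕄)
  refine ⟨C₁ + C₂, ?_⟩
  filter_upwards [ball_mem_nhds _ hr₁, ball_mem_nhds _ hr₂, hfst.eventually hreal_i,
    hfst.eventually hreal_k] with w hw₁ hw₂ hri hrk
  have e1 := h₁ w hw₁
  have e2 := h₂ w hw₂
  have hik : S.Gx k i (w.1, 0) = S.Gx k k (w.1, 0) := by
    show (S.c i).crossLoc (S.c k) (w.1, 0) = (S.c k).crossLoc (S.c k) (w.1, 0)
    rw [hri, hrk]
  calc ‖S.Gx k i w - S.Gx k k w‖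
      = ‖(S.Gx k i w - S.Gx k i (w.1, 0)) - (S.Gx k k w - S.Gx k k (w.1, 0))‖ := by
        rw [hik]; congr 1; abel
    _ ≤ ‖S.Gx k i w - S.Gx k i (w.1, 0)‖ + ‖S.Gx k k w - S.Gx k k (w.1, 0)‖ := norm_sub_le _ _
    _ ≤ C₁ * ‖w.2‖ + C₂ * ‖w.2‖ := add_le_add e1 e2
    _ = (C₁ + C₂) * ‖w.2‖ := by ring

/-- **The comparison map and the local solution of `k` differ by `O(‖z‖²)` at `sqModel (u, z)`**
near `w₀` (`‖z‖² = ‖w₂‖`). [folklore] -/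
theorem exists_bound_Gh_sub (hk : x₀ ∈ (S.c k).dom) (hfix : σ x₀ = x₀)
    (hkJ : q₁ x₀ ∈ tsupport (S.η k)) :
    ∃ C : ℝ, ∀ᶠ x in 𝓝 (((split ((S.c k).φ₁ x₀)).1, 0) : 𝕄),
      ‖S.Gh k (sqModel x) - S.Gx k k (sqModel x)‖ ≤ C * ‖x.2‖ ^ 2 := by
  have hu₀ : (((split ((S.c k).φ₁ x₀)).1, (0 : ℂ)) : 𝕄) ∈ (S.c k).θ.source :=
    (S.c k).fst_split_φ₁_mem_realSource hk hfix
  -- the comparison map: second order bound for `sqModel ∘ θ`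
  obtain ⟨r₁, hr₁, C₁, -, h₁⟩ := exists_ball_norm_sqModel_sub_le (S.c k).isOpen_θ_source
    (S.c k).contDiffOn_θ (fun x hx => (S.c k).θ_flipIm hx) hu₀
  -- the local solution of `k` at `sqModel x`
  have hck := (S.contDiffAt_Gx hk hfix hkJ).of_le (show (1 : WithTop ℕ∞) ≤ ∞ by exact_mod_cast le_top)
  obtain ⟨r₂, hr₂, C₂, -, -, -, h₂⟩ := exists_ball_norm_sub_real_le hck
  have hreal_k := (S.c k).crossLoc_real (S.c k) hk (S.mem_dom_of_mem_tsupport hfix hkJ) hfix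
  have hfst : Tendsto (fun w : 𝕄 => w.1) (𝓝 (((split ((S.c k).φ₁ x₀)).1, 0) : 𝕄))
      (𝓝 (split ((S.c k).φ₁ x₀)).1) :=
    continuous_fst.tendsto (((split ((S.c k).φ₁ x₀)).1, (0 : ℂ)) : 𝕄)
  have hsq : Tendsto sqModel (𝓝 (((split ((S.c k).φ₁ x₀)).1, 0) : 𝕄))
      (𝓝 (((split ((S.c k).φ₁ x₀)).1, 0) : 𝕄)) := by
    have := contDiff_sqModel.continuous.tendsto (((split ((S.c k).φ₁ x₀)).1, (0 : ℂ)) : 𝕄)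
    simpa [sqModel_apply] using this
  have hrs : Tendsto (fun x : 𝕄 => x.1) (𝓝 (((split ((S.c k).φ₁ x₀)).1, 0) : 𝕄))
      (𝓝 (split ((S.c k).φ₁ x₀)).1) := hfst
  refine ⟨C₁ + C₂, ?_⟩
  filter_upwards [ball_mem_nhds _ hr₁, hsq.eventually (ball_mem_nhds _ hr₂),
    (S.c k).isOpen_θ_source.mem_nhds hu₀, hfst.eventually hreal_k,
    hfst.eventually ((S.c k).isOpen_realSource.mem_nhds hu₀)] with x hx₁ hx₂ hxs hrk hxr
  -- `Gh (sqModel x) = sqModel (θ x)` and the real values agree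
  have hGh : S.Gh k (sqModel x) = sqModel ((S.c k).θ x) := (S.c k).Θh_sqModel S.h₁ S.h₂ hxs
  have hreal : sqModel ((S.c k).θ (x.1, 0)) = ((S.c k).γ x.1, 0) := by
    rw [(S.c k).θ_real hxr]; simp [sqModel_apply]
  have hGk : S.Gx k k ((sqModel x).1, 0) = ((S.c k).γ x.1, 0) := by
    show (S.c k).crossLoc (S.c k) ((sqModel x).1, 0) = _
    rw [show (sqModel x).1 = x.1 from rfl, hrk]
  have e1 := h₁ x hx₁
  have e2 := h₂ (sqModel x) hx₂
  rw [hGk] at e2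
  rw [hreal] at e1
  have hn2 : ‖(sqModel x).2‖ = ‖x.2‖ ^ 2 := by rw [show (sqModel x).2 = x.2 ^ 2 from rfl, norm_pow]
  rw [hn2] at e2
  calc ‖S.Gh k (sqModel x) - S.Gx k k (sqModel x)‖
      = ‖(sqModel ((S.c k).θ x) - ((S.c k).γ x.1, 0)) - (S.Gx k k (sqModel x) - ((S.c k).γ x.1, 0))‖ := by
        rw [hGh]; congr 1; abel
    _ ≤ ‖sqModel ((S.c k).θ x) - ((S.c k).γ x.1, 0)‖ + ‖S.Gx k k (sqModel x) - ((S.c k).γ x.1, 0)‖ :=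
        norm_sub_le _ _
    _ ≤ C₁ * ‖x.2‖ ^ 2 + C₂ * ‖x.2‖ ^ 2 := add_le_add e1 e2
    _ = (C₁ + C₂) * ‖x.2‖ ^ 2 := by ring

end Bounds

namespace BranchSeq

variable [IsManifold (𝓡 4) ∞ Y₁] [IsManifold (𝓡 4) ∞ Y₂]
  {S : Setup ι σ q₁ q₂ N} {k : ι} {x₀ : X} (B : BranchSeq S k x₀)

/-! ### Convergence of the main part -/

/-- **`Alinₙ → Â`.** The hypothesis `hcase` distinguishes sequences on the branch locus (the
weight of the comparison map vanishes identically) from sequences off it (the polar parameters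
converge to `(u₀, 0, e*)` with `e* ≠ 0`). [folklore] -/
theorem tendsto_Alin {T : ι → ℝ} {Th : ℝ} {estar : ℂ}
    (hT : ∀ i, Tendsto (fun n => S.tch k (B.a n) (B.Λ n) i (B.w n)) atTop (𝓝 (T i)))
    (hTh : Tendsto (fun n => S.tinfch k (B.a n) (B.Λ n) (B.w n)) atTop (𝓝 Th)) (p : ℕ → ℙ)
    (hcase : (∀ n, S.tinfch k (B.a n) (B.Λ n) (B.w n) = 0) ∨
      (Tendsto p atTop (𝓝 ((split ((S.c k).φ₁ x₀)).1, 0, estar)) ∧ estar ≠ 0)) :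
    Tendsto (fun n => S.Alin k (B.a n) (B.Λ n) (B.w n) (p n)) atTop
      (𝓝 (∑ i, T i • ((fderiv ℝ (S.Ech k) ((S.c k).θ ((split ((S.c k).φ₁ x₀)).1, 0))).comp
          (fderiv ℝ (S.Gx k i) ((split ((S.c k).φ₁ x₀)).1, 0))) +
        Th • ((fderiv ℝ (S.Ech k) ((S.c k).θ ((split ((S.c k).φ₁ x₀)).1, 0))).comp
          (polarDeriv (S.c k).θ ((split ((S.c k).φ₁ x₀)).1, 0, estar))))) := by
  set w₀ : 𝕄 := ((split ((S.c k).φ₁ x₀)).1, 0) with hw₀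
  set z₀ := (S.c k).θ w₀ with hz₀
  have hDE : ContinuousAt (fderiv ℝ (S.Ech k)) z₀ :=
    (S.contDiffAt_Ech k (S.base_target_mem B.hk B.hfix)).continuousAt_fderiv (by simp)
  -- the terms of the pairs
  have hterm : ∀ i, Tendsto (fun n => S.tch k (B.a n) (B.Λ n) i (B.w n) • S.Qx k i (B.w n)) atTop
      (𝓝 (T i • ((fderiv ℝ (S.Ech k) z₀).comp (fderiv ℝ (S.Gx k i) w₀)))) := by
    intro i
    by_cases hi : q₁ x₀ ∈ tsupport (S.η i)
    · have h1 : Tendsto (fun n => fderiv ℝ (S.Ech k) (S.Gx k i (B.w n))) atTop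
          (𝓝 (fderiv ℝ (S.Ech k) z₀)) := hDE.tendsto.comp (B.tendsto_Gx hi)
      have h2 : Tendsto (fun n => fderiv ℝ (S.Gx k i) (B.w n)) atTop
          (𝓝 (fderiv ℝ (S.Gx k i) w₀)) :=
        ((S.contDiffAt_Gx B.hk B.hfix hi).continuousAt_fderiv (by simp)).tendsto.comp B.tendsto_w
      exact (hT i).smul (BranchedModel.tendsto_clm_comp h1 h2)
    · -- inactive: the weight is eventually zero, so is its limit
      have hev : ∀ᶠ n in atTop, S.tch k (B.a n) (B.Λ n) i (B.w n) = 0 := by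
        filter_upwards [B.eventually_of_nhds (S.eventually_tch_eventuallyEq_zero B.hk B.hfix hi)]
          with n hn
        simpa using (hn (B.a n) (B.Λ n)).self_of_nhds
      have hT0 : T i = 0 :=
        tendsto_nhds_unique (hT i) (tendsto_const_nhds.congr' (hev.mono fun n hn => hn.symm))
      rw [hT0, show (0 : ℝ) • ((fderiv ℝ (S.Ech k) z₀).comp (fderiv ℝ (S.Gx k i) w₀)) = 0 from
        zero_smul ℝ ((fderiv ℝ (S.Ech k) z₀).comp (fderiv ℝ (S.Gx k i) w₀))]
      refine tendsto_const_nhds.congr' ?_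
      filter_upwards [hev] with n hn
      rw [hn]
      exact (zero_smul ℝ (S.Qx k i (B.w n))).symm
  -- the comparison term
  have hterm' : Tendsto (fun n => S.tinfch k (B.a n) (B.Λ n) (B.w n) • S.Qh k (B.w n) (p n)) atTop
      (𝓝 (Th • ((fderiv ℝ (S.Ech k) z₀).comp (polarDeriv (S.c k).θ (w₀.1, 0, estar))))) := by
    rcases hcase with h0 | ⟨hp, he⟩
    · have hT0 : Th = 0 :=
        tendsto_nhds_unique hTh (tendsto_const_nhds.congr' (Eventually.of_forall fun n => (h0 n).symm))
      rw [hT0, show (0 : ℝ) • ((fderiv ℝ (S.Ech k) z₀).comp (polarDeriv (S.c k).θ (w₀.1, 0, estar))) = 0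
        from zero_smul ℝ ((fderiv ℝ (S.Ech k) z₀).comp (polarDeriv (S.c k).θ (w₀.1, 0, estar)))]
      refine tendsto_const_nhds.congr' (Eventually.of_forall fun n => ?_)
      try dsimp only
      rw [h0 n]
      exact (zero_smul ℝ (S.Qh k (B.w n) (p n))).symm
    · have h1 : Tendsto (fun n => fderiv ℝ (S.Ech k) (S.Gh k (B.w n))) atTop
          (𝓝 (fderiv ℝ (S.Ech k) z₀)) := hDE.tendsto.comp B.tendsto_Gh
      have hu₀ : pt (((split ((S.c k).φ₁ x₀)).1, (0 : ℝ), estar) : ℙ) ∈ (S.c k).θ.source := by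
        rw [pt_apply]; simp only [zero_smul]
        exact (S.c k).fst_split_φ₁_mem_realSource B.hk B.hfix
      have hP : ContinuousAt (polarDeriv (S.c k).θ) ((split ((S.c k).φ₁ x₀)).1, 0, estar) :=
        continuousAt_polarDeriv (S.c k).isOpen_θ_source (S.c k).contDiffOn_θ
          (fun x hx => (S.c k).θ_flipIm hx) hu₀ he
      have h2 : Tendsto (fun n => polarDeriv (S.c k).θ (p n)) atTop
          (𝓝 (polarDeriv (S.c k).θ (w₀.1, 0, estar))) := hP.tendsto.comp hp
      exact hTh.smul (BranchedModel.tendsto_clm_comp h1 h2)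
  have := (tendsto_finsetSum (Finset.univ : Finset ι) fun i _ => hterm i).add hterm'
  simpa only [Alin] using this

/-! ### The weight-derivative part tends to zero -/

/-- **`Blinₙ → 0`.** The hypothesis `hcase` distinguishes sequences on the branch locus from
sequences `wₙ = sqModel xₙ` with `xₙ → w₀`. [folklore] -/
theorem tendsto_Blin (hkJ : q₁ x₀ ∈ tsupport (S.η k))
    (hcase : (∀ n, B.y n ∈ q₁ '' fixedPoints σ) ∨
      (∃ x : ℕ → 𝕄, Tendsto x atTop (𝓝 (((split ((S.c k).φ₁ x₀)).1, 0) : 𝕄)) ∧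
        ∀ n, B.w n = sqModel (x n) ∧ ‖(x n).2‖ ^ 2 = ‖(B.w n).2‖)) :
    Tendsto (fun n => S.Blin k (B.a n) (B.Λ n) (B.w n)) atTop (𝓝 0) := by
  set w₀ : 𝕄 := ((split ((S.c k).φ₁ x₀)).1, 0) with hw₀
  set z₀ := (S.c k).θ w₀ with hz₀
  -- Lipschitz bound for `Ech` near `z₀`
  obtain ⟨rE, hrE, LE, hLE, hlip⟩ := S.exists_ball_lipschitz_Ech k (S.base_target_mem B.hk B.hfix)
  have hGk_ball : ∀ᶠ n in atTop, S.Gx k k (B.w n) ∈ ball z₀ rE :=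
    (B.tendsto_Gx hkJ).eventually (ball_mem_nhds _ hrE)
  -- recentred expression
  have hrec : ∀ n, S.Blin k (B.a n) (B.Λ n) (B.w n) =
      ∑ i, (fderiv ℝ (S.tch k (B.a n) (B.Λ n) i) (B.w n)).smulRight
          (S.Ech k (S.Gx k i (B.w n)) - S.Ech k (S.Gx k k (B.w n))) +
        (fderiv ℝ (S.tinfch k (B.a n) (B.Λ n)) (B.w n)).smulRight
          (S.Ech k (S.Gh k (B.w n)) - S.Ech k (S.Gx k k (B.w n))) := fun n =>
    BranchedModel.sum_smulRight_add_recenter _ _ _ _ _ (S.sum_fderiv_tch k (B.a n) (B.hΛ n) (B.w_mem_Ω n))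
  -- each term tends to zero
  have hterm : ∀ i, Tendsto (fun n => (fderiv ℝ (S.tch k (B.a n) (B.Λ n) i) (B.w n)).smulRight
      (S.Ech k (S.Gx k i (B.w n)) - S.Ech k (S.Gx k k (B.w n)))) atTop (𝓝 0) := by
    intro i
    by_cases hi : q₁ x₀ ∈ tsupport (S.η i)
    · obtain ⟨C, hC⟩ := S.exists_bound_Gx_sub B.hk B.hfix hi hkJ
      have hGi_ball : ∀ᶠ n in atTop, S.Gx k i (B.w n) ∈ ball z₀ rE :=
        (B.tendsto_Gx hi).eventually (ball_mem_nhds _ hrE)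
      have hmaj : Tendsto (fun n => LE * |C| *
          (‖fderiv ℝ (S.tch k (B.a n) (B.Λ n) i) (B.w n)‖ * ‖(B.w n).2‖)) atTop (𝓝 0) := by
        simpa using (S.tendsto_fderiv_tch_mul B.hk B.hfix B.a B.Λ B.hΛ B.hΛ' B.tendsto_w i).const_mul
          (LE * |C|)
      refine squeeze_zero_norm' ?_ hmaj
      filter_upwards [hGi_ball, hGk_ball, B.eventually_of_nhds hC] with n h1 h2 h3
      rw [ContinuousLinearMap.norm_smulRight_apply]
      calc ‖fderiv ℝ (S.tch k (B.a n) (B.Λ n) i) (B.w n)‖ *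
            ‖S.Ech k (S.Gx k i (B.w n)) - S.Ech k (S.Gx k k (B.w n))‖
          ≤ ‖fderiv ℝ (S.tch k (B.a n) (B.Λ n) i) (B.w n)‖ * (LE * (|C| * ‖(B.w n).2‖)) := by
            gcongr
            refine (hlip _ h1 _ h2).trans ?_
            gcongr
            exact h3.trans (by gcongr; exact le_abs_self C)
        _ = LE * |C| * (‖fderiv ℝ (S.tch k (B.a n) (B.Λ n) i) (B.w n)‖ * ‖(B.w n).2‖) := by ring
    · refine tendsto_const_nhds.congr' ?_
      filter_upwards [B.eventually_of_nhds (S.eventually_tch_eventuallyEq_zero B.hk B.hfix hi)]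
        with n hn
      have h0 : fderiv ℝ (S.tch k (B.a n) (B.Λ n) i) (B.w n) = 0 := by
        rw [(hn (B.a n) (B.Λ n)).fderiv_eq]; exact fderiv_const_apply 0
      try dsimp only
      rw [h0]
      exact (ContinuousLinearMap.ext fun v => by simp).symm
  have hterm' : Tendsto (fun n => (fderiv ℝ (S.tinfch k (B.a n) (B.Λ n)) (B.w n)).smulRight
      (S.Ech k (S.Gh k (B.w n)) - S.Ech k (S.Gx k k (B.w n)))) atTop (𝓝 0) := by
    rcases hcase with hB | ⟨x, hx, hxw⟩
    · refine tendsto_const_nhds.congr' (Eventually.of_forall fun n => ?_)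
      have h0 : fderiv ℝ (S.tinfch k (B.a n) (B.Λ n)) (B.w n) = 0 := by
        rw [(S.tinfch_eventuallyEq_zero (B.a n) (B.Λ n) (B.w_mem_Ω n)
          (by rw [B.ych_w]; exact hB n)).fderiv_eq]
        exact fderiv_const_apply 0
      try dsimp only
      rw [h0]
      exact (ContinuousLinearMap.ext fun v => by simp).symm
    · obtain ⟨C, hC⟩ := S.exists_bound_Gh_sub B.hk B.hfix hkJ
      have hGh_ball : ∀ᶠ n in atTop, S.Gh k (B.w n) ∈ ball z₀ rE :=
        B.tendsto_Gh.eventually (ball_mem_nhds _ hrE)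
      have hmaj : Tendsto (fun n => LE * |C| *
          (‖fderiv ℝ (S.tinfch k (B.a n) (B.Λ n)) (B.w n)‖ * ‖(B.w n).2‖)) atTop (𝓝 0) := by
        simpa using (S.tendsto_fderiv_tinfch_mul B.hk B.hfix B.a B.Λ B.hΛ B.hΛ' B.tendsto_w).const_mul
          (LE * |C|)
      refine squeeze_zero_norm' ?_ hmaj
      filter_upwards [hGh_ball, hGk_ball, hx.eventually hC] with n h1 h2 h3
      rw [ContinuousLinearMap.norm_smulRight_apply]
      have h3' : ‖S.Gh k (B.w n) - S.Gx k k (B.w n)‖ ≤ |C| * ‖(B.w n).2‖ :=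
        calc ‖S.Gh k (B.w n) - S.Gx k k (B.w n)‖
            = ‖S.Gh k (sqModel (x n)) - S.Gx k k (sqModel (x n))‖ := by rw [← (hxw n).1]
          _ ≤ C * ‖(x n).2‖ ^ 2 := h3
          _ ≤ |C| * ‖(x n).2‖ ^ 2 := by gcongr; exact le_abs_self C
          _ = |C| * ‖(B.w n).2‖ := by rw [(hxw n).2]
      calc ‖fderiv ℝ (S.tinfch k (B.a n) (B.Λ n)) (B.w n)‖ *
            ‖S.Ech k (S.Gh k (B.w n)) - S.Ech k (S.Gx k k (B.w n))‖
          ≤ ‖fderiv ℝ (S.tinfch k (B.a n) (B.Λ n)) (B.w n)‖ * (LE * (|C| * ‖(B.w n).2‖)) := by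
            gcongr
            exact (hlip _ h1 _ h2).trans (by gcongr)
        _ = LE * |C| * (‖fderiv ℝ (S.tinfch k (B.a n) (B.Λ n)) (B.w n)‖ * ‖(B.w n).2‖) := by ring
  have hlim := (tendsto_finsetSum (Finset.univ : Finset ι) fun i _ => hterm i).add hterm'
  rw [Finset.sum_const_zero, add_zero] at hlim
  exact hlim.congr' (Eventually.of_forall fun n => (hrec n).symm)

/-! ### Goodness for large `n` -/

/-- **A good index**: the average at `yₙ` lies in the tube, the averaged map sends `yₙ` into the
target chart domain, and read in the charts it has an invertible derivative at `wₙ`. [folklore] -/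
def Good (n : ℕ) : Prop :=
  S.avg (B.a n) (B.Λ n) (B.y n) ∈ S.tube ∧ S.Φ (B.a n) (B.Λ n) (B.y n) ∈ (S.c k).ψ₂.source ∧
    ∃ L : 𝕄 ≃L[ℝ] 𝕄, HasFDerivAt (S.Φch k (B.a n) (B.Λ n)) (L : 𝕄 →L[ℝ] 𝕄) (B.w n)

omit [IsManifold (𝓡 4) ∞ Y₁] [IsManifold (𝓡 4) ∞ Y₂] in
/-- Goodness is compatible with reindexing. [folklore] -/
theorem good_comp_iff (φ : ℕ → ℕ) (hφ : StrictMono φ) (n : ℕ) :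
    (B.comp φ hφ).Good n ↔ B.Good (φ n) :=
  Iff.rfl

/-- **Eventual goodness under convergence assumptions.** Along a branch sequence read in an
active pair, if the weights converge and either all points are branch points or none is and the
polar data converge, then all large indices are good. [folklore] -/
theorem eventually_good (hkJ : q₁ x₀ ∈ tsupport (S.η k)) {T : ι → ℝ} {Th : ℝ} {estar : ℂ}
    (hT : ∀ i, Tendsto (fun n => S.tch k (B.a n) (B.Λ n) i (B.w n)) atTop (𝓝 (T i)))
    (hTh : Tendsto (fun n => S.tinfch k (B.a n) (B.Λ n) (B.w n)) atTop (𝓝 Th))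
    (he : ‖estar‖ = 1) (p : ℕ → ℙ)
    (hcase : (∀ n, B.y n ∈ q₁ '' fixedPoints σ) ∨
      ((∀ n, B.y n ∉ q₁ '' fixedPoints σ) ∧
        (∀ n, (p n).1 = (B.w n).1 ∧ 0 < (p n).2.1 ∧ ‖(p n).2.2‖ = 1 ∧
          B.w n = sqModel ((B.w n).1, (p n).2.1 • (p n).2.2) ∧ (p n).2.1 ^ 2 = ‖(B.w n).2‖) ∧
        Tendsto (fun n => (p n).2.2) atTop (𝓝 estar))) :
    ∀ᶠ n in atTop, B.Good n := by
  classical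
  set w₀ : 𝕄 := ((split ((S.c k).φ₁ x₀)).1, 0) with hw₀
  set z₀ := (S.c k).θ w₀ with hz₀
  have he0 : estar ≠ 0 := by
    rintro rfl; simp at he
  have hu₀ : (w₀ : 𝕄) ∈ (S.c k).θ.source := (S.c k).fst_split_φ₁_mem_realSource B.hk B.hfix
  -- (1) the weights of the comparison map vanish on the branch locus
  have htinf0 : ∀ n, B.y n ∈ q₁ '' fixedPoints σ → S.tinfch k (B.a n) (B.Λ n) (B.w n) = 0 := by
    intro n hn
    have h := (S.tinf_eventuallyEq_zero (B.a n) (B.Λ n) hn).self_of_nhds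
    simp only at h
    rw [tinfch, B.ych_w]
    exact h
  -- (2) convergence of the polar data and of the pre-images (off the branch locus)
  have hpolar : (∀ n, B.y n ∉ q₁ '' fixedPoints σ) →
      (∀ n, (p n).1 = (B.w n).1 ∧ 0 < (p n).2.1 ∧ ‖(p n).2.2‖ = 1 ∧
        B.w n = sqModel ((B.w n).1, (p n).2.1 • (p n).2.2) ∧ (p n).2.1 ^ 2 = ‖(B.w n).2‖) →
      Tendsto (fun n => (p n).2.2) atTop (𝓝 estar) →
      Tendsto p atTop (𝓝 (w₀.1, 0, estar)) ∧
        Tendsto (fun n => (((B.w n).1, (p n).2.1 • (p n).2.2) : 𝕄)) atTop (𝓝 w₀) := by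
    intro _ hp hpe
    have hs : Tendsto (fun n => (p n).2.1) atTop (𝓝 0) := by
      have h1 : Tendsto (fun n => Real.sqrt ‖(B.w n).2‖) atTop (𝓝 (Real.sqrt 0)) :=
        (Real.continuous_sqrt.tendsto 0).comp B.tendsto_norm_snd_w
      rw [Real.sqrt_zero] at h1
      refine h1.congr fun n => ?_
      rw [← (hp n).2.2.2.2, Real.sqrt_sq (hp n).2.1.le]
    have hfst : Tendsto (fun n => (p n).1) atTop (𝓝 w₀.1) := by
      have := B.tendsto_fst_w
      exact this.congr fun n => ((hp n).1).symm
    refine ⟨?_, ?_⟩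
    · have := hfst.prodMk_nhds (hs.prodMk_nhds hpe)
      exact this
    · have h2 : Tendsto (fun n => (p n).2.1 • (p n).2.2) atTop (𝓝 0) := by
        have := hs.smul hpe
        rwa [zero_smul] at this
      have := B.tendsto_fst_w.prodMk_nhds h2
      exact this
  -- (3) the derivative formula along the sequence
  have hp' : ∀ᶠ n in atTop, B.y n ∉ q₁ '' fixedPoints σ →
      B.w n = sqModel ((p n).1, (p n).2.1 • (p n).2.2) ∧ (p n).2.1 ≠ 0 ∧ (p n).2.2 ≠ 0 ∧
        (((p n).1, (p n).2.1 • (p n).2.2) : 𝕄) ∈ (S.c k).θ.source := by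
    rcases hcase with hA | ⟨hB, hp, hpe⟩
    · exact Eventually.of_forall fun n h => absurd (hA n) h
    · obtain ⟨-, hx⟩ := hpolar hB hp hpe
      filter_upwards [hx.eventually ((S.c k).isOpen_θ_source.mem_nhds hu₀)] with n hn _
      refine ⟨by rw [(hp n).1]; exact (hp n).2.2.2.1, (hp n).2.1.ne', ?_, by rw [(hp n).1]; exact hn⟩
      have := (hp n).2.2.1
      rintro h0; rw [h0, norm_zero] at this; exact zero_ne_one this
  have hderiv := B.eventually_hasFDerivAt_avgch p hp'
  -- (4) convergence of `Alin`, `Blin`, `D Rch`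
  have hA := B.tendsto_Alin hT hTh p (by
    rcases hcase with hA | ⟨hB, hp, hpe⟩
    · exact Or.inl fun n => htinf0 n (hA n)
    · exact Or.inr ⟨(hpolar hB hp hpe).1, he0⟩)
  have hBl := B.tendsto_Blin hkJ (by
    rcases hcase with hA | ⟨hB, hp, hpe⟩
    · exact Or.inl hA
    · refine Or.inr ⟨fun n => ((B.w n).1, (p n).2.1 • (p n).2.2), (hpolar hB hp hpe).2, fun n =>
        ⟨(hp n).2.2.2.1, ?_⟩⟩
      simp only [norm_smul, Real.norm_eq_abs, abs_of_pos (hp n).2.1, (hp n).2.2.1, mul_one]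
      exact (hp n).2.2.2.2)
  have hRc : ContDiffAt ℝ 1 (S.Rch k) (S.emb (q₂ x₀)) := (S.eventually_contDiffAt_Rch B.hk).self_of_nhds
  have hR : Tendsto (fun n => fderiv ℝ (S.Rch k) (S.avgch k (B.a n) (B.Λ n) (B.w n))) atTop
      (𝓝 (fderiv ℝ (S.Rch k) (S.emb (q₂ x₀)))) :=
    (hRc.continuousAt_fderiv one_ne_zero).tendsto.comp B.tendsto_avgch
  have hD := BranchedModel.tendsto_clm_comp hR (hA.add hBl)
  rw [add_zero] at hD
  -- (5) the limit is the limit operator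
  have hz₀mem : splitW.symm z₀ ∈ (S.c k).ψ₂.target := S.base_target_mem B.hk B.hfix
  have hEz₀ : S.Ech k z₀ = S.emb (q₂ x₀) := S.Ech_base B.hk B.hfix
  have hRE : ∀ v : 𝕄, fderiv ℝ (S.Rch k) (S.emb (q₂ x₀)) (fderiv ℝ (S.Ech k) z₀ v) = v := by
    intro v
    have h := S.fderiv_Rch_comp_fderiv_Ech k hz₀mem (by rw [hEz₀]; exact hRc.differentiableAt one_ne_zero)
    rw [hEz₀] at h
    have := congrArg (fun A : 𝕄 →L[ℝ] 𝕄 => A v) h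
    simpa only [ContinuousLinearMap.coe_comp, comp_apply, ContinuousLinearMap.id_apply] using this
  have hM : (fderiv ℝ (S.Rch k) (S.emb (q₂ x₀))).comp
      (∑ i, T i • ((fderiv ℝ (S.Ech k) z₀).comp (fderiv ℝ (S.Gx k i) w₀)) +
        Th • ((fderiv ℝ (S.Ech k) z₀).comp (polarDeriv (S.c k).θ (w₀.1, 0, estar)))) =
      S.Mstar k x₀ T Th estar := by
    refine ContinuousLinearMap.ext fun v => ?_
    simp only [Mstar, ContinuousLinearMap.coe_comp, comp_apply, add_apply, sum_apply, smul_apply,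
      map_add, map_sum, map_smul, hRE]
    rfl
  rw [hM] at hD
  -- (6) the limit operator is a unit; units are open
  have hTnn : ∀ i, 0 ≤ T i := fun i =>
    ge_of_tendsto' (hT i) fun n => S.t_nonneg _ _ _ _
  have hThnn : 0 ≤ Th := ge_of_tendsto' hTh fun n => S.tinf_nonneg _ _ _
  have hsum : ∑ i, T i + Th = 1 :=
    tendsto_nhds_unique ((tendsto_finsetSum (Finset.univ : Finset ι) fun i _ => hT i).add hTh)
      (tendsto_const_nhds.congr' (Eventually.of_forall fun n => (S.sum_tch k (B.a n) (B.Λ n) (B.w n)).symm))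
  have hT0 : ∀ i, q₁ x₀ ∉ tsupport (S.η i) → T i = 0 := by
    intro i hi
    have hev : ∀ᶠ n in atTop, S.tch k (B.a n) (B.Λ n) i (B.w n) = 0 := by
      filter_upwards [B.eventually_of_nhds (S.eventually_tch_eventuallyEq_zero B.hk B.hfix hi)]
        with n hn
      simpa using (hn (B.a n) (B.Λ n)).self_of_nhds
    exact tendsto_nhds_unique (hT i) (tendsto_const_nhds.congr' (hev.mono fun n hn => hn.symm))
  obtain ⟨u, hu⟩ := isUnit_of_injective (S.injective_Mstar B.hk B.hfix hTnn hThnn hsum hT0 he)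
  rw [← hu] at hD
  have hunit : ∀ᶠ n in atTop, IsUnit ((fderiv ℝ (S.Rch k) (S.avgch k (B.a n) (B.Λ n) (B.w n))).comp
      (S.Alin k (B.a n) (B.Λ n) (B.w n) (p n) + S.Blin k (B.a n) (B.Λ n) (B.w n))) :=
    hD.eventually (Units.isOpen.mem_nhds ⟨u, rfl⟩)
  -- (7) assemble
  filter_upwards [hunit, hderiv, B.eventually_avg_good] with n hun hd hg
  refine ⟨hg.1, hg.2.1, ?_⟩
  obtain ⟨un, hun⟩ := hun
  refine ⟨ContinuousLinearEquiv.unitsEquiv ℝ 𝕄 un, ?_⟩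
  have hcoe : ((ContinuousLinearEquiv.unitsEquiv ℝ 𝕄 un : 𝕄 ≃L[ℝ] 𝕄) : 𝕄 →L[ℝ] 𝕄) = (un : 𝕄 →L[ℝ] 𝕄) :=
    ContinuousLinearMap.ext fun v => rfl
  rw [hcoe, hun]
  exact S.hasFDerivAt_Φch hd (hg.2.2.differentiableAt one_ne_zero)

/-! ### Removing the convergence assumptions -/

/-- **Along every branch sequence read in an active pair some point is good.** [folklore] -/
theorem exists_good (hkJ : q₁ x₀ ∈ tsupport (S.η k)) : ∃ n, B.Good n := by
  classical
  -- it suffices to treat sequences entirely on, or entirely off, the branch locus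
  suffices key : ∀ B' : BranchSeq S k x₀,
      ((∀ n, B'.y n ∈ q₁ '' fixedPoints σ) ∨ (∀ n, B'.y n ∉ q₁ '' fixedPoints σ)) → ∃ n, B'.Good n by
    by_cases h : ∃ᶠ n in atTop, B.y n ∈ q₁ '' fixedPoints σ
    · obtain ⟨φ, hφ, hφ'⟩ := extraction_of_frequently_atTop h
      obtain ⟨n, hn⟩ := key (B.comp φ hφ) (Or.inl hφ')
      exact ⟨φ n, (B.good_comp_iff φ hφ n).1 hn⟩
    · rw [not_frequently] at h
      obtain ⟨φ, hφ, hφ'⟩ := extraction_of_eventually_atTop h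
      obtain ⟨n, hn⟩ := key (B.comp φ hφ) (Or.inr hφ')
      exact ⟨φ n, (B.good_comp_iff φ hφ n).1 hn⟩
  intro B' hB'
  -- polar data off the branch locus (trivial data on it)
  have hdata : ∃ s : ℕ → ℝ, ∃ e : ℕ → ℂ, (∀ n, ‖e n‖ = 1) ∧
      ((∀ n, B'.y n ∈ q₁ '' fixedPoints σ) ∨
        ((∀ n, B'.y n ∉ q₁ '' fixedPoints σ) ∧ ∀ n, 0 < s n ∧
          B'.w n = sqModel ((B'.w n).1, s n • e n) ∧ s n ^ 2 = ‖(B'.w n).2‖)) := by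
    rcases hB' with hA | hB
    · exact ⟨fun _ => 1, fun _ => 1, fun _ => by simp, Or.inl hA⟩
    · have hw2 : ∀ n, (B'.w n).2 ≠ 0 := fun n h => hB n ((B'.snd_w_eq_zero_iff n).1 h)
      choose s hs e he hw hs2 using fun n => exists_polar (B'.w n) (hw2 n)
      exact ⟨s, e, he, Or.inr ⟨hB, fun n => ⟨hs n, hw n, hs2 n⟩⟩⟩
  obtain ⟨s, e, he, hcase⟩ := hdata
  -- compactness: extract convergence of the weights and of the direction
  set V : ℕ → (ι → ℝ) × ℝ × ℂ := fun n =>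
    (fun i => S.tch k (B'.a n) (B'.Λ n) i (B'.w n), S.tinfch k (B'.a n) (B'.Λ n) (B'.w n), e n) with hV
  set K : Set ((ι → ℝ) × ℝ × ℂ) := (Set.pi univ fun _ => Icc 0 1) ×ˢ (Icc 0 1 ×ˢ sphere 0 1) with hK
  have hKc : IsCompact K :=
    (isCompact_univ_pi fun _ => isCompact_Icc).prod (isCompact_Icc.prod (isCompact_sphere 0 1))
  have hVK : ∀ n, V n ∈ K := by
    intro n
    have hs1 := S.sum_tch k (B'.a n) (B'.Λ n) (B'.w n)
    have hnn : ∀ i, 0 ≤ S.tch k (B'.a n) (B'.Λ n) i (B'.w n) := fun i => S.t_nonneg _ _ _ _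
    have hinf := S.tinf_nonneg (B'.a n) (B'.Λ n) (S.ych k (B'.w n))
    have hsum_nn : 0 ≤ ∑ i, S.tch k (B'.a n) (B'.Λ n) i (B'.w n) := Finset.sum_nonneg fun i _ => hnn i
    refine ⟨fun i _ => ⟨hnn i, ?_⟩, ⟨⟨hinf, ?_⟩, by simpa using he n⟩⟩
    · have := Finset.single_le_sum (fun j _ => hnn j) (Finset.mem_univ i)
      change S.tch k (B'.a n) (B'.Λ n) i (B'.w n) ≤ 1
      have h' : S.tinfch k (B'.a n) (B'.Λ n) (B'.w n) = S.tinf (B'.a n) (B'.Λ n) (S.ych k (B'.w n)) := rfl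
      linarith
    · change S.tinfch k (B'.a n) (B'.Λ n) (B'.w n) ≤ 1
      linarith
  obtain ⟨v, hvK, φ, hφ, hv⟩ := hKc.tendsto_subseq hVK
  set B'' := B'.comp φ hφ with hB''
  -- limits along the subsequence
  have hT : ∀ i, Tendsto (fun n => S.tch k (B''.a n) (B''.Λ n) i (B''.w n)) atTop (𝓝 (v.1 i)) := by
    intro i
    have := ((continuous_apply i).tendsto v.1).comp ((continuous_fst.tendsto v).comp hv)
    exact this
  have hTh : Tendsto (fun n => S.tinfch k (B''.a n) (B''.Λ n) (B''.w n)) atTop (𝓝 v.2.1) :=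
    (continuous_fst.tendsto v.2).comp ((continuous_snd.tendsto v).comp hv)
  have hE : Tendsto (fun n => e (φ n)) atTop (𝓝 v.2.2) :=
    (continuous_snd.tendsto v.2).comp ((continuous_snd.tendsto v).comp hv)
  have hve : ‖v.2.2‖ = 1 := by simpa using hvK.2.2
  -- apply eventual goodness
  have hgood : ∀ᶠ n in atTop, B''.Good n := by
    refine B''.eventually_good hkJ hT hTh hve (fun n => ((B''.w n).1, s (φ n), e (φ n))) ?_
    rcases hcase with hA | ⟨hB, hp⟩
    · exact Or.inl fun n => hA (φ n)
    · exact Or.inr ⟨fun n => hB (φ n), fun n => ⟨rfl, (hp (φ n)).1, he (φ n), (hp (φ n)).2.1,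
        (hp (φ n)).2.2⟩, hE⟩
  obtain ⟨n, hn⟩ := hgood.exists
  exact ⟨φ n, (B'.good_comp_iff φ hφ n).1 hn⟩

end BranchSeq

end Setup

end Literature.Topology.FourManifolds

end


/-!
# Global assembly: the averaged map is a diffeomorphism for small parameters

Topic `Topology/FourManifolds`; namespace `Literature.Topology.FourManifolds`. Sixteenth file of
the proof of `Literature.Topology.FourManifolds.DegtyarevKharlamov2000_conjQuotient_unique`
(`ConjugationQuotients.lean`). Everything is proved; no named facts.

* `Setup.isLocalDiffeomorphAt_of_good` — a good index (`ConjugationQuotientsMainEstimate`) gives a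
  local diffeomorphism at the point (chart-level inverse function theorem,
  `Literature.Geometry.Manifold.isLocalDiffeomorphAt_of_hasFDerivAt_charts`).
* `Setup.eventually_allGood` — for the parameters `aₙ = -(2n+2)`, `Λₙ = n+1`, for all large `n`
  the averaged map `Φₙ` is a local diffeomorphism at every point and the average lies in the
  tube (by contradiction: bad points accumulate either off the branch locus, where `Φₙ` is
  eventually the comparison map, or at a branch point, contradicting `BranchSeq.exists_good`).
* `Setup.eventually_image_small` — `Φₙ` maps `{rad ≤ e^{aₙ+Λₙ}}` into any neighbourhood of the
  branch locus for large `n`.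
* `Setup.exists_notMem_branchLocus` — non-branch points are dense in `Y₂`;
  `Setup.exists_diffeomorph` — `Φₙ ∘ h⁻¹ : Y₂ → Y₂` is a proper local homeomorphism which is the
  identity off a small neighbourhood of the branch locus and has a singleton fibre in every
  component, hence is bijective (`Literature.Topology.IsLocalHomeomorph.bijective_of_forall_existsUnique`);
  so `Φₙ` is a bijective local diffeomorphism, a diffeomorphism `Y₁ → Y₂`.

## References

* A. Degtyarev, V. Kharlamov, Russian Math. Surveys 55 (2000), arXiv:math/0004134, §3.2 ¶1.
  [DegtyarevKharlamov2000]
-/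

noncomputable section

open scoped Manifold ContDiff Topology
open Set Function Filter Metric
open Literature.Topology.FourManifolds.BranchedModel

namespace Literature.Topology.FourManifolds

/-- Local notation: `𝕄` is the split model space `(Fin 2 → ℝ) × ℂ`. -/
local notation "𝕄" => (Fin 2 → ℝ) × ℂ

/-- Local notation: the Euclidean space `ℝᴺ`. -/
local notation "𝔼" N:arg => EuclideanSpace ℝ (Fin N)

namespace Setup

variable {X : Type*} [TopologicalSpace X] [ChartedSpace (Fin 2 → ℂ) X]
  {Y₁ : Type*} [TopologicalSpace Y₁] [ChartedSpace (EuclideanSpace ℝ (Fin 4)) Y₁]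
  {Y₂ : Type*} [TopologicalSpace Y₂] [ChartedSpace (EuclideanSpace ℝ (Fin 4)) Y₂]
  {ι : Type*} [Fintype ι] {σ : X → X} {q₁ : X → Y₁} {q₂ : X → Y₂} {N : ℕ}

/-! ### From a good index to a local diffeomorphism -/

/-- **A good point is a local diffeomorphism point of the averaged map.** [folklore] -/
theorem isLocalDiffeomorphAt_of_good [IsManifold (𝓡 4) ∞ Y₁] [IsManifold (𝓡 4) ∞ Y₂]
    (S : Setup ι σ q₁ q₂ N) {k : ι} {a Λ : ℝ} (hΛ : 0 < Λ) {y : Y₁} (hy : y ∈ (S.c k).ψ₁.source)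
    (htube : S.avg a Λ y ∈ S.tube) (hΦ : S.Φ a Λ y ∈ (S.c k).ψ₂.source) {L : 𝕄 ≃L[ℝ] 𝕄}
    (hL : HasFDerivAt (S.Φch k a Λ) (L : 𝕄 →L[ℝ] 𝕄) (splitW ((S.c k).ψ₁ y))) :
    IsLocalDiffeomorphAt (𝓡 4) (𝓡 4) ∞ (S.Φ a Λ) y := by
  -- smooth on the open set where the average lies in the tube
  have hs : IsOpen {y' | S.avg a Λ y' ∈ S.tube} :=
    S.tube_open.preimage (S.contMDiff_avg a hΛ).continuous
  have hf : ContMDiffOn (𝓡 4) (𝓡 4) ∞ (S.Φ a Λ) {y' | S.avg a Λ y' ∈ S.tube} := fun y' hy' =>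
    (S.contMDiffAt_Φ a hΛ hy').contMDiffWithinAt
  -- the chart expression in the charts `ψ₁`, `ψ₂` is `splitW⁻¹ ∘ Φch ∘ splitW`
  have h2 : HasFDerivAt (S.Φch k a Λ ∘ fun v : 𝔼 4 => splitW v)
      ((L : 𝕄 →L[ℝ] 𝕄).comp (splitW : 𝔼 4 →L[ℝ] 𝕄)) ((S.c k).ψ₁ y) :=
    hL.comp _ splitW.hasFDerivAt
  have h3 := (splitW.symm.hasFDerivAt (x := (S.Φch k a Λ ∘ fun v : 𝔼 4 => splitW v) ((S.c k).ψ₁ y))).comp _ h2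
  have hg : HasFDerivAt ((S.c k).ψ₂ ∘ S.Φ a Λ ∘ (S.c k).ψ₁.symm)
      (((splitW.trans (L.trans splitW.symm) : 𝔼 4 ≃L[ℝ] 𝔼 4)) : 𝔼 4 →L[ℝ] 𝔼 4) ((S.c k).ψ₁ y) := by
    refine (h3.congr_of_eventuallyEq (Eventually.of_forall fun v => ?_)).congr_fderiv
      (ContinuousLinearMap.ext fun v => rfl)
    simp only [comp_apply, Φch, ych, ContinuousLinearEquiv.symm_apply_apply]
  exact Literature.Geometry.Manifold.isLocalDiffeomorphAt_of_hasFDerivAt_charts (by simp) hs htube hf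
    (S.c k).ψ₁_mem (S.c k).ψ₂_mem hy hΦ hg

/-! ### The parameter sequences -/

/-- The inner parameters `aₙ = -(2n + 2)`. [folklore] -/
def aseq (n : ℕ) : ℝ := -(2 * n + 2)

/-- The logarithmic widths `Λₙ = n + 1`. [folklore] -/
def Λseq (n : ℕ) : ℝ := n + 1

/-- `Λseq_pos` (auxiliary). [folklore] -/
theorem Λseq_pos (n : ℕ) : 0 < Λseq n := by unfold Λseq; positivity

/-- `aseq_add_Λseq` (auxiliary). [folklore] -/
theorem aseq_add_Λseq (n : ℕ) : aseq n + Λseq n = -(n + 1 : ℝ) := by unfold aseq Λseq; ring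

/-- `tendsto_Λseq` (auxiliary). [folklore] -/
theorem tendsto_Λseq : Tendsto Λseq atTop atTop :=
  tendsto_atTop_add_const_right _ 1 tendsto_natCast_atTop_atTop

/-- `e^{aₙ+Λₙ} → 0`, also along any subsequence. [folklore] -/
theorem tendsto_exp_params {φ : ℕ → ℕ} (hφ : StrictMono φ) :
    Tendsto (fun n => Real.exp (aseq (φ n) + Λseq (φ n))) atTop (𝓝 0) := by
  have h1 : Tendsto (fun n => (φ n : ℝ) + 1) atTop atTop :=
    tendsto_atTop_add_const_right _ 1 (tendsto_natCast_atTop_atTop.comp hφ.tendsto_atTop)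
  have h2 := Real.tendsto_exp_neg_atTop_nhds_zero.comp h1
  refine h2.congr fun n => ?_
  simp only [comp_apply, aseq_add_Λseq]

/-- Far from the branch locus the average is `emb ∘ comparison`. [folklore] -/
theorem avg_of_gt (S : Setup ι σ q₁ q₂ N) {a Λ : ℝ} (hΛ : 0 < Λ) {y : Y₁}
    (h : Real.exp (a + Λ) < S.rad y) : S.avg a Λ y = S.emb (S.hcmp y) := by
  rw [avg, Finset.sum_eq_zero fun i _ => by rw [S.t_of_ge hΛ h.le i, zero_smul], zero_add,
    S.tinf_of_ge hΛ h.le, one_smul]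

/-! ### Non-branch points are dense -/

/-- **Every neighbourhood in `Y₂` contains a non-branch point** (in an adapted chart at a fixed
point the fixed points are the real points, which have empty interior). [folklore] -/
theorem exists_notMem_branchLocus (S : Setup ι σ q₁ q₂ N) (z : Y₂) {V : Set Y₂} (hV : V ∈ 𝓝 z) :
    ∃ z' ∈ V, z' ∉ q₂ '' fixedPoints σ := by
  by_cases hz : z ∈ q₂ '' fixedPoints σ
  · obtain ⟨x₀, hfix, rfl⟩ := hz
    obtain ⟨k, hk⟩ := S.cover x₀ hfix
    set c := S.c k with hc
    -- the path of non-real chart points `p t = φ₁ x₀ + t • I`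
    set p : ℝ → (Fin 2 → ℂ) := fun t => c.φ₁ x₀ + (t : ℂ) • fun _ => Complex.I with hp
    have hpc : Continuous p := by
      refine continuous_const.add (Continuous.smul Complex.continuous_ofReal continuous_const)
    have hp0 : p 0 = c.φ₁ x₀ := by simp [hp]
    -- the good chart points form a neighbourhood of `p 0`
    have hW : IsOpen (c.φ₁.target ∩ c.φ₁.symm ⁻¹' (c.dom ∩ q₂ ⁻¹' interior V)) :=
      c.φ₁.continuousOn_symm.isOpen_inter_preimage c.φ₁.open_target
        (c.isOpen_dom.inter (isOpen_interior.preimage S.h₂.continuous))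
    have hmem : p 0 ∈ c.φ₁.target ∩ c.φ₁.symm ⁻¹' (c.dom ∩ q₂ ⁻¹' interior V) := by
      rw [hp0]
      refine ⟨c.φ₁.map_source hk.1, ?_⟩
      rw [mem_preimage, c.φ₁.left_inv hk.1]
      exact ⟨hk, mem_interior_iff_mem_nhds.2 hV⟩
    have hev : ∀ᶠ t in 𝓝 (0 : ℝ), p t ∈ c.φ₁.target ∩ c.φ₁.symm ⁻¹' (c.dom ∩ q₂ ⁻¹' interior V) :=
      hpc.continuousAt.preimage_mem_nhds (hW.mem_nhds hmem)
    obtain ⟨t, ⟨ht, hdom, hVt⟩, ht0⟩ :=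
      ((hev.filter_mono nhdsWithin_le_nhds).and self_mem_nhdsWithin).exists (f := 𝓝[≠] (0 : ℝ))
    refine ⟨q₂ (c.φ₁.symm (p t)), interior_subset hVt, fun hmemB => ?_⟩
    -- a branch point would be a real chart point
    have hfix' : σ (c.φ₁.symm (p t)) = c.φ₁.symm (p t) :=
      (S.h₂.apply_mem_image_fixedPoints_iff _).1 hmemB
    have hstar : star (p t) = p t := by
      have h1 := (c.adapted₁ _ hdom.1).2.1
      rw [hfix', c.φ₁.right_inv ht] at h1
      exact h1.symm
    have hstar0 : star (c.φ₁ x₀) = c.φ₁ x₀ := by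
      have h1 := (c.adapted₁ x₀ hk.1).2.1
      rw [hfix] at h1
      exact h1.symm
    have h2 := congrFun hstar 0
    have h3 := congrFun hstar0 0
    simp only [hp, Pi.star_apply, Pi.add_apply, Pi.smul_apply, star_add, smul_eq_mul, star_mul',
      Complex.star_def, Complex.conj_ofReal, Complex.conj_I] at h2 h3
    rw [h3] at h2
    have h4 : (t : ℂ) * Complex.I = 0 := by linear_combination (-1 / 2 : ℂ) * h2
    rcases mul_eq_zero.1 h4 with h5 | h5
    · exact ht0 (by exact_mod_cast h5)
    · exact Complex.I_ne_zero h5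
  · exact ⟨z, mem_of_mem_nhds hV, hz⟩

/-! ### Accumulation at a branch point yields a branch sequence -/

section Global

variable [T2Space Y₁] [SecondCountableTopology Y₁] [CompactSpace Y₁]
  [IsManifold (𝓡 4) ∞ Y₁] [IsManifold (𝓡 4) ∞ Y₂]

omit [T2Space Y₁] [SecondCountableTopology Y₁] [CompactSpace Y₁] [IsManifold (𝓡 4) ∞ Y₁]
  [IsManifold (𝓡 4) ∞ Y₂] in
/-- **At a branch point some pair is active**, and the fixed point lies in its common domain.
[folklore] -/
theorem exists_active (S : Setup ι σ q₁ q₂ N) {x₀ : X} (hfix : σ x₀ = x₀) :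
    ∃ k, q₁ x₀ ∈ tsupport (S.η k) ∧ x₀ ∈ (S.c k).dom := by
  classical
  have hB : q₁ x₀ ∈ q₁ '' fixedPoints σ := ⟨x₀, hfix, rfl⟩
  have hinf : S.ηinf (q₁ x₀) = 0 := by
    simpa using (S.ηinf_eventuallyEq_zero hB).self_of_nhds
  have hsum : ∑ i, S.η i (q₁ x₀) = 1 := by rw [S.sum_η_eq, hinf, sub_zero]
  obtain ⟨k, -, hk⟩ : ∃ k ∈ Finset.univ, S.η k (q₁ x₀) ≠ 0 := by
    by_contra hall
    push Not at hall
    rw [Finset.sum_eq_zero hall] at hsum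
    exact zero_ne_one hsum
  have hk' : q₁ x₀ ∈ tsupport (S.η k) := subset_tsupport _ (Function.mem_support.2 hk)
  exact ⟨k, hk', S.mem_dom_of_mem_tsupport hfix hk'⟩

omit [T2Space Y₁] [SecondCountableTopology Y₁] [CompactSpace Y₁] [IsManifold (𝓡 4) ∞ Y₁]
  [IsManifold (𝓡 4) ∞ Y₂] in
/-- **A sequence converging to a branch point has a tail which is a branch sequence in an active
pair** (after reindexing). [folklore] -/
theorem exists_branchSeq (S : Setup ι σ q₁ q₂ N) {a Λ : ℕ → ℝ} (hΛ : ∀ n, 0 < Λ n) (hΛ' : Tendsto Λ atTop atTop)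
    {y : ℕ → Y₁} {x₀ : X} (hfix : σ x₀ = x₀) (hy : Tendsto y atTop (𝓝 (q₁ x₀))) :
    ∃ k, q₁ x₀ ∈ tsupport (S.η k) ∧ ∃ φ : ℕ → ℕ, StrictMono φ ∧ ∃ B : BranchSeq S k x₀,
      B.a = a ∘ φ ∧ B.Λ = Λ ∘ φ ∧ B.y = y ∘ φ := by
  obtain ⟨k, hkJ, hk⟩ := S.exists_active hfix
  have hopen : IsOpen (q₁ '' (S.c k).dom) := S.h₁.isOpen_image S.hσ (S.c k).isOpen_dom
  have hev : ∀ᶠ n in atTop, y n ∈ q₁ '' (S.c k).dom := hy.eventually (hopen.mem_nhds ⟨x₀, hk, rfl⟩)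
  obtain ⟨φ, hφ, hφ'⟩ := extraction_of_eventually_atTop hev
  exact ⟨k, hkJ, φ, hφ,
    { a := a ∘ φ, Λ := Λ ∘ φ, y := y ∘ φ, hΛ := fun n => hΛ (φ n), hΛ' := hΛ'.comp hφ.tendsto_atTop,
      hy := hy.comp hφ.tendsto_atTop, hyd := hφ', hk := hk, hfix := hfix }, rfl, rfl, rfl⟩

/-! ### All points are good for large `n` -/

/-- **For large `n` the averaged map is good everywhere**: the average lies in the tube and `Φₙ`
is a local diffeomorphism at every point. [folklore] -/
theorem eventually_allGood (S : Setup ι σ q₁ q₂ N) :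
    ∀ᶠ n in atTop, ∀ y, S.avg (aseq n) (Λseq n) y ∈ S.tube ∧
      IsLocalDiffeomorphAt (𝓡 4) (𝓡 4) ∞ (S.Φ (aseq n) (Λseq n)) y := by
  by_contra hcon
  rw [not_eventually] at hcon
  obtain ⟨φ, hφ, hbad⟩ := extraction_of_frequently_atTop hcon
  choose y hy using fun n => not_forall.1 (hbad n)
  obtain ⟨ystar, -, ψ, hψ, hlim⟩ := isCompact_univ.tendsto_subseq fun n => mem_univ (y n)
  by_cases hB : ystar ∈ q₁ '' fixedPoints σ
  · -- accumulation at a branch point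
    obtain ⟨x₀, hfix, rfl⟩ := hB
    obtain ⟨k, hkJ, χ, hχ, B, hBa, hBΛ, hBy⟩ := S.exists_branchSeq (a := aseq ∘ φ ∘ ψ)
      (Λ := Λseq ∘ φ ∘ ψ) (fun n => Λseq_pos _)
      (tendsto_Λseq.comp ((hφ.comp hψ).tendsto_atTop)) hfix hlim
    obtain ⟨n, hn₁, hn₂, L, hL⟩ := B.exists_good hkJ
    refine hy (ψ (χ n)) ⟨?_, ?_⟩
    · have := hn₁
      rw [hBa, hBΛ, hBy] at this
      exact this
    · have hloc := S.isLocalDiffeomorphAt_of_good (B.hΛ n) (B.y_mem_source n) hn₁ hn₂ hL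
      rw [hBa, hBΛ, hBy] at hloc
      exact hloc
  · -- accumulation off the branch locus: `Φ` is eventually the comparison map there
    have hpos : 0 < S.rad ystar := S.rad_pos hB
    have hr : Tendsto (fun n => S.rad (y (ψ n))) atTop (𝓝 (S.rad ystar)) :=
      (S.contMDiff_rad.continuous.tendsto _).comp hlim
    have he : Tendsto (fun n => Real.exp (aseq (φ (ψ n)) + Λseq (φ (ψ n)))) atTop (𝓝 0) :=
      tendsto_exp_params (hφ.comp hψ)
    obtain ⟨n, hn⟩ := (he.eventually_lt hr hpos).exists
    obtain ⟨x, hx⟩ := S.h₁.surjective (y (ψ n))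
    have hxB : σ x ≠ x := by
      intro hfix
      have : S.rad (y (ψ n)) = 0 := S.rad_eq_zero (by rw [← hx]; exact ⟨x, hfix, rfl⟩)
      rw [this] at hn
      exact (Real.exp_pos _).not_gt hn
    refine hy (ψ n) ⟨?_, ?_⟩
    · rw [S.avg_of_gt (Λseq_pos _) hn]; exact S.emb_mem _
    · have hloc : IsLocalDiffeomorphAt (𝓡 4) (𝓡 4) ∞ S.hcmp (y (ψ n)) := by
        rw [← hx]; exact IsBranchedDoubleQuotient.isLocalDiffeomorphAt_comparison S.h₁ S.h₂ hxB
      exact hloc.congr_of_eventuallyEq (S.Φ_eventuallyEq (Λseq_pos _) hn)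

/-- The comparison homeomorphism of the set-up. [folklore] -/
def hH (S : Setup ι σ q₁ q₂ N) : Y₁ ≃ₜ Y₂ :=
  IsBranchedDoubleQuotient.comparisonHomeomorph S.h₁ S.h₂

omit [T2Space Y₁] [SecondCountableTopology Y₁] [CompactSpace Y₁] [IsManifold (𝓡 4) ∞ Y₁]
  [IsManifold (𝓡 4) ∞ Y₂] in
/-- The comparison homeomorphism is the comparison map. [folklore] -/
theorem hH_apply (S : Setup ι σ q₁ q₂ N) (y : Y₁) : S.hH y = S.hcmp y := rfl

omit [T2Space Y₁] [SecondCountableTopology Y₁] [CompactSpace Y₁] [IsManifold (𝓡 4) ∞ Y₁]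
  [IsManifold (𝓡 4) ∞ Y₂] in
/-- The inverse comparison homeomorphism over `X`: `h⁻¹ (q₂ x) = q₁ x`. [folklore] -/
theorem hH_symm_apply_q₂ (S : Setup ι σ q₁ q₂ N) (x : X) : S.hH.symm (q₂ x) = q₁ x :=
  IsBranchedDoubleQuotient.comparison_apply S.h₂ S.h₁ x

/-- **For large `n`, `Φₙ` maps the inner region into any neighbourhood of the branch locus**:
`rad y ≤ e^{aₙ+Λₙ} → rad (h⁻¹ (Φₙ y)) < ρ`. [folklore] -/
theorem eventually_image_small (S : Setup ι σ q₁ q₂ N) {ρ : ℝ} (hρ : 0 < ρ) :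
    ∀ᶠ n in atTop, ∀ y, S.rad y ≤ Real.exp (aseq n + Λseq n) →
      S.rad (S.hH.symm (S.Φ (aseq n) (Λseq n) y)) < ρ := by
  by_contra hcon
  rw [not_eventually] at hcon
  obtain ⟨φ, hφ, hbad⟩ := extraction_of_frequently_atTop hcon
  choose y hy using fun n => not_forall.1 (hbad n)
  have hy' : ∀ n, S.rad (y n) ≤ Real.exp (aseq (φ n) + Λseq (φ n)) ∧
      ρ ≤ S.rad (S.hH.symm (S.Φ (aseq (φ n)) (Λseq (φ n)) (y n))) := fun n => by
    have := hy n
    rw [Classical.not_imp, not_lt] at this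
    exact this
  obtain ⟨ystar, -, ψ, hψ, hlim⟩ := isCompact_univ.tendsto_subseq fun n => mem_univ (y n)
  -- the limit is a branch point
  have hrad0 : S.rad ystar = 0 := by
    have hr : Tendsto (fun n => S.rad (y (ψ n))) atTop (𝓝 (S.rad ystar)) :=
      (S.contMDiff_rad.continuous.tendsto _).comp hlim
    have he : Tendsto (fun n => Real.exp (aseq (φ (ψ n)) + Λseq (φ (ψ n)))) atTop (𝓝 0) :=
      tendsto_exp_params (hφ.comp hψ)
    refine le_antisymm (le_of_tendsto_of_tendsto' hr he fun n => (hy' (ψ n)).1) (S.rad_nonneg _)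
  obtain ⟨x₀, hfix, hx₀⟩ := (S.rad_eq_zero_iff ystar).1 hrad0
  rw [← hx₀] at hlim
  obtain ⟨k, hkJ, χ, hχ, B, hBa, hBΛ, hBy⟩ := S.exists_branchSeq (a := aseq ∘ φ ∘ ψ)
    (Λ := Λseq ∘ φ ∘ ψ) (fun n => Λseq_pos _) (tendsto_Λseq.comp ((hφ.comp hψ).tendsto_atTop)) hfix hlim
  -- along the branch sequence `Φ (yₙ) → q₂ x₀`, hence `rad (h⁻¹ (Φ yₙ)) → 0`
  have hΦ : Tendsto (fun n => S.Φ (B.a n) (B.Λ n) (B.y n)) atTop (𝓝 (q₂ x₀)) := by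
    have hretr : ContinuousAt S.retr (S.emb (q₂ x₀)) :=
      S.retr_smooth.continuousOn.continuousAt (S.tube_open.mem_nhds (S.emb_mem _))
    have h := hretr.tendsto.comp B.tendsto_avgch
    rw [S.retr_emb] at h
    exact h.congr fun n => (B.Φ_eq n).symm
  have hrad : Tendsto (fun n => S.rad (S.hH.symm (S.Φ (B.a n) (B.Λ n) (B.y n)))) atTop (𝓝 0) := by
    have hc : ContinuousAt (fun z => S.rad (S.hH.symm z)) (q₂ x₀) :=
      (S.contMDiff_rad.continuous.comp S.hH.symm.continuous).continuousAt
    have h := hc.tendsto.comp hΦ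
    simp only [hH_symm_apply_q₂] at h
    rwa [S.rad_eq_zero ⟨x₀, hfix, rfl⟩] at h
  obtain ⟨n, hn⟩ := (hrad.eventually (gt_mem_nhds hρ)).exists
  have := (hy' (ψ (χ n))).2
  rw [hBa, hBΛ, hBy] at hn
  simp only [comp_apply] at hn
  linarith

/-! ### Bijectivity and the diffeomorphism -/

/-- **The averaged map is a diffeomorphism for suitable parameters.** [folklore] -/
theorem exists_diffeomorph [T2Space Y₂] [CompactSpace Y₂] (S : Setup ι σ q₁ q₂ N) : Nonempty (Y₁ ≃ₘ⟮𝓡 4, 𝓡 4⟯ Y₂) := by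
  classical
  haveI : LocallyConnectedSpace Y₂ := ChartedSpace.locallyConnectedSpace (EuclideanSpace ℝ (Fin 4)) Y₂
  -- finitely many components, a non-branch representative in each, and a positive level `ρ`
  obtain ⟨t, ht⟩ := isCompact_univ.elim_finite_subcover (fun z : Y₂ => connectedComponent z)
    (fun _ => isOpen_connectedComponent) (fun z _ => mem_iUnion.2 ⟨z, mem_connectedComponent⟩)
  choose rep hrep hrepB using fun z : Y₂ =>
    S.exists_notMem_branchLocus z (isOpen_connectedComponent.mem_nhds mem_connectedComponent)
  have hrad_rep : ∀ z, 0 < S.rad (S.hH.symm (rep z)) := fun z =>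
    S.rad_pos fun hmem => hrepB z
      ((IsBranchedDoubleQuotient.comparison_mem_image_fixedPoints_iff S.h₂ S.h₁ (rep z)).1 hmem)
  by_cases hne : t.Nonempty
  swap
  · -- `Y₂` is empty
    simp only [Finset.not_nonempty_iff_eq_empty] at hne
    rw [hne] at ht
    have hY : IsEmpty Y₂ := ⟨fun z => by simpa using ht (mem_univ z)⟩
    have hY₁ : IsEmpty Y₁ := ⟨fun y => hY.elim (S.hH y)⟩
    exact ⟨{ toEquiv := Equiv.equivOfIsEmpty Y₁ Y₂
             contMDiff_toFun := fun y => hY₁.elim y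
             contMDiff_invFun := fun z => hY.elim z }⟩
  set ρ : ℝ := t.inf' hne fun z => S.rad (S.hH.symm (rep z)) with hρ
  have hρpos : 0 < ρ := (Finset.lt_inf'_iff hne).2 fun z _ => hrad_rep z
  have hρle : ∀ z ∈ t, ρ ≤ S.rad (S.hH.symm (rep z)) := fun z hz => Finset.inf'_le _ hz
  -- a large index
  have hexp : ∀ᶠ n in atTop, Real.exp (aseq n + Λseq n) < ρ := by
    have := tendsto_exp_params strictMono_id
    exact this.eventually (gt_mem_nhds hρpos)
  obtain ⟨n, hgood, hsmall, hexpn⟩ := (S.eventually_allGood.and ((S.eventually_image_small hρpos).and hexp)).exists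
  set Φn := S.Φ (aseq n) (Λseq n) with hΦn
  have hΦloc : IsLocalDiffeomorph (𝓡 4) (𝓡 4) ∞ Φn := fun y => (hgood y).2
  -- `F = Φₙ ∘ h⁻¹` is a proper local homeomorphism of `Y₂`
  set F : Y₂ → Y₂ := Φn ∘ S.hH.symm with hF
  have hFloc : IsLocalHomeomorph F :=
    hΦloc.isLocalHomeomorph.comp S.hH.symm.isLocalHomeomorph
  have hFprop : IsProperMap F := hFloc.continuous.isProperMap
  -- `F = id` where `rad ∘ h⁻¹ > e^{aₙ+Λₙ}`
  have hFid : ∀ z, Real.exp (aseq n + Λseq n) < S.rad (S.hH.symm z) → F z = z := by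
    intro z hz
    simp only [hF, comp_apply, hΦn, S.Φ_of_gt (Λseq_pos n) hz]
    exact S.hH.apply_symm_apply z
  -- every component has a representative with a singleton fibre
  have hfib : ∀ z, ∃ z' ∈ connectedComponent z, ∃! x, F x = z' := by
    intro z
    obtain ⟨z₁, hz₁, hzz₁⟩ : ∃ z₁ ∈ t, z ∈ connectedComponent z₁ := by
      have := ht (mem_univ z)
      simpa only [mem_iUnion, exists_prop] using this
    have hrepz : rep z₁ ∈ connectedComponent z := by
      rw [← connectedComponent_eq hzz₁]; exact hrep z₁
    have hbig : Real.exp (aseq n + Λseq n) < S.rad (S.hH.symm (rep z₁)) :=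
      hexpn.trans_le (hρle z₁ hz₁)
    refine ⟨rep z₁, hrepz, rep z₁, hFid _ hbig, fun x hx => ?_⟩
    by_contra hne'
    -- `x` must lie in the inner region, whose image has small `rad ∘ h⁻¹`
    have hxin : S.rad (S.hH.symm x) ≤ Real.exp (aseq n + Λseq n) := by
      by_contra hout
      push Not at hout
      exact hne' (by rw [← hFid x hout]; exact hx.symm ▸ rfl)
    have h1 := hsmall (S.hH.symm x) hxin
    have h2 : F x = Φn (S.hH.symm x) := rfl
    rw [← h2, hx] at h1
    exact (not_lt.2 (hρle z₁ hz₁)) h1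
  have hbij : Bijective F :=
    Literature.Topology.IsLocalHomeomorph.bijective_of_forall_existsUnique hFloc hFprop hfib
  have hΦbij : Bijective Φn := by
    have : Φn = F ∘ S.hH := by
      funext y; simp [hF, comp_apply]
    rw [this]
    exact hbij.comp S.hH.bijective
  exact ⟨hΦloc.diffeomorphOfBijective hΦbij⟩

end Global

end Setup

end Literature.Topology.FourManifolds

end


/-!
# Proof of the uniqueness of the smooth branched double quotient `X/conj`

Topic `Topology/FourManifolds`; namespace `Literature.Topology.FourManifolds`. This file
DISCHARGES the named fact `DegtyarevKharlamov2000_conjQuotient_unique` of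
`ConjugationQuotients.lean` (Degtyarev–Kharlamov, Russian Math. Surveys 55 (2000), §3.2 ¶1,
arXiv:math/0004134 p. 14, ll. 21–26: "one can easily see that, up to isotopy, there is a unique
smooth structure on `X/conj` such that the projection `X → X/conj` is a double covering branched
over `ℝX`"), in the diffeomorphism form vendored there.

## The argument (seventeen files, all proved, no named facts)

The print gives no proof ("one can easily see"); the classical mechanism (equivariant tubular
neighbourhoods, Bredon 1972 VI.2) is not available in Mathlib. We prove the diffeomorphism
statement directly, by a **downstairs Whitney-averaging of explicit local solutions with a
logarithmic radial cutoff**: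

1. `ConjugationQuotientsComparison` — the canonical comparison homeomorphism `h : Y₁ → Y₂` over `X`
   is a diffeomorphism OFF the branch locus `B₁ = q₁ '' Fix σ` (it is not smooth across it in
   general).
2. `BranchedModelCalculus`, `ConjugationQuotientsChartPairs`, `ConjugationQuotientsPositivePairs`,
   `BranchedModelPolar`, `ConjugationQuotientsTransitions` — adapted chart pairs at the fixed
   points; in such a pair the comparison map reads `Θh = sqModel ∘ θ ∘ sqModel⁻¹` for the smooth
   `flipIm`-equivariant mixed transition `θ`, and `Θloc (u, w) = (γ u, polarSq (L u) w)` is an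
   explicit smooth local solution (a local diffeomorphism onto its image agreeing with `h` on the
   branch locus); positivity of the pairs, the polar derivative field of `Θh`, and the first-order
   structure of one local solution read in another pair.
3. `ConjugationQuotientsSetup`, `…SmoothAverage` — finitely many positive pairs covering the fixed
   points, a partition of unity, a Whitney embedding `Y₂ ↪ ℝᴺ` with normal retraction, the radial
   function `rad` and the logarithmic cutoff `χ = cut (log rad)`; the averaged map
   `Φ = retr (∑ tᵢ • emb ∘ flocᵢ + t∞ • emb ∘ h)` is smooth.
4. `…LocalBounds`, `…Radial`, `…WeightBounds`, `…Derivative`, `…LimitOperator`, `…Sequences`,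
   `…MainEstimate` — the main estimate: along any sequence of points converging to a branch point,
   with widths `Λₙ → ∞`, the derivative of `Φₙ` read in a pair converges (after extraction) to an
   invertible block-triangular limit operator (`2 × 2` lemma), so `Φₙ` is a local diffeomorphism
   at all points for large `n` (`BranchSeq.exists_good`, `Setup.eventually_allGood`).
5. `…Global` — `Φₙ ∘ h⁻¹` is a proper local homeomorphism of `Y₂` equal to the identity off a
   shrinking neighbourhood of the branch locus, with a singleton fibre in every component; by the
   sheet count (`Literature.Topology.IsLocalHomeomorph.bijective_of_forall_existsUnique`) it is
   bijective, so `Φₙ : Y₁ → Y₂` is a bijective local diffeomorphism, a diffeomorphism.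

## References

* [DegtyarevKharlamov2000] A. Degtyarev, V. Kharlamov, Russian Math. Surveys 55 (2000)
  (arXiv:math/0004134), §3.2 ¶1.
-/

noncomputable section

open scoped Manifold ContDiff
open Set Function

namespace Literature.Topology.FourManifolds

/-- **Degtyarev–Kharlamov 2000, §3.2 ¶1, discharged**: two standard-model branched double
quotients of a compact complex surface by an anti-holomorphic involution are diffeomorphic.
[cite: DegtyarevKharlamov2000, §3.2 ¶1 (arXiv:math/0004134 p. 14, ll. 21–26)] -/
theorem DegtyarevKharlamov2000_conjQuotient_unique_holds :
    DegtyarevKharlamov2000_conjQuotient_unique := by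
  intro X _ _ _ _ _ _ σ hσ _ Y₁ _ _ _ _ _ q₁ Y₂ _ _ _ _ _ q₂ h₁ h₂
  have hσc : Continuous σ := hσ.continuous
  rcases isEmpty_or_nonempty X with hX | hX
  · -- no points: both quotients are empty
    have hY₁ : IsEmpty Y₁ := ⟨fun y => hX.elim (h₁.surjective y).choose⟩
    have hY₂ : IsEmpty Y₂ := ⟨fun y => hX.elim (h₂.surjective y).choose⟩
    exact ⟨{ toEquiv := Equiv.equivOfIsEmpty Y₁ Y₂
             contMDiff_toFun := fun y => hY₁.elim y
             contMDiff_invFun := fun z => hY₂.elim z }⟩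
  · obtain ⟨m, N, ⟨S⟩⟩ := Setup.exists_nonempty h₁ h₂ hσc
    haveI : CompactSpace Y₁ := h₁.compactSpace
    haveI : CompactSpace Y₂ := h₂.compactSpace
    exact S.exists_diffeomorph

end Literature.Topology.FourManifolds

end
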